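import Mathlib
import Literature.MathematicalPhysics.QuantumLattice.FermiRG.FST3GraphClassification
import HarnessLib

/-!
# FST III §2 — proved remarks about skeleton graphs: the legs-parity identity, "two-legged skeleton
# graphs are 1PI", "a DOL graph has at least four loops", the one-bubble wicked ladder is the sunset,
# (rev 2) the Figure-3 clause of Lemma 2.5, (rev 3) Theorem 2.4 itself: `lemma25_holds`, and
# (rev 4) "the wicked ladder is not DOL": all three families of Theorem 2.6 are non-DOL,
# (rev 5) `t = 0`: the external vertex is `≥ 6`-legged and the graph is overlapping,
# (rev 6) `t = 0` classified: fat tadpoles and rings of bubbles (`tZero_classification`)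

Theorem-only companion of `FermiRG/FST3GraphClassification.lean` (FST III = Feldman–Salmhofer–Trubowitz,
CPAM **52** (1999) 273 = arXiv:cond-mat/9705272 [FeldmanSalmhoferTrubowitz1999], Chapter 2). That file
types §2's vocabulary (`FST3.FGraph`, incidence numbers, subgraph legs, `IsSkeleton`, `IsOnePI`,
spanning trees, `IsDOL`, the sunset / multiple sunset / wicked ladder shapes) and the named facts
`FST3.lemma25`, `FST3.theorem26`. Here we PROVE, for those definitions, the elementary remarks the print
makes about them (locators `p000N:Ln` = chunk/line of the TeX render `paper:arxiv-cond-mat_9705272`):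

* `FGraph.subgraphLegs_add_two_mul_card` — the counting identity behind every parity step of §2: for
  a subgraph `(W, M)`, `legs(W, M) + 2|M| = Σ_{v ∈ W} n(v)` (each line of `M` has both ends in `W`);
  hence `FGraph.even_subgraphLegs`: under the standing assumption "all graphs have vertices with even
  incidence number" every subgraph has an even number of legs ("`G₁`, `G₂` and `G'` must all have an
  even number of legs", p0005:L101–103; "If all vertices of `G` have even incidence number, then `G`
  has an even number of external legs", p0004:L24–25 — `FGraph.even_numExt`).
* `FGraph.IsSkeleton.isOnePI` — "If `G` is a two–legged skeleton graph, `G` is one-particle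
  irreducible (1PI). That is, `G` cannot be disconnected by cutting one internal line" (p0004:L33–35):
  if cutting `ℓ` separated `G`, the side `A` of the cut containing one end of `ℓ` would be a proper
  subgraph with `ext(A) + 1` legs, an even number, so `ext(A) = 1` and `A` is two-legged — excluded.
* `FGraph.IsDOL.card_add_three_le` — "by this definition, a DOL graph has to have at least four loops"
  (p0004:L82): the four distinct non-tree lines of Definition 2.1 give `|L(G)| ≥ |V(G)| + 3`, i.e.
  `|L| - |V| + 1 ≥ 4` loops.
* `FGraph.isWickedLadderShape_one_iff` — the wicked ladder with ONE bubble is the sunset (two vertices,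
  `2 + 1 = 3` lines), the degenerate case recorded in the docstring of `IsWickedLadderShape`
  (Figure 12 vs Figure 1).
* (rev 2) the graph-distance balls `S_k = ball v₀ k`, `T_m = ball v_t m` of the proof of Lemma 2.5
  (p0005:L57–77): `mem_ball_succ_iff`, `ball_mono`, the triangle inequality `mem_ball_add`, symmetry
  `mem_ball_comm`, `edist_le_of_mem_ball` / `not_mem_ball_of_lt_edist` ("`v_{k+1} ∉ S_k`"),
  connectivity `isConnectedOn_ball` ("`S_k` is a connected subgraph", L68), the legs of an induced
  subgraph `subgraphLegs_induced` (`= ext(W) + #lines leaving W`), and the parity count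
  `three_le_card_linesBetween_compl` (a vertex set containing one external vertex but not the other is
  left by `≥ 3` lines: `1 + k` legs, even and `≠ 2`, L101–107); whence **the whole Figure-3 clause of
  Lemma 2.5 is PROVED** (`FGraph.lemma25_figure3`: `G₁ ∩ G₂ = ∅`, `G₁`, `G₂` connected, no `G₁–G₂`
  line, `≥ 3` lines from each into `G'`) and the named fact `FST3.lemma25` (licence F-035) is
  EQUIVALENT to its first conclusion, Theorem 2.4 "two-legged skeleton graphs with `t ≥ 2` are DOL"
  (`lemma25_of_theorem24`, `lemma25_iff_theorem24`) — the part still carried as a fact.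

* (rev 3) **THEOREM 2.4 PROVED and the named fact `lemma25` DISCHARGED** (`theorem24_holds`,
  `lemma25_holds : lemma25`): spanning trees of connected vertex sets (`FGraph.exists_tree`,
  `exists_isSpanningTree`); the CHAIN LEMMA `FGraph.isDOL_of_chain` — for `V = P ⊔ Q ⊔ R` with connected
  parts, a line `θ` from `P` to `Q`, two further lines leaving `P`, and three lines between `Q` and
  `R`, the tree `T_P ∪ {θ} ∪ T_Q ∪ {ζ} ∪ T_R` gives rise to two separate overlaps (the common content
  of the "fat lines" of Figures 3, 5, 6, p0006:L30–35); components of `G[M]` (`comp_eq_of_mem`,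
  `isConnectedOn_comp`, `linesBetween_comp_compl`), the parity counts `odd_card_linesBetween_compl`
  (a set holding exactly one external vertex is left by an odd number of lines) and
  `card_linesBetween_compl_of_avoids` (a set holding neither: even, `≠ 2`, `≥ 1`); the sides
  `P₀ = {a} ∪ (components of G − a away from b)`, `S₀` symmetric (`side_spec`); the existence of a good
  middle component by parity (`exists_goodComponent` — the case analysis "`m_k = 1` or `n_k = 1` / all
  `m_b, n_b > 1`" of p0006:L11–28 in the form: otherwise the components touching `P₀` each send `0` or
  `2` lines to `S₀`, an even total, against the odd count); and the assembly `isDOL_of_goodComponent`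
  (`P = P₀ ∪` components away from `S₀`, `Q =` the good component, `R = S₀ ∪` the rest) in one of the
  two orientations (`FGraph.isDOL_of_two_le_edist`). The proof follows the printed one (p0005:L57–
  p0006:L35) with the balls `S_r`, `T_{t-s-1}` replaced by the coarser sides `P₀`, `S₀` (Figure 3 with
  `r = 0`, `s = t - 1` after absorbing the components attached to one side only, p0005:L111–115).

* (rev 4) **"The graph in Figure 11 is DOL, but the one in Figure 12, the wicked ladder, is not"**
  (p0006:L102–103) — `FGraph.IsWickedLadderShape.not_isDOL`; with `IsSunsetShape.not_isDOL` and
  `IsMultipleSunsetShape.not_isDOL` of the statement file, each of the three families of Theorem 2.6 is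
  now PROVED non-DOL (the easy direction of the classification `theorem26`, which stays a named fact).
  Tools: cuts of a spanning tree (`IsSpanningTree.loopContains_iff` — the loop of `l` contains the tree
  line `θ` iff the ends of `l` lie on different sides of `T − θ`; `loopContains_self`,
  `not_joins_of_ne` — a spanning tree has no parallel lines, `card_add_one_ge_of_connects` — a line set
  connecting `V` has `≥ |V| − 1` lines) and a discrete intermediate value theorem around the cycle
  `u₀ u₁ ⋯ uₙ u₀` (`exists_step_of_not_iff`, `exists_second_step`): a spanning tree of the ladder takes
  one line from `n` of the `n + 1` gaps of the cycle; the cut of a tree line is crossed exactly by the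
  lines of its own gap and of the free gap; so a line whose loop contains `ζ` but not `θ` is parallel
  to `ζ`, and a gap holds at most two lines — no `k₁ ≠ k₂`.

* (rev 5) **both external legs at ONE vertex (`t = 0`, Flag 1 of the statement file; the alternative
  "has only one external vertex" of Theorem 3.11, p0016:L171–176).** For a two-legged skeleton graph
  with even incidence numbers and `ext a = 2`: every nonempty vertex set not containing `a` is left by
  `≥ 4` lines (`FGraph.four_le_card_linesBetween_compl_of_ext_eq_two`, the `t = 0` twin of
  `three_le_card_linesBetween_compl`); hence the external vertex is at least six-legged
  (`six_le_incidence_of_ext_eq_two`) — **no graph carrying both external legs at a four-legged vertex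
  is a skeleton** (`not_isSkeleton_of_incidence_eq_four`: the `t = 0` graphs outside Theorem 2.6 need a
  fat external vertex, i.e. occur among the quotient graphs `G̃(φ)` of §3, not among bare graphs); a
  graph with two vertices is never DOL ("the graph has to have at least three vertices", p0004:L83–85:
  `IsDOL.three_le_card`, `not_isDOL_of_card_le_two` of the statement file — Flag 1's fat tadpoles); and
  **"Otherwise, `G` is overlapping"** (the `t_G̃ = 0` case in the proof of Theorem 3.11, p0018:L54–57) is PROVED: `isOverlapping_of_ext_eq_two` — for every spanning tree and every tree
  line `θ`, at least three non-tree lines cross the cut of `θ` on the side away from `a`.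

* (rev 6) **THE `t = 0` CLASS IS CLASSIFIED** (`FGraph.tZero_classification`; not in the print, which
  does not need it): a non-DOL two-legged skeleton graph with even incidence numbers and both external
  legs at one vertex has exactly two vertices (a fat tadpole `a =2m= c`, `2m ≥ 4`), or every vertex is
  joined to exactly two other vertices by exactly two lines each (`lineCount = 2, 2`, all other
  `lineCount = 0`): self-contractions apart, a RING OF BUBBLES through the external vertex — Flag 1 of
  the statement file is exhaustive. Route (all for the typed Definition 2.1): every cut of a `t = 0`
  skeleton has `≥ 4` lines and even size (`four_le_card_linesBetween_compl'`,
  `even_card_linesBetween_compl`), so every tree line is crossed by `≥ 3` non-tree lines, an odd number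
  (`exists_three_loopContains`, `odd_card_filter_loopContains`); `¬`DOL in usable form: two distinct
  non-tree lines crossing a tree line `ζ` cannot both avoid another tree line `θ`
  (`loopContains_of_not_isDOL`); two vertices are separated by some tree cut
  (`IsSpanningTree.exists_separating`); leaf cuts (`IsSpanningTree.loopContains_leaf_iff`); hence NO CUT
  VERTEX (`isConnectedOn_compl_singleton_of_not_isDOL`), spanning trees with a prescribed leaf line
  (`exists_isSpanningTree_leaf`), a second leaf by the handshake count (`IsSpanningTree.exists_leaf_ne`),
  AT MOST TWO PARALLEL LINES (`parallel_le_two`), the local structure "a bubble to `w` plus one more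
  line" at every vertex (`local_lines`), and the exclusion of two single lines by a parity count across
  a separating tree line (`no_single_lines`), giving `tZero_local_ring`. The two rev-5 restatements of
  the statement file's `IsDOL.three_le_card` / `not_isDOL_of_card_le_two` were removed (unreferenced).

No definitions, no named facts, no `sorry`; nothing about any model is asserted.
-/

namespace Literature.MathematicalPhysics.QuantumLattice.FermiRG

namespace FST3

namespace FGraph

universe u v

variable {V : Type u} {L : Type v}

open Finset

/-! ### Counting: ends of a line inside a vertex set, legs of a subgraph -/

/-- The number of ends of `l` in `W` is the sum over `v ∈ W` of the number of ends of `l` at `v`.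
[cite: FeldmanSalmhoferTrubowitz1999, §2 p0004:L17-21] -/
theorem endsIn_eq_sum_endsAt [DecidableEq V] (G : FGraph V L) (W : Finset V) (l : L) :
    G.endsIn W l = ∑ v ∈ W, G.endsAt l v := by
  simp only [endsIn, endsAt, Finset.sum_add_distrib, Finset.sum_ite_eq]

/-- `Σ_{v ∈ W} n(v) = ext(W) + Σ_l #(ends of l in W)`. [cite: FeldmanSalmhoferTrubowitz1999, §2 p0004:L17-25] -/
theorem sum_incidence_eq [Fintype L] [DecidableEq V] (G : FGraph V L) (W : Finset V) :
    ∑ v ∈ W, G.incidence v = (∑ v ∈ W, G.ext v) + ∑ l, G.endsIn W l := by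
  simp only [incidence, Finset.sum_add_distrib, endsIn_eq_sum_endsAt]
  rw [Finset.sum_comm]

/-- A line of the subgraph `(W, M)` has both ends in `W`. [cite: FeldmanSalmhoferTrubowitz1999, §2 p0004:L31-32] -/
theorem IsSubgraph.endsIn_eq_two [DecidableEq V] {G : FGraph V L} {W : Finset V} {M : Finset L}
    (h : G.IsSubgraph W M) {l : L} (hl : l ∈ M) : G.endsIn W l = 2 := by
  obtain ⟨h1, h2⟩ := h l hl
  simp [endsIn, h1, h2]

/-- **The legs-counting identity**: for a subgraph `(W, M)` of `G`,
`legs(W, M) + 2·|M| = Σ_{v ∈ W} n(v)` — every line of `M` contributes its two ends to the incidence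
numbers of `W` and nothing to the legs; every other line end in `W` is a leg.
[cite: FeldmanSalmhoferTrubowitz1999, §2 p0005:L101-105] -/
theorem subgraphLegs_add_two_mul_card [Fintype L] [DecidableEq V] [DecidableEq L] (G : FGraph V L)
    {W : Finset V} {M : Finset L} (h : G.IsSubgraph W M) :
    G.subgraphLegs W M + 2 * M.card = ∑ v ∈ W, G.incidence v := by
  rw [sum_incidence_eq, subgraphLegs]
  have hsplit : ∑ l, G.endsIn W l = (∑ l ∈ Finset.univ \ M, G.endsIn W l) + ∑ l ∈ M, G.endsIn W l :=
    (Finset.sum_sdiff (Finset.subset_univ M)).symm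
  have hM : ∑ l ∈ M, G.endsIn W l = 2 * M.card := by
    rw [Finset.sum_congr rfl fun l hl => h.endsIn_eq_two hl, Finset.sum_const, smul_eq_mul, mul_comm]
  rw [hsplit, hM]
  ring

/-- Under the standing even-incidence assumption every subgraph has an even number of legs ("all
vertices of `G` have an even number of legs, so `G₁`, `G₂` and `G'` must all have an even number of
legs", p0005:L101–103). [cite: FeldmanSalmhoferTrubowitz1999, Lemma 2.5 (proof) p0005:L101-103] -/
theorem even_subgraphLegs [Fintype L] [DecidableEq V] [DecidableEq L] {G : FGraph V L}
    (hev : G.EvenIncidence) {W : Finset V} {M : Finset L} (h : G.IsSubgraph W M) :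
    Even (G.subgraphLegs W M) := by
  have hsum : Even (∑ v ∈ W, G.incidence v) :=
    even_iff_two_dvd.mpr (Finset.dvd_sum fun v _ => even_iff_two_dvd.mp (hev v))
  rw [← G.subgraphLegs_add_two_mul_card h, Nat.even_add] at hsum
  exact hsum.mpr (even_two_mul _)

/-- The whole graph `(V(G), L(G))` has `E(G)` legs. [cite: FeldmanSalmhoferTrubowitz1999, §2 p0004:L24-25] -/
theorem subgraphLegs_univ [Fintype V] [Fintype L] [DecidableEq V] [DecidableEq L] (G : FGraph V L) :
    G.subgraphLegs Finset.univ Finset.univ = G.numExt := by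
  simp [subgraphLegs, numExt]

/-- "If all vertices of `G` have even incidence number, then `G` has an even number of external legs"
(p0004:L24–25). [cite: FeldmanSalmhoferTrubowitz1999, §2 p0004:L24-25] -/
theorem even_numExt [Fintype V] [Fintype L] [DecidableEq V] [DecidableEq L] {G : FGraph V L}
    (hev : G.EvenIncidence) : Even G.numExt := by
  rw [← G.subgraphLegs_univ]
  exact even_subgraphLegs hev fun l _ => ⟨Finset.mem_univ _, Finset.mem_univ _⟩

/-! ### Two-legged skeleton graphs are one-particle irreducible (p0004:L33–35) -/

/-- Reachability through a set of lines is monotone in the set. [cite: FeldmanSalmhoferTrubowitz1999, §2 p0004:L33-35] -/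
theorem Reachable.mono {G : FGraph V L} {S S' : Finset L} (hSS' : S ⊆ S') {v w : V}
    (h : G.Reachable S v w) : G.Reachable S' v w := by
  induction h with
  | refl => exact Relation.ReflTransGen.refl
  | tail _ hxy ih =>
    obtain ⟨l, hl, hj⟩ := hxy
    exact Relation.ReflTransGen.tail ih ⟨l, hSS' hl, hj⟩

/-- `Joins` is symmetric in the two vertices. [cite: FeldmanSalmhoferTrubowitz1999, §2 p0004:L17-19] -/
theorem Joins.symm {G : FGraph V L} {l : L} {v w : V} (h : G.Joins l v w) : G.Joins l w v := by
  rcases h with ⟨h1, h2⟩ | ⟨h1, h2⟩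
  · exact Or.inr ⟨h1, h2⟩
  · exact Or.inl ⟨h1, h2⟩

/-- **Two-legged skeleton graphs are 1PI** (p0004:L33–35: "If `G` is a two–legged skeleton graph, `G`
is one-particle irreducible (1PI). That is, `G` cannot be disconnected by cutting one internal line"),
under the standing even-incidence assumption (p0004:L26). Proof: if cutting `ℓ` disconnects `v` from
`w`, let `A` be the set of vertices reachable from `v` without `ℓ`; every other line has both or no ends
in `A`, and `ℓ` has exactly one (else `A` would be closed under all lines and contain `w`), so the
subgraph `(A, lines inside A)` has `ext(A) + 1` legs; this number is even, `ext(A) ≤ E(G) = 2`, hence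
`ext(A) = 1` and `A` is a proper two-legged subgraph — impossible in a skeleton graph.
[cite: FeldmanSalmhoferTrubowitz1999, §2 p0004:L33-35] -/
theorem IsSkeleton.isOnePI [Fintype V] [Fintype L] [DecidableEq V] [DecidableEq L] {G : FGraph V L}
    (hev : G.EvenIncidence) (h2 : G.IsTwoLegged) (hsk : G.IsSkeleton) : G.IsOnePI := by
  classical
  refine ⟨hsk.1, fun l v w => ?_⟩
  by_contra hvw
  -- the side of the cut containing `v`
  set A : Finset V := Finset.univ.filter fun x => G.Reachable (Finset.univ.erase l) v x with hA
  have hvA : v ∈ A := by simp [hA, Reachable, Relation.ReflTransGen.refl]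
  have hwA : w ∉ A := by simpa [hA] using hvw
  -- closure of `A` under every line other than `l`
  have hclosed : ∀ l' : L, l' ≠ l → ∀ x y : V, G.Joins l' x y → x ∈ A → y ∈ A := by
    intro l' hl' x y hj hx
    simp only [hA, Finset.mem_filter, Finset.mem_univ, true_and] at hx ⊢
    exact Relation.ReflTransGen.tail hx ⟨l', Finset.mem_erase.mpr ⟨hl', Finset.mem_univ _⟩, hj⟩
  have hclosed_iff : ∀ l' : L, l' ≠ l → (G.fst l' ∈ A ↔ G.snd l' ∈ A) := fun l' hl' =>
    ⟨hclosed l' hl' _ _ (Or.inl ⟨rfl, rfl⟩), hclosed l' hl' _ _ (Or.inr ⟨rfl, rfl⟩)⟩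
  -- `l` has exactly one end in `A`
  have hl_one : ¬ (G.fst l ∈ A ↔ G.snd l ∈ A) := by
    intro hiff
    -- then `A` is closed under all lines, and `w`, reachable from `v` in `G`, lies in `A`
    have hall : ∀ x y : V, G.Adj Finset.univ x y → x ∈ A → y ∈ A := by
      rintro x y ⟨l', -, hj⟩ hx
      by_cases hl' : l' = l
      · subst hl'
        rcases hj with ⟨h1, h2⟩ | ⟨h1, h2⟩
        · rw [← h2]; rw [← h1] at hx; exact hiff.mp hx
        · rw [← h1]; rw [← h2] at hx; exact hiff.mpr hx
      · exact hclosed l' hl' x y hj hx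
    have key : ∀ y : V, G.Reachable Finset.univ v y → y ∈ A := by
      intro y hy
      induction hy with
      | refl => exact hvA
      | tail _ hxy ih => exact hall _ _ hxy ih
    exact hwA (key w (hsk.1 v w))
  have hendsl : G.endsIn A l = 1 := by
    unfold endsIn
    by_cases h1 : G.fst l ∈ A
    · have h2' : G.snd l ∉ A := fun h2' => hl_one ⟨fun _ => h2', fun _ => h1⟩
      simp [h1, h2']
    · have h2' : G.snd l ∈ A := by
        by_contra h2'
        exact hl_one ⟨fun h => absurd h h1, fun h => absurd h h2'⟩
      simp [h1, h2']
  -- the subgraph `(A, lines inside A)` and its legs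
  have hsub : G.IsSubgraph A (G.induced A) := fun l' hl' => by
    simpa [induced] using hl'
  have hl_not : l ∉ G.induced A := by
    intro hl
    have := hsub l hl
    exact hl_one ⟨fun _ => this.2, fun _ => this.1⟩
  have hothers : ∀ l' ∈ Finset.univ \ G.induced A, l' ≠ l → G.endsIn A l' = 0 := by
    intro l' hl' hne
    have hiff := hclosed_iff l' hne
    have hnot : ¬ (G.fst l' ∈ A ∧ G.snd l' ∈ A) := by
      simpa [induced] using hl'
    have h1 : G.fst l' ∉ A := fun h1 => hnot ⟨h1, hiff.mp h1⟩
    have h2' : G.snd l' ∉ A := fun h2' => h1 (hiff.mpr h2')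
    simp [endsIn, h1, h2']
  have hlegs : G.subgraphLegs A (G.induced A) = (∑ x ∈ A, G.ext x) + 1 := by
    unfold subgraphLegs
    congr 1
    rw [Finset.sum_eq_single_of_mem l (by simpa using hl_not) hothers, hendsl]
  -- parity: `ext(A) + 1` is even, and `ext(A) ≤ E(G) = 2`, so `ext(A) = 1`
  have heven : Even ((∑ x ∈ A, G.ext x) + 1) := hlegs ▸ even_subgraphLegs hev hsub
  have hle : (∑ x ∈ A, G.ext x) ≤ 2 := by
    calc (∑ x ∈ A, G.ext x) ≤ ∑ x, G.ext x := Finset.sum_le_sum_of_subset (Finset.subset_univ A)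
      _ = 2 := h2
  have hext : (∑ x ∈ A, G.ext x) = 1 := by
    rcases Nat.even_add_one.mp heven |> Nat.not_even_iff_odd.mp with ⟨k, hk⟩
    omega
  -- `A` is a proper two-legged subgraph: contradiction with the skeleton property
  have hproper : A ≠ Finset.univ := fun hAu => hwA (hAu ▸ Finset.mem_univ w)
  exact hsk.2.2.2 A (G.induced A) hsub (Or.inl hproper) (by rw [hlegs, hext])

/-! ### DOL graphs have at least four loops (p0004:L82) -/

/-- "Since by this definition, a DOL graph has to have at least four loops" (p0004:L82): the four
distinct non-tree lines `ℓ₁, ℓ₂, k₁, k₂` of Definition 2.1 together with the `|V| - 1` tree lines give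
`|L(G)| ≥ |V(G)| + 3`, i.e. loop number `|L| - |V| + 1 ≥ 4`.
[cite: FeldmanSalmhoferTrubowitz1999, Def 2.1 p0004:L82] -/
theorem IsDOL.card_add_three_le [Fintype V] [Fintype L] [DecidableEq L] {G : FGraph V L}
    (h : G.IsDOL) : Fintype.card V + 3 ≤ Fintype.card L := by
  obtain ⟨T, ⟨_, hcard⟩, θ, _, ζ, _, _, l₁, l₂, k₁, k₂, hl₁, hl₂, hk₁, hk₂, h12, h13, h14, h23, h24,
    h34, _⟩ := h
  have hS : ({l₁, l₂, k₁, k₂} : Finset L).card = 4 := by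
    rw [Finset.card_insert_of_notMem (by simp [h12, h13, h14]),
      Finset.card_insert_of_notMem (by simp [h23, h24]), Finset.card_pair h34]
  have hdisj : Disjoint T ({l₁, l₂, k₁, k₂} : Finset L) := by
    rw [Finset.disjoint_iff_ne]
    rintro x hx y hy rfl
    simp only [Finset.mem_insert, Finset.mem_singleton] at hy
    rcases hy with rfl | rfl | rfl | rfl
    · exact hl₁ hx
    · exact hl₂ hx
    · exact hk₁ hx
    · exact hk₂ hx
  have hle := Finset.card_le_univ (T ∪ {l₁, l₂, k₁, k₂})
  rw [Finset.card_union_of_disjoint hdisj, hS] at hle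
  omega

/-! ### The wicked ladder with one bubble is the sunset -/

/-- The degenerate case `n = 1` of the wicked-ladder shape is exactly the sunset shape (two vertices
`a ≠ b` joined by `2 + 1 = 3` lines; Figure 12 with one bubble vs Figure 1).
[cite: FeldmanSalmhoferTrubowitz1999, §2.2 (Figures 1, 12) p0006:L44-46] -/
theorem isWickedLadderShape_one_iff [Fintype V] [Fintype L] [DecidableEq V] (G : FGraph V L)
    (a b : V) : G.IsWickedLadderShape a b 1 ↔ G.IsSunsetShape a b := by
  constructor
  · rintro ⟨u, hbij, h0, h1, hcount⟩
    have hlast : Fin.last 1 = 1 := rfl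
    have hab : a ≠ b := by
      rw [← h0, ← h1, hlast]
      exact fun h => absurd (hbij.1 h) (by decide)
    refine ⟨hab, ?_, ?_⟩
    · ext x
      simp only [Finset.mem_univ, Finset.mem_insert, Finset.mem_singleton, true_iff]
      obtain ⟨i, rfl⟩ := hbij.2 x
      fin_cases i
      · exact Or.inl h0
      · exact Or.inr h1
    · have h1' : u 1 = b := hlast ▸ h1
      have := hcount 0 1 (by decide)
      rw [h0, h1'] at this
      simpa [hlast] using this
  · rintro ⟨hab, huniv, hcount⟩
    refine ⟨fun i => if i = 0 then a else b, ⟨?_, ?_⟩, by simp, by simp [show Fin.last 1 = 1 from rfl],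
      ?_⟩
    · intro i j hij
      fin_cases i <;> fin_cases j
      · rfl
      · simp at hij; exact absurd hij hab
      · simp at hij; exact absurd hij.symm hab
      · rfl
    · intro x
      have hx : x ∈ ({a, b} : Finset V) := huniv ▸ Finset.mem_univ x
      simp only [Finset.mem_insert, Finset.mem_singleton] at hx
      rcases hx with rfl | rfl
      · exact ⟨0, by simp⟩
      · exact ⟨1, by simp⟩
    · intro i j hij
      fin_cases i <;> fin_cases j
      · simp at hij
      · simpa [show Fin.last 1 = 1 from rfl] using hcount
      · simp at hij
      · simp at hij


/-! ### Balls, graph distance, and the Figure-3 clause of Lemma 2.5 (p0005:L57–107), proved -/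

section Ball

variable [Fintype V] [Fintype L] [DecidableEq V] (G : FGraph V L)

/-- Membership in one ball step. [cite: FeldmanSalmhoferTrubowitz1999, Lemma 2.5 (proof) p0005:L57-67] -/
theorem mem_ballStep_iff {B : Finset V} {x : V} :
    x ∈ G.ballStep B ↔ x ∈ B ∨ ∃ u ∈ B, ∃ l : L, G.Joins l u x := by
  simp [ballStep]

/-- `S_0` is the vertex `v₀` ("If `k = 0`, `S_k` is the vertex `v₀`", p0005:L69–70).
[cite: FeldmanSalmhoferTrubowitz1999, Lemma 2.5 (proof) p0005:L69-70] -/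
theorem ball_zero (v : V) : G.ball v 0 = {v} := rfl

/-- The ball of radius `n + 1` is one step from the ball of radius `n`.
[cite: FeldmanSalmhoferTrubowitz1999, Lemma 2.5 (proof) p0005:L63-67] -/
theorem ball_succ (v : V) (n : ℕ) : G.ball v (n + 1) = G.ballStep (G.ball v n) := by
  rw [ball, Function.iterate_succ_apply']
  rfl

/-- Membership in the ball of radius `n + 1`. [cite: FeldmanSalmhoferTrubowitz1999, Lemma 2.5 (proof) p0005:L63-67] -/
theorem mem_ball_succ_iff {v x : V} {n : ℕ} :
    x ∈ G.ball v (n + 1) ↔ x ∈ G.ball v n ∨ ∃ u ∈ G.ball v n, ∃ l : L, G.Joins l u x := by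
  rw [ball_succ, mem_ballStep_iff]

/-- Balls are monotone in the radius. [cite: FeldmanSalmhoferTrubowitz1999, Lemma 2.5 (proof) p0005:L63-65] -/
theorem ball_mono (v : V) {m n : ℕ} (h : m ≤ n) : G.ball v m ⊆ G.ball v n := by
  induction h with
  | refl => exact subset_rfl
  | step _ ih => exact ih.trans (G.ball_subset_ball_succ v _)

/-- A vertex joined by a line to the ball of radius `n` lies in the ball of radius `n + 1`.
[cite: FeldmanSalmhoferTrubowitz1999, Lemma 2.5 (proof) p0005:L63-67] -/
theorem mem_ball_succ_of_joins {v u x : V} {n : ℕ} (hu : u ∈ G.ball v n) {l : L}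
    (hl : G.Joins l u x) : x ∈ G.ball v (n + 1) :=
  G.mem_ball_succ_iff.mpr (Or.inr ⟨u, hu, l, hl⟩)

/-- Concatenation of walks: the triangle inequality for balls.
[cite: FeldmanSalmhoferTrubowitz1999, Lemma 2.5 (proof) p0005:L95-99] -/
theorem mem_ball_add {v x y : V} {m n : ℕ} (hx : x ∈ G.ball v m) (hy : y ∈ G.ball x n) :
    y ∈ G.ball v (m + n) := by
  induction n generalizing y with
  | zero =>
    rw [ball_zero, Finset.mem_singleton] at hy
    subst hy
    simpa using hx
  | succ n ih =>
    rcases G.mem_ball_succ_iff.mp hy with hy' | ⟨u, hu, l, hl⟩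
    · exact G.ball_subset_ball_succ v (m + n) (ih hy')
    · exact G.mem_ball_succ_of_joins (ih hu) hl

/-- Walks can be reversed: `x ∈ ball v n ↔ v ∈ ball x n` (one direction).
[cite: FeldmanSalmhoferTrubowitz1999, Lemma 2.5 (proof) p0005:L72-77] -/
theorem mem_ball_comm {v x : V} {n : ℕ} (h : x ∈ G.ball v n) : v ∈ G.ball x n := by
  induction n generalizing x with
  | zero =>
    rw [ball_zero, Finset.mem_singleton] at h
    subst h
    exact G.mem_ball_self _ 0
  | succ n ih =>
    rcases G.mem_ball_succ_iff.mp h with h' | ⟨u, hu, l, hl⟩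
    · exact G.ball_subset_ball_succ x n (ih h')
    · have hux : u ∈ G.ball x 1 := G.mem_ball_succ_of_joins (G.mem_ball_self x 0) hl.symm
      have hv : v ∈ G.ball x (1 + n) := G.mem_ball_add hux (ih hu)
      rwa [Nat.add_comm] at hv

/-- `b ∈ ball a n` bounds the distance: `edist a b ≤ n`. [cite: FeldmanSalmhoferTrubowitz1999, §2.1 p0005:L29-37] -/
theorem edist_le_of_mem_ball {a b : V} {n : ℕ} (h : b ∈ G.ball a n) : G.edist a b ≤ n :=
  Nat.sInf_le h

/-- Below the distance the balls miss the target: `n < edist a b → b ∉ ball a n` ("`v_{k+1} ∉ S_k`").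
[cite: FeldmanSalmhoferTrubowitz1999, Lemma 2.5 (proof) p0005:L71] -/
theorem not_mem_ball_of_lt_edist {a b : V} {n : ℕ} (h : n < G.edist a b) : b ∉ G.ball a n :=
  fun hb => absurd (G.edist_le_of_mem_ball hb) (not_le.mpr h)

/-- If `b` can be reached from `a` at all, it lies in the ball of radius `edist a b`.
[cite: FeldmanSalmhoferTrubowitz1999, §2.1 p0005:L29-37] -/
theorem mem_ball_edist {a b : V} (h : ∃ n, b ∈ G.ball a n) : b ∈ G.ball a (G.edist a b) :=
  Nat.sInf_mem h

/-- **Lemma 2.5, `G₁ ∩ G₂ = ∅`** ("they are disjoint by minimality of `θ` and because `r + t-s-1 < t-1`",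
p0005:L84–85): balls about `a` and `b` whose radii sum to less than `edist a b` are disjoint.
[cite: FeldmanSalmhoferTrubowitz1999, Lemma 2.5 (proof) p0005:L84-87] -/
theorem disjoint_ball_of_lt_edist {a b : V} {r m : ℕ} (h : r + m < G.edist a b) :
    Disjoint (G.ball a r) (G.ball b m) := by
  rw [Finset.disjoint_left]
  intro x hxa hxb
  exact G.not_mem_ball_of_lt_edist h (G.mem_ball_add hxa (G.mem_ball_comm hxb))

omit [Fintype V] in
/-- `linesBetween` is symmetric. [cite: FeldmanSalmhoferTrubowitz1999, Lemma 2.5 (proof) p0005:L92-95] -/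
theorem linesBetween_comm (W₁ W₂ : Finset V) : G.linesBetween W₁ W₂ = G.linesBetween W₂ W₁ := by
  ext l
  simp only [linesBetween, Finset.mem_filter, Finset.mem_univ, true_and]
  exact Or.comm

/-- **Lemma 2.5, no line joins `G₁` to `G₂`** ("by minimality of `θ`, there can be no line that connects
a vertex in `G₁` to a vertex in `G₂` (if there were such a line, it could be used to make a path of
length strictly less than `t` between `v₀` and `v_t`)", p0005:L95–99).
[cite: FeldmanSalmhoferTrubowitz1999, Lemma 2.5 (proof) p0005:L95-99] -/
theorem linesBetween_ball_eq_empty {a b : V} {r m : ℕ} (h : r + m + 1 < G.edist a b) :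
    G.linesBetween (G.ball a r) (G.ball b m) = ∅ := by
  rw [Finset.eq_empty_iff_forall_notMem]
  intro l hl
  simp only [linesBetween, Finset.mem_filter, Finset.mem_univ, true_and] at hl
  rcases hl with ⟨h1, h2⟩ | ⟨h1, h2⟩
  · have hs : G.snd l ∈ G.ball a (r + 1) := G.mem_ball_succ_of_joins h1 (Or.inl ⟨rfl, rfl⟩)
    have hb : b ∈ G.ball a (r + 1 + m) := G.mem_ball_add hs (G.mem_ball_comm h2)
    exact G.not_mem_ball_of_lt_edist (by omega) hb
  · have hs : G.fst l ∈ G.ball a (r + 1) := G.mem_ball_succ_of_joins h2 (Or.inr ⟨rfl, rfl⟩)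
    have hb : b ∈ G.ball a (r + 1 + m) := G.mem_ball_add hs (G.mem_ball_comm h1)
    exact G.not_mem_ball_of_lt_edist (by omega) hb

omit [Fintype V] in
/-- `induced` is monotone in the vertex set. [cite: FeldmanSalmhoferTrubowitz1999, Lemma 2.5 (proof) p0005:L66-67] -/
theorem induced_mono {W W' : Finset V} (h : W ⊆ W') : G.induced W ⊆ G.induced W' := by
  intro l hl
  simp only [induced, Finset.mem_filter, Finset.mem_univ, true_and] at hl ⊢
  exact ⟨h hl.1, h hl.2⟩

/-- Every vertex of `S_n` is joined to `v₀` inside `S_n` ("Obviously, `S_k` is a connected subgraph of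
`G` that contains `v₀`", p0005:L68–69). [cite: FeldmanSalmhoferTrubowitz1999, Lemma 2.5 (proof) p0005:L68-69] -/
theorem reachable_induced_ball {v x : V} {n : ℕ} (h : x ∈ G.ball v n) :
    G.Reachable (G.induced (G.ball v n)) v x := by
  induction n generalizing x with
  | zero =>
    rw [ball_zero, Finset.mem_singleton] at h
    subst h
    exact Relation.ReflTransGen.refl
  | succ n ih =>
    have hmono : G.induced (G.ball v n) ⊆ G.induced (G.ball v (n + 1)) :=
      G.induced_mono (G.ball_subset_ball_succ v n)
    rcases G.mem_ball_succ_iff.mp h with h' | ⟨u, hu, l, hl⟩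
    · exact (ih h').mono hmono
    · refine ((ih hu).mono hmono).tail ⟨l, ?_, hl⟩
      simp only [induced, Finset.mem_filter, Finset.mem_univ, true_and]
      rcases hl with ⟨h1, h2⟩ | ⟨h1, h2⟩
      · rw [h1, h2]; exact ⟨G.ball_subset_ball_succ v n hu, h⟩
      · rw [h1, h2]; exact ⟨h, G.ball_subset_ball_succ v n hu⟩

omit [Fintype V] [Fintype L] [DecidableEq V] in
/-- Reachability through a fixed set of lines is symmetric (lines are unoriented).
[cite: FeldmanSalmhoferTrubowitz1999, §2 p0004:L17-19] -/
theorem Reachable.symm {S : Finset L} {v w : V} (h : G.Reachable S v w) : G.Reachable S w v := by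
  induction h with
  | refl => exact Relation.ReflTransGen.refl
  | tail _ hxy ih =>
    obtain ⟨l, hl, hj⟩ := hxy
    exact Relation.ReflTransGen.head ⟨l, hl, hj.symm⟩ ih

/-- **Lemma 2.5, `G₁` and `G₂` are connected**: every ball is a connected vertex set (`S_k`, `T_m` are
connected subgraphs, p0005:L68–69, L76). [cite: FeldmanSalmhoferTrubowitz1999, Lemma 2.5 p0005:L46] -/
theorem isConnectedOn_ball (v : V) (n : ℕ) : G.IsConnectedOn (G.ball v n) :=
  fun _ hx _ hy => (G.reachable_induced_ball hx).symm.trans (G.reachable_induced_ball hy)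

omit [Fintype V] in
/-- `(W, lines inside W)` is a subgraph. [cite: FeldmanSalmhoferTrubowitz1999, Lemma 2.5 (proof) p0005:L63-67] -/
theorem isSubgraph_induced [DecidableEq L] (W : Finset V) : G.IsSubgraph W (G.induced W) := by
  intro l hl
  simpa [induced] using hl

/-- The legs of the induced subgraph on `W`: the external legs at `W` plus the lines leaving `W`
(each has exactly one end in `W`). [cite: FeldmanSalmhoferTrubowitz1999, Lemma 2.5 (proof) p0005:L92-95] -/
theorem subgraphLegs_induced [DecidableEq L] (W : Finset V) :
    G.subgraphLegs W (G.induced W) = (∑ v ∈ W, G.ext v) + (G.linesBetween W Wᶜ).card := by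
  unfold subgraphLegs
  congr 1
  have h1 : ∀ l ∈ Finset.univ \ G.induced W,
      G.endsIn W l = if l ∈ G.linesBetween W Wᶜ then 1 else 0 := by
    intro l hl
    simp only [Finset.mem_sdiff, Finset.mem_univ, true_and, induced, Finset.mem_filter, not_and] at hl
    simp only [linesBetween, Finset.mem_filter, Finset.mem_univ, true_and, Finset.mem_compl, endsIn]
    by_cases ha : G.fst l ∈ W
    · have hb : G.snd l ∉ W := hl ha
      simp [ha, hb]
    · by_cases hb : G.snd l ∈ W
      · simp [ha, hb]
      · simp [ha, hb]
  rw [Finset.sum_congr rfl h1, ← Finset.card_filter]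
  congr 1
  ext l
  simp only [Finset.mem_filter, Finset.mem_sdiff, Finset.mem_univ, true_and, induced, linesBetween,
    Finset.mem_compl, not_and]
  constructor
  · exact fun h => h.2
  · intro h
    refine ⟨?_, h⟩
    rcases h with ⟨_, h2⟩ | ⟨h1, _⟩
    · exact fun _ => h2
    · exact fun hf => absurd hf h1

omit [Fintype L] in
/-- In a two-legged graph whose external vertices `a ≠ b` carry one leg each, every other vertex
carries none. [cite: FeldmanSalmhoferTrubowitz1999, §2.1 p0005:L29-30] -/
theorem ext_eq_zero_of_ne (h2 : G.IsTwoLegged) {a b : V} (ha : G.ext a = 1) (hb : G.ext b = 1)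
    (hab : a ≠ b) {v : V} (hva : v ≠ a) (hvb : v ≠ b) : G.ext v = 0 := by
  have hsum : ∑ x, G.ext x = 2 := h2
  have hle : ∑ x ∈ ({a, b, v} : Finset V), G.ext x ≤ ∑ x, G.ext x :=
    Finset.sum_le_sum_of_subset (Finset.subset_univ _)
  rw [Finset.sum_insert (by simp [hab, hva.symm]), Finset.sum_pair hvb.symm, ha, hb, hsum] at hle
  omega

/-- **Lemma 2.5, "at least three lines"** ("`G` is 1PI, so `k₁ ≥ 3` and `k₂ ≥ 3`", p0005:L103–106), in
the general form the proof gives: in a two-legged skeleton graph with even incidence numbers and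
external vertices `a ≠ b` (one leg each), every vertex set containing `a` but not `b` is left by at
least three lines — its induced subgraph has `1 + k` legs, an even number different from `2`.
[cite: FeldmanSalmhoferTrubowitz1999, Lemma 2.5 (proof) p0005:L101-107] -/
theorem three_le_card_linesBetween_compl [DecidableEq L] (hev : G.EvenIncidence) (h2 : G.IsTwoLegged)
    {a b : V} (ha : G.ext a = 1) (hb : G.ext b = 1) (hab : a ≠ b) (hsk : G.IsSkeleton) {W : Finset V}
    (haW : a ∈ W) (hbW : b ∉ W) : 3 ≤ (G.linesBetween W Wᶜ).card := by
  have hext : ∑ v ∈ W, G.ext v = 1 := by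
    rw [Finset.sum_eq_single_of_mem a haW fun v hv hva =>
      G.ext_eq_zero_of_ne h2 ha hb hab hva fun h => hbW (h ▸ hv), ha]
  have heven := even_subgraphLegs hev (G.isSubgraph_induced W)
  have hne : G.subgraphLegs W (G.induced W) ≠ 2 :=
    hsk.2.2.2 W _ (G.isSubgraph_induced W) (Or.inl fun h => hbW (h ▸ Finset.mem_univ b))
  rw [subgraphLegs_induced, hext] at heven hne
  rcases heven with ⟨k, hk⟩
  omega

/-- Lines leaving `W` that cannot end in `U` end outside `W ∪ U`.
[cite: FeldmanSalmhoferTrubowitz1999, Lemma 2.5 (proof) p0005:L92-99] -/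
theorem linesBetween_compl_subset {W U : Finset V} (h : G.linesBetween W U = ∅) :
    G.linesBetween W Wᶜ ⊆ G.linesBetween W (W ∪ U)ᶜ := by
  intro l hl
  have hnot : l ∉ G.linesBetween W U := by rw [h]; exact Finset.notMem_empty l
  simp only [linesBetween, Finset.mem_filter, Finset.mem_univ, true_and, Finset.mem_compl,
    Finset.mem_union, not_or] at hl hnot ⊢
  rcases hl with ⟨h1, h2⟩ | ⟨h1, h2⟩
  · exact Or.inl ⟨h1, h2, fun hU => hnot.1 ⟨h1, hU⟩⟩
  · exact Or.inr ⟨⟨h1, fun hU => hnot.2 ⟨hU, h2⟩⟩, h2⟩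

/-- **The Figure-3 clause of Lemma 2.5, PROVED** for the typed definitions (p0005:L43–47 with the proof's
sets `G₁ = S_r = ball a r`, `G₂ = T_{t-s-1} = ball b (t-s-1)`, p0005:L81–107): for a two-legged skeleton
graph with even incidence numbers, external vertices `a`, `b` (one leg each), `t = edist a b ≥ 2`, and
`0 ≤ r < s ≤ t-1`: `G₁ ∩ G₂ = ∅`, `G₁` and `G₂` are connected, no line joins `G₁` to `G₂`, and each of
them is joined to `G' = (G₁ ∪ G₂)ᶜ` by at least three lines. (So the named fact `FST3.lemma25` reduces
to its first conclusion, Theorem 2.4 "`G` is DOL": `lemma25_of_theorem24`.)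
[cite: FeldmanSalmhoferTrubowitz1999, Lemma 2.5 p0005:L43-47] -/
theorem lemma25_figure3 [DecidableEq L] (hev : G.EvenIncidence) (h2 : G.IsTwoLegged) {a b : V}
    (ha : G.ext a = 1) (hb : G.ext b = 1) (hsk : G.IsSkeleton) (ht : 2 ≤ G.edist a b) {r s : ℕ}
    (hrs : r < s) (hst : s + 1 ≤ G.edist a b) :
    Disjoint (G.ball a r) (G.ball b (G.edist a b - s - 1)) ∧
    G.IsConnectedOn (G.ball a r) ∧
    G.IsConnectedOn (G.ball b (G.edist a b - s - 1)) ∧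
    G.linesBetween (G.ball a r) (G.ball b (G.edist a b - s - 1)) = ∅ ∧
    3 ≤ (G.linesBetween (G.ball a r) (G.ball a r ∪ G.ball b (G.edist a b - s - 1))ᶜ).card ∧
    3 ≤ (G.linesBetween (G.ball b (G.edist a b - s - 1))
          (G.ball a r ∪ G.ball b (G.edist a b - s - 1))ᶜ).card := by
  set t := G.edist a b with htdef
  set m := t - s - 1 with hmdef
  have hab : a ≠ b := G.ne_of_edist_pos (by omega)
  have hnone : G.linesBetween (G.ball a r) (G.ball b m) = ∅ :=
    G.linesBetween_ball_eq_empty (by omega)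
  have hbW : b ∉ G.ball a r := G.not_mem_ball_of_lt_edist (by omega)
  have haU : a ∉ G.ball b m := fun h =>
    G.not_mem_ball_of_lt_edist (show m < G.edist a b by omega) (G.mem_ball_comm h)
  refine ⟨G.disjoint_ball_of_lt_edist (by omega), G.isConnectedOn_ball a r, G.isConnectedOn_ball b m,
    hnone, ?_, ?_⟩
  · exact (G.three_le_card_linesBetween_compl hev h2 ha hb hab hsk (G.mem_ball_self a r) hbW).trans
      (Finset.card_le_card (G.linesBetween_compl_subset hnone))
  · have hnone' : G.linesBetween (G.ball b m) (G.ball a r) = ∅ := by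
      rw [linesBetween_comm, hnone]
    have h3 := G.three_le_card_linesBetween_compl hev h2 hb ha hab.symm hsk (G.mem_ball_self b m) haU
    refine h3.trans (Finset.card_le_card ?_)
    rw [Finset.union_comm]
    exact G.linesBetween_compl_subset hnone'

end Ball


/-! ### Spanning trees of connected vertex sets (for the DOL constructions of §2.1) -/

section Trees

variable [Fintype V] [Fintype L] [DecidableEq V] [DecidableEq L] (G : FGraph V L)

omit [Fintype V] [DecidableEq L] in
/-- Membership in `linesBetween` through a pair of joined vertices.
[cite: FeldmanSalmhoferTrubowitz1999, Lemma 2.5 (proof) p0005:L92-95] -/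
theorem mem_linesBetween_iff {W₁ W₂ : Finset V} {l : L} :
    l ∈ G.linesBetween W₁ W₂ ↔ ∃ x ∈ W₁, ∃ y ∈ W₂, G.Joins l x y := by
  simp only [linesBetween, Finset.mem_filter, Finset.mem_univ, true_and]
  constructor
  · rintro (⟨h1, h2⟩ | ⟨h1, h2⟩)
    · exact ⟨_, h1, _, h2, Or.inl ⟨rfl, rfl⟩⟩
    · exact ⟨_, h2, _, h1, Or.inr ⟨rfl, rfl⟩⟩
  · rintro ⟨x, hx, y, hy, ⟨h1, h2⟩ | ⟨h1, h2⟩⟩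
    · exact Or.inl ⟨h1 ▸ hx, h2 ▸ hy⟩
    · exact Or.inr ⟨h1 ▸ hy, h2 ▸ hx⟩

omit [Fintype V] [DecidableEq L] in
/-- Membership in `induced` through a pair of joined vertices.
[cite: FeldmanSalmhoferTrubowitz1999, Lemma 2.5 (proof) p0005:L66-67] -/
theorem mem_induced_iff_of_joins {W : Finset V} {l : L} {x y : V} (h : G.Joins l x y) :
    l ∈ G.induced W ↔ x ∈ W ∧ y ∈ W := by
  simp only [induced, Finset.mem_filter, Finset.mem_univ, true_and]
  rcases h with ⟨h1, h2⟩ | ⟨h1, h2⟩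
  · rw [h1, h2]
  · rw [h1, h2]; exact And.comm

omit [Fintype V] [Fintype L] [DecidableEq V] [DecidableEq L] in
/-- The two ends of a line are determined up to order.
[cite: FeldmanSalmhoferTrubowitz1999, §2 p0004:L17-19] -/
theorem Joins.eq_or_eq {G : FGraph V L} {l : L} {x y x' y' : V} (h : G.Joins l x y)
    (h' : G.Joins l x' y') :
    (x = x' ∧ y = y') ∨ (x = y' ∧ y = x') := by
  rcases h with ⟨h1, h2⟩ | ⟨h1, h2⟩ <;> rcases h' with ⟨h3, h4⟩ | ⟨h3, h4⟩
  · exact Or.inl ⟨h1 ▸ h3, h2 ▸ h4⟩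
  · exact Or.inr ⟨h1 ▸ h3, h2 ▸ h4⟩
  · exact Or.inr ⟨h2 ▸ h4, h1 ▸ h3⟩
  · exact Or.inl ⟨h2 ▸ h4, h1 ▸ h3⟩

omit [Fintype V] [DecidableEq L] in
/-- A walk inside `G[W]` that starts in `W` stays in `W`.
[cite: FeldmanSalmhoferTrubowitz1999, Lemma 2.5 (proof) p0005:L63-67] -/
theorem reachable_induced_mem {W : Finset V} {x y : V} (h : G.Reachable (G.induced W) x y) (hx : x ∈ W) :
    y ∈ W := by
  induction h with
  | refl => exact hx
  | @tail b c _ hbc _ =>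
    obtain ⟨l, hl, hj⟩ := hbc
    exact ((G.mem_induced_iff_of_joins hj).mp hl).2

omit [Fintype V] [DecidableEq L] in
/-- In a connected vertex set `W`, every proper subset `U ∋ v₀` is left by a line of `G[W]`
(growth step for spanning trees). [cite: FeldmanSalmhoferTrubowitz1999, §2.1 p0004:L44-47] -/
theorem exists_crossing {W U : Finset V} (hW : G.IsConnectedOn W) (hUW : U ⊆ W) {v₀ : V}
    (hv₀ : v₀ ∈ U) {w : V} (hw : w ∈ W) (hwU : w ∉ U) :
    ∃ l ∈ G.induced W, ∃ u ∈ U, ∃ x ∈ W, x ∉ U ∧ G.Joins l u x := by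
  suffices key : ∀ y, G.Reachable (G.induced W) v₀ y →
      y ∈ U ∨ ∃ l ∈ G.induced W, ∃ u ∈ U, ∃ x ∈ W, x ∉ U ∧ G.Joins l u x by
    rcases key w (hW v₀ (hUW hv₀) w hw) with h | h
    · exact absurd h hwU
    · exact h
  intro y hy
  induction hy with
  | refl => exact Or.inl hv₀
  | @tail b c _ hbc ih =>
    rcases ih with hbU | hcross
    · obtain ⟨l, hl, hj⟩ := hbc
      by_cases hcU : c ∈ U
      · exact Or.inl hcU
      · exact Or.inr ⟨l, hl, b, hbU, c, ((G.mem_induced_iff_of_joins hj).mp hl).2, hcU, hj⟩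
    · exact Or.inr hcross

omit [Fintype V] in
/-- Spanning-tree growth (induction on the number of missing vertices).
[cite: FeldmanSalmhoferTrubowitz1999, §2.1 p0004:L44-47] -/
theorem exists_tree_aux {W : Finset V} (hW : G.IsConnectedOn W) {v₀ : V} (hv₀ : v₀ ∈ W) :
    ∀ (n : ℕ) (U : Finset V) (T : Finset L), U ⊆ W → v₀ ∈ U → T ⊆ G.induced U →
      (∀ x ∈ U, G.Reachable T v₀ x) → T.card + 1 = U.card → U.card + n = W.card →
      ∃ T' : Finset L, T' ⊆ G.induced W ∧ (∀ x ∈ W, G.Reachable T' v₀ x) ∧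
        T'.card + 1 = W.card := by
  intro n
  induction n with
  | zero =>
    intro U T hUW _ hT hreach hcard hn
    have hUW' : U = W := Finset.eq_of_subset_of_card_le hUW (by omega)
    subst hUW'
    exact ⟨T, hT, hreach, hcard⟩
  | succ n ih =>
    intro U T hUW hv₀U hT hreach hcard hn
    have hne : U ≠ W := fun h => by rw [h] at hn; omega
    obtain ⟨w, hwW, hwU⟩ := Finset.exists_of_ssubset (Finset.ssubset_iff_subset_ne.mpr ⟨hUW, hne⟩)
    obtain ⟨l, hl, u, huU, x, hxW, hxU, hj⟩ := G.exists_crossing hW hUW hv₀U hwW hwU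
    have hlT : l ∉ T := fun hlT =>
      hxU ((G.mem_induced_iff_of_joins hj).mp (hT hlT)).2
    refine ih (insert x U) (insert l T) (Finset.insert_subset hxW hUW)
      (Finset.mem_insert_of_mem hv₀U) ?_ ?_ ?_ ?_
    · intro l' hl'
      rcases Finset.mem_insert.mp hl' with rfl | hl'T
      · exact (G.mem_induced_iff_of_joins hj).mpr
          ⟨Finset.mem_insert_of_mem huU, Finset.mem_insert_self x U⟩
      · exact G.induced_mono (Finset.subset_insert x U) (hT hl'T)
    · intro y hy
      rcases Finset.mem_insert.mp hy with rfl | hyU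
      · exact ((hreach u huU).mono (Finset.subset_insert l T)).tail
          ⟨l, Finset.mem_insert_self l T, hj⟩
      · exact (hreach y hyU).mono (Finset.subset_insert l T)
    · rw [Finset.card_insert_of_notMem hlT, Finset.card_insert_of_notMem hxU, hcard]
    · rw [Finset.card_insert_of_notMem hxU]
      omega

omit [Fintype V] in
/-- **Every connected vertex set has a spanning tree**: `|W| - 1` lines of `G[W]` joining all of `W`
to a root `v₀` ("a subgraph of `G` that is a connected tree and contains all vertices", p0004:L44–45).
[cite: FeldmanSalmhoferTrubowitz1999, §2.1 p0004:L44-47] -/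
theorem exists_tree {W : Finset V} (hW : G.IsConnectedOn W) {v₀ : V} (hv₀ : v₀ ∈ W) :
    ∃ T : Finset L, T ⊆ G.induced W ∧ (∀ x ∈ W, G.Reachable T v₀ x) ∧ T.card + 1 = W.card := by
  have hpos : 0 < W.card := Finset.card_pos.mpr ⟨v₀, hv₀⟩
  refine G.exists_tree_aux hW hv₀ (W.card - 1) {v₀} ∅ (Finset.singleton_subset_iff.mpr hv₀)
    (Finset.mem_singleton_self v₀) (Finset.empty_subset _) ?_ (by simp) ?_
  · intro x hx
    rw [Finset.mem_singleton.mp hx]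
    exact Relation.ReflTransGen.refl
  · rw [Finset.card_singleton]
    omega

omit [DecidableEq L] in
/-- The whole graph is connected iff the vertex set `univ` is.
[cite: FeldmanSalmhoferTrubowitz1999, §2 p0004:L31] -/
theorem isConnectedOn_univ (h : G.IsConnected) : G.IsConnectedOn Finset.univ := by
  intro v _ w _
  have hi : (Finset.univ : Finset L) ⊆ G.induced Finset.univ := fun l _ => by simp [induced]
  exact (h v w).mono hi

/-- A connected graph has a spanning tree in the sense of `IsSpanningTree`.
[cite: FeldmanSalmhoferTrubowitz1999, §2.1 p0004:L44-47] -/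
theorem exists_isSpanningTree [Nonempty V] (h : G.IsConnected) : ∃ T : Finset L, G.IsSpanningTree T := by
  obtain ⟨v₀⟩ := ‹Nonempty V›
  obtain ⟨T, -, hreach, hcard⟩ := G.exists_tree (G.isConnectedOn_univ h) (Finset.mem_univ v₀)
  refine ⟨T, fun v w => (hreach v (Finset.mem_univ v)).symm.trans (hreach w (Finset.mem_univ w)), ?_⟩
  rw [hcard, Finset.card_univ]

end Trees

/-! ### The chain lemma: three connected parts `P | Q | R` give two separate overlaps (Figures 3, 5, 6) -/

section Chain

variable [Fintype V] [Fintype L] [DecidableEq V] [DecidableEq L] (G : FGraph V L)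

omit [Fintype V] [Fintype L] [DecidableEq V] [DecidableEq L] in
/-- If no line of `S` crosses the cut `(P, Pᶜ)`, walks over `S` stay on one side.
[cite: FeldmanSalmhoferTrubowitz1999, §2.1 p0004:L48-53] -/
theorem reachable_mem_iff {S : Finset L} {P : Finset V} (hS : ∀ l ∈ S, (G.fst l ∈ P ↔ G.snd l ∈ P))
    {x y : V} (h : G.Reachable S x y) : (x ∈ P ↔ y ∈ P) := by
  induction h with
  | refl => exact Iff.rfl
  | @tail b c _ hbc ih =>
    obtain ⟨l, hl, hj⟩ := hbc
    have hl' := hS l hl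
    refine ih.trans ?_
    rcases hj with ⟨h1, h2⟩ | ⟨h1, h2⟩
    · rw [h1, h2] at hl'; exact hl'
    · rw [h1, h2] at hl'; exact hl'.symm

/-- **Chain lemma** (the mechanism behind Figures 3, 5 and 6 of Lemma 2.5, "the lines drawn fat are
those in a possible spanning tree, where one can see directly from the definition that the graph is
DOL", p0006:L30–35): let `V(G) = P ⊔ Q ⊔ R` with `G[P]`, `G[Q]`, `G[R]` connected, a line `θ` from `P`
to `Q`, two further lines `ℓ₁ ≠ ℓ₂` leaving `P`, and three distinct lines `ζ, k₁, k₂` between `Q` and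
`R`. Then the spanning tree `T_P ∪ {θ} ∪ T_Q ∪ {ζ} ∪ T_R` gives rise to two separate overlaps: the
loops of `ℓ₁, ℓ₂` contain `θ`, those of `k₁, k₂` contain `ζ` but not `θ`. Hence `G` is DOL.
[cite: FeldmanSalmhoferTrubowitz1999, Lemma 2.5 (proof) p0006:L30-35] -/
theorem isDOL_of_chain {P Q R : Finset V} (hPQ : Disjoint P Q) (hPR : Disjoint P R)
    (hQR : Disjoint Q R) (hcover : P ∪ Q ∪ R = Finset.univ) (hP : G.IsConnectedOn P)
    (hQ : G.IsConnectedOn Q) (hR : G.IsConnectedOn R) {θ ℓ₁ ℓ₂ ζ k₁ k₂ : L}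
    (hθ : θ ∈ G.linesBetween P Q) (hℓ₁ : ℓ₁ ∈ G.linesBetween P Pᶜ) (hℓ₂ : ℓ₂ ∈ G.linesBetween P Pᶜ)
    (h12 : ℓ₁ ≠ ℓ₂) (h1θ : ℓ₁ ≠ θ) (h2θ : ℓ₂ ≠ θ) (hζ : ζ ∈ G.linesBetween Q R)
    (hk₁ : k₁ ∈ G.linesBetween Q R) (hk₂ : k₂ ∈ G.linesBetween Q R) (hk12 : k₁ ≠ k₂)
    (hk1ζ : k₁ ≠ ζ) (hk2ζ : k₂ ≠ ζ) : G.IsDOL := by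
  -- endpoints of θ and ζ
  obtain ⟨p₀, hp₀, q₀, hq₀, hθj⟩ := G.mem_linesBetween_iff.mp hθ
  obtain ⟨q₁, hq₁, r₀, hr₀, hζj⟩ := G.mem_linesBetween_iff.mp hζ
  -- disjointness facts as functions
  have hPQ' : ∀ {x}, x ∈ P → x ∉ Q := fun hx hx' => Finset.disjoint_left.mp hPQ hx hx'
  have hPR' : ∀ {x}, x ∈ P → x ∉ R := fun hx hx' => Finset.disjoint_left.mp hPR hx hx'
  have hQR' : ∀ {x}, x ∈ Q → x ∉ R := fun hx hx' => Finset.disjoint_left.mp hQR hx hx'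
  -- trees
  obtain ⟨TP, hTP, hTPr, hTPc⟩ := G.exists_tree hP hp₀
  obtain ⟨TQ, hTQ, hTQr, hTQc⟩ := G.exists_tree hQ hq₀
  obtain ⟨TR, hTR, hTRr, hTRc⟩ := G.exists_tree hR hr₀
  -- where the tree lines live
  have hTP' : ∀ l ∈ TP, G.fst l ∈ P ∧ G.snd l ∈ P := fun l hl => by
    simpa [induced] using hTP hl
  have hTQ' : ∀ l ∈ TQ, G.fst l ∈ Q ∧ G.snd l ∈ Q := fun l hl => by
    simpa [induced] using hTQ hl
  have hTR' : ∀ l ∈ TR, G.fst l ∈ R ∧ G.snd l ∈ R := fun l hl => by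
    simpa [induced] using hTR hl
  set U : Finset L := TP ∪ TQ ∪ TR with hU
  have hθU : θ ∉ U := by
    intro h
    rcases Finset.mem_union.mp h with h | h
    · rcases Finset.mem_union.mp h with h | h
      · exact hPQ' ((G.mem_induced_iff_of_joins hθj).mp (hTP h)).2 hq₀
      · exact hPQ' hp₀ ((G.mem_induced_iff_of_joins hθj).mp (hTQ h)).1
    · exact hPR' hp₀ ((G.mem_induced_iff_of_joins hθj).mp (hTR h)).1
  have hζU : ζ ∉ U := by
    intro h
    rcases Finset.mem_union.mp h with h | h
    · rcases Finset.mem_union.mp h with h | h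
      · exact hPQ' ((G.mem_induced_iff_of_joins hζj).mp (hTP h)).1 hq₁
      · exact hQR' ((G.mem_induced_iff_of_joins hζj).mp (hTQ h)).2 hr₀
    · exact hQR' hq₁ ((G.mem_induced_iff_of_joins hζj).mp (hTR h)).1
  have hθζ : θ ≠ ζ := by
    rintro rfl
    rcases hθj.eq_or_eq hζj with ⟨h1, _⟩ | ⟨h1, _⟩
    · exact hPQ' hp₀ (h1 ▸ hq₁)
    · exact hPR' hp₀ (h1 ▸ hr₀)
  set S₁ : Finset L := insert ζ U with hS₁
  have hθS₁ : θ ∉ S₁ := by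
    rw [hS₁, Finset.mem_insert, not_or]
    exact ⟨hθζ, hθU⟩
  set T : Finset L := insert θ S₁ with hT
  -- disjointness of the three trees
  have hdPQ : Disjoint TP TQ := Finset.disjoint_left.mpr fun l h1 h2 => hPQ' (hTP' l h1).1 (hTQ' l h2).1
  have hdPR : Disjoint TP TR := Finset.disjoint_left.mpr fun l h1 h2 => hPR' (hTP' l h1).1 (hTR' l h2).1
  have hdQR : Disjoint TQ TR := Finset.disjoint_left.mpr fun l h1 h2 => hQR' (hTQ' l h1).1 (hTR' l h2).1
  have hUcard : U.card = TP.card + TQ.card + TR.card := by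
    rw [hU, Finset.card_union_of_disjoint (Finset.disjoint_union_left.mpr ⟨hdPR, hdQR⟩),
      Finset.card_union_of_disjoint hdPQ]
  have hVcard : Fintype.card V = P.card + Q.card + R.card := by
    rw [← Finset.card_univ, ← hcover,
      Finset.card_union_of_disjoint (Finset.disjoint_union_left.mpr ⟨hPR, hQR⟩),
      Finset.card_union_of_disjoint hPQ]
  -- every vertex reaches p₀ in T
  have hUT : U ⊆ T := (Finset.subset_insert ζ U).trans (Finset.subset_insert θ S₁)
  have hTPT : TP ⊆ T := (Finset.subset_union_left.trans Finset.subset_union_left).trans hUT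
  have hTQT : TQ ⊆ T := (Finset.subset_union_right.trans Finset.subset_union_left).trans hUT
  have hTRT : TR ⊆ T := Finset.subset_union_right.trans hUT
  have hθT : θ ∈ T := Finset.mem_insert_self θ S₁
  have hζT : ζ ∈ T := Finset.mem_insert_of_mem (Finset.mem_insert_self ζ U)
  have hq₀p₀ : G.Reachable T q₀ p₀ := Relation.ReflTransGen.single ⟨θ, hθT, hθj.symm⟩
  have hreach : ∀ v, G.Reachable T v p₀ := by
    intro v
    have hv : v ∈ P ∪ Q ∪ R := hcover ▸ Finset.mem_univ v
    rcases Finset.mem_union.mp hv with hv | hv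
    · rcases Finset.mem_union.mp hv with hv | hv
      · exact ((hTPr v hv).mono hTPT).symm
      · exact ((hTQr v hv).mono hTQT).symm.trans hq₀p₀
    · have h1 : G.Reachable T v r₀ := ((hTRr v hv).mono hTRT).symm
      have h2 : G.Reachable T r₀ q₁ := Relation.ReflTransGen.single ⟨ζ, hζT, hζj.symm⟩
      have h3 : G.Reachable T q₁ q₀ := ((hTQr q₁ hq₁).mono hTQT).symm
      exact h1.trans (h2.trans (h3.trans hq₀p₀))
  have hspan : G.IsSpanningTree T := by
    refine ⟨fun v w => (hreach v).trans (hreach w).symm, ?_⟩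
    rw [hT, Finset.card_insert_of_notMem hθS₁, hS₁, Finset.card_insert_of_notMem hζU, hUcard, hVcard]
    omega
  -- endpoints of the four extra lines
  obtain ⟨x₁, hx₁, y₁, hy₁, hℓ₁j⟩ := G.mem_linesBetween_iff.mp hℓ₁
  obtain ⟨x₂, hx₂, y₂, hy₂, hℓ₂j⟩ := G.mem_linesBetween_iff.mp hℓ₂
  obtain ⟨u₁, hu₁, w₁, hw₁, hk₁j⟩ := G.mem_linesBetween_iff.mp hk₁
  obtain ⟨u₂, hu₂, w₂, hw₂, hk₂j⟩ := G.mem_linesBetween_iff.mp hk₂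
  rw [Finset.mem_compl] at hy₁ hy₂
  -- membership of a line in T, by its ends
  have hmemT : ∀ {l : L} {x y : V}, G.Joins l x y → l ∈ T →
      l = θ ∨ l = ζ ∨ (x ∈ P ∧ y ∈ P) ∨ (x ∈ Q ∧ y ∈ Q) ∨ (x ∈ R ∧ y ∈ R) := by
    intro l x y hj hl
    rcases Finset.mem_insert.mp hl with h | h
    · exact Or.inl h
    rcases Finset.mem_insert.mp h with h | h
    · exact Or.inr (Or.inl h)
    rcases Finset.mem_union.mp h with h | h
    · rcases Finset.mem_union.mp h with h | h
      · exact Or.inr (Or.inr (Or.inl ((G.mem_induced_iff_of_joins hj).mp (hTP h))))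
      · exact Or.inr (Or.inr (Or.inr (Or.inl ((G.mem_induced_iff_of_joins hj).mp (hTQ h)))))
    · exact Or.inr (Or.inr (Or.inr (Or.inr ((G.mem_induced_iff_of_joins hj).mp (hTR h)))))
  -- a line with an end in P and an end outside P, different from θ, is not in T
  have hℓT : ∀ {l : L} {x y : V}, G.Joins l x y → x ∈ P → y ∉ P → l ≠ θ → l ∉ T := by
    intro l x y hj hx hy hne hl
    rcases hmemT hj hl with h | h | ⟨_, h⟩ | ⟨h, _⟩ | ⟨h, _⟩
    · exact hne h
    · subst h
      rcases hj.eq_or_eq hζj with ⟨h1, _⟩ | ⟨h1, _⟩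
      · exact hPQ' hx (h1 ▸ hq₁)
      · exact hPR' hx (h1 ▸ hr₀)
    · exact hy h
    · exact hPQ' hx h
    · exact hPR' hx h
  -- a line between Q and R different from ζ is not in T
  have hkT : ∀ {l : L} {x y : V}, G.Joins l x y → x ∈ Q → y ∈ R → l ≠ ζ → l ∉ T := by
    intro l x y hj hx hy hne hl
    rcases hmemT hj hl with h | h | ⟨h, _⟩ | ⟨_, h⟩ | ⟨h, _⟩
    · subst h
      rcases hj.eq_or_eq hθj with ⟨h1, _⟩ | ⟨_, h2⟩
      · exact hPQ' hp₀ (h1 ▸ hx)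
      · exact hPR' hp₀ (h2 ▸ hy)
    · exact hne h
    · exact hPQ' h hx
    · exact hQR' h hy
    · exact hQR' hx h
  have hQP : ∀ {x}, x ∈ Q → x ∉ P := fun hx hx' => hPQ' hx' hx
  have hRP : ∀ {x}, x ∈ R → x ∉ P := fun hx hx' => hPR' hx' hx
  have hRQ : ∀ {x}, x ∈ R → x ∉ Q := fun hx hx' => hQR' hx' hx
  -- no line of `S₁ = T - θ` crosses the cut `(P, Pᶜ)`
  have hS₁noP : ∀ l ∈ S₁, (G.fst l ∈ P ↔ G.snd l ∈ P) := by
    intro l hl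
    rcases Finset.mem_insert.mp hl with rfl | hl
    · rcases hζj with ⟨h1, h2⟩ | ⟨h1, h2⟩
      · rw [h1, h2]; exact iff_of_false (hQP hq₁) (hRP hr₀)
      · rw [h1, h2]; exact iff_of_false (hRP hr₀) (hQP hq₁)
    rcases Finset.mem_union.mp hl with hl | hl
    · rcases Finset.mem_union.mp hl with hl | hl
      · exact iff_of_true (hTP' l hl).1 (hTP' l hl).2
      · exact iff_of_false (hQP (hTQ' l hl).1) (hQP (hTQ' l hl).2)
    · exact iff_of_false (hRP (hTR' l hl).1) (hRP (hTR' l hl).2)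
  -- no line of `T - ζ = insert θ U` crosses the cut `(R, Rᶜ)`
  have hS₂noR : ∀ l ∈ insert θ U, (G.fst l ∈ R ↔ G.snd l ∈ R) := by
    intro l hl
    rcases Finset.mem_insert.mp hl with rfl | hl
    · rcases hθj with ⟨h1, h2⟩ | ⟨h1, h2⟩
      · rw [h1, h2]; exact iff_of_false (hPR' hp₀) (hQR' hq₀)
      · rw [h1, h2]; exact iff_of_false (hQR' hq₀) (hPR' hp₀)
    rcases Finset.mem_union.mp hl with hl | hl
    · rcases Finset.mem_union.mp hl with hl | hl
      · exact iff_of_false (hPR' (hTP' l hl).1) (hPR' (hTP' l hl).2)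
      · exact iff_of_false (hQR' (hTQ' l hl).1) (hQR' (hTQ' l hl).2)
    · exact iff_of_true (hTR' l hl).1 (hTR' l hl).2
  have hTθ : T.erase θ = S₁ := by rw [hT, Finset.erase_insert hθS₁]
  have hTζ : T.erase ζ = insert θ U := by
    rw [hT, hS₁, Finset.erase_insert_of_ne hθζ, Finset.erase_insert hζU]
  -- loops of lines leaving P contain θ
  have hsepP : ∀ {l : L} {x y : V}, G.Joins l x y → x ∈ P → y ∉ P → G.LoopContains T l θ := by
    intro l x y hj hx hy h
    rw [hTθ] at h
    have hiff := G.reachable_mem_iff hS₁noP h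
    rcases hj with ⟨h1, h2⟩ | ⟨h1, h2⟩
    · rw [h1, h2] at hiff; exact hy (hiff.mp hx)
    · rw [h1, h2] at hiff; exact hy (hiff.mpr hx)
  -- loops of lines between Q and R contain ζ …
  have hsepR : ∀ {l : L} {x y : V}, G.Joins l x y → x ∈ Q → y ∈ R → G.LoopContains T l ζ := by
    intro l x y hj hx hy h
    rw [hTζ] at h
    have hiff := G.reachable_mem_iff hS₂noR h
    rcases hj with ⟨h1, h2⟩ | ⟨h1, h2⟩
    · rw [h1, h2] at hiff; exact hQR' hx (hiff.mpr hy)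
    · rw [h1, h2] at hiff; exact hQR' hx (hiff.mp hy)
  -- … but not θ
  have hconQR : ∀ {l : L} {x y : V}, G.Joins l x y → x ∈ Q → y ∈ R → ¬ G.LoopContains T l θ := by
    intro l x y hj hx hy h
    apply h
    rw [hTθ]
    have hTQS : TQ ⊆ S₁ := Finset.subset_union_right.trans (Finset.subset_union_left.trans
      (Finset.subset_insert ζ U))
    have hTRS : TR ⊆ S₁ := Finset.subset_union_right.trans (Finset.subset_insert ζ U)
    have hxy : G.Reachable S₁ x y :=
      (((hTQr x hx).mono hTQS).symm.trans ((hTQr q₁ hq₁).mono hTQS)).trans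
        ((Relation.ReflTransGen.single ⟨ζ, Finset.mem_insert_self ζ U, hζj⟩).trans
          ((hTRr y hy).mono hTRS))
    rcases hj with ⟨h1, h2⟩ | ⟨h1, h2⟩
    · rw [h1, h2]; exact hxy
    · rw [h1, h2]; exact hxy.symm
  -- distinctness of P-lines from Q–R-lines
  have hℓk : ∀ {l l' : L} {x y x' y' : V}, G.Joins l x y → x ∈ P → G.Joins l' x' y' → x' ∈ Q →
      y' ∈ R → l ≠ l' := by
    intro l l' x y x' y' hj hx hj' hx' hy' heq
    subst heq
    rcases hj.eq_or_eq hj' with ⟨h1, _⟩ | ⟨h1, _⟩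
    · exact hPQ' hx (h1 ▸ hx')
    · exact hPR' hx (h1 ▸ hy')
  exact ⟨T, hspan, θ, hθT, ζ, hζT, hθζ, ℓ₁, ℓ₂, k₁, k₂,
    hℓT hℓ₁j hx₁ hy₁ h1θ, hℓT hℓ₂j hx₂ hy₂ h2θ, hkT hk₁j hu₁ hw₁ hk1ζ, hkT hk₂j hu₂ hw₂ hk2ζ,
    h12, hℓk hℓ₁j hx₁ hk₁j hu₁ hw₁, hℓk hℓ₁j hx₁ hk₂j hu₂ hw₂, hℓk hℓ₂j hx₂ hk₁j hu₁ hw₁,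
    hℓk hℓ₂j hx₂ hk₂j hu₂ hw₂, hk12,
    hsepP hℓ₁j hx₁ hy₁, hsepP hℓ₂j hx₂ hy₂, hsepR hk₁j hu₁ hw₁, hsepR hk₂j hu₂ hw₂,
    hconQR hk₁j hu₁ hw₁, hconQR hk₂j hu₂ hw₂⟩

end Chain

/-! ### Components inside a vertex set (the `C_α` of Figure 4) -/

section Components

variable [Fintype V] [Fintype L] [DecidableEq V] [DecidableEq L] (G : FGraph V L)

open Classical in
omit [Fintype V] [DecidableEq L] in
/-- Transitivity/symmetry bookkeeping: the component of `x` in `G[M]` is the component of each of its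
members. [cite: FeldmanSalmhoferTrubowitz1999, Lemma 2.5 (proof) p0005:L109-115] -/
theorem comp_eq_of_mem {M : Finset V} {x y : V}
    (hy : y ∈ M.filter fun z => G.Reachable (G.induced M) x z) :
    (M.filter fun z => G.Reachable (G.induced M) y z) = M.filter fun z => G.Reachable (G.induced M) x z := by
  obtain ⟨_, hxy⟩ := Finset.mem_filter.mp hy
  ext z
  simp only [Finset.mem_filter, and_congr_right_iff]
  intro _
  exact ⟨fun h => hxy.trans h, fun h => hxy.symm.trans h⟩

open Classical in
omit [Fintype V] [DecidableEq L] in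
/-- A line with one end in the component of `x` in `G[M]` has its other end in that component or
outside `M`. [cite: FeldmanSalmhoferTrubowitz1999, Lemma 2.5 (proof) p0005:L109-115] -/
theorem mem_comp_of_joins {M : Finset V} {x y z : V} {l : L}
    (hy : y ∈ M.filter fun w => G.Reachable (G.induced M) x w) (hj : G.Joins l y z) (hz : z ∈ M) :
    z ∈ M.filter fun w => G.Reachable (G.induced M) x w := by
  obtain ⟨hyM, hxy⟩ := Finset.mem_filter.mp hy
  exact Finset.mem_filter.mpr ⟨hz, hxy.tail ⟨l, (G.mem_induced_iff_of_joins hj).mpr ⟨hyM, hz⟩, hj⟩⟩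

open Classical in
omit [Fintype V] [DecidableEq L] in
/-- Walks inside `G[M]` from `x` stay inside the component of `x`, using only its lines.
[cite: FeldmanSalmhoferTrubowitz1999, Lemma 2.5 (proof) p0005:L109-115] -/
theorem reachable_induced_comp {M : Finset V} {x y : V} (hx : x ∈ M) (h : G.Reachable (G.induced M) x y) :
    G.Reachable (G.induced (M.filter fun w => G.Reachable (G.induced M) x w)) x y := by
  induction h with
  | refl => exact Relation.ReflTransGen.refl
  | @tail b c hxb hbc ih =>
    obtain ⟨l, hl, hj⟩ := hbc
    have hbM : b ∈ M := G.reachable_induced_mem hxb hx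
    have hcM : c ∈ M := ((G.mem_induced_iff_of_joins hj).mp hl).2
    refine ih.tail ⟨l, (G.mem_induced_iff_of_joins hj).mpr ⟨?_, ?_⟩, hj⟩
    · exact Finset.mem_filter.mpr ⟨hbM, hxb⟩
    · exact Finset.mem_filter.mpr ⟨hcM, hxb.tail ⟨l, hl, hj⟩⟩

open Classical in
omit [Fintype V] [DecidableEq L] in
/-- Components are connected vertex sets. [cite: FeldmanSalmhoferTrubowitz1999, Lemma 2.5 (proof) p0005:L109-111] -/
theorem isConnectedOn_comp {M : Finset V} {x : V} (hx : x ∈ M) :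
    G.IsConnectedOn (M.filter fun w => G.Reachable (G.induced M) x w) := by
  intro y hy z hz
  obtain ⟨_, hxy⟩ := Finset.mem_filter.mp hy
  obtain ⟨_, hxz⟩ := Finset.mem_filter.mp hz
  exact (G.reachable_induced_comp hx hxy).symm.trans (G.reachable_induced_comp hx hxz)

open Classical in
omit [DecidableEq L] in
/-- The lines leaving a component of `G[M]` end outside `M`.
[cite: FeldmanSalmhoferTrubowitz1999, Lemma 2.5 (proof) p0005:L109-115] -/
theorem linesBetween_comp_compl {M : Finset V} {x : V} :
    G.linesBetween (M.filter fun w => G.Reachable (G.induced M) x w)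
        (M.filter fun w => G.Reachable (G.induced M) x w)ᶜ =
      G.linesBetween (M.filter fun w => G.Reachable (G.induced M) x w) Mᶜ := by
  ext l
  simp only [G.mem_linesBetween_iff, Finset.mem_compl]
  constructor
  · rintro ⟨y, hy, z, hz, hj⟩
    exact ⟨y, hy, z, fun hzM => hz (G.mem_comp_of_joins hy hj hzM), hj⟩
  · rintro ⟨y, hy, z, hz, hj⟩
    exact ⟨y, hy, z, fun hz' => hz (Finset.mem_filter.mp hz').1, hj⟩

omit [Fintype V] in
/-- `linesBetween` distributes over a union in the second slot.
[cite: FeldmanSalmhoferTrubowitz1999, Lemma 2.5 (proof) p0005:L92-95] -/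
theorem linesBetween_union_right (A B B' : Finset V) :
    G.linesBetween A (B ∪ B') = G.linesBetween A B ∪ G.linesBetween A B' := by
  ext l
  simp only [G.mem_linesBetween_iff, Finset.mem_union]
  constructor
  · rintro ⟨y, hy, z, hz | hz, hj⟩
    · exact Or.inl ⟨y, hy, z, hz, hj⟩
    · exact Or.inr ⟨y, hy, z, hz, hj⟩
  · rintro (⟨y, hy, z, hz, hj⟩ | ⟨y, hy, z, hz, hj⟩)
    · exact ⟨y, hy, z, Or.inl hz, hj⟩
    · exact ⟨y, hy, z, Or.inr hz, hj⟩

omit [Fintype V] [DecidableEq L] in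
/-- `linesBetween` is monotone in the second slot.
[cite: FeldmanSalmhoferTrubowitz1999, Lemma 2.5 (proof) p0005:L92-95] -/
theorem linesBetween_mono_right (A : Finset V) {B B' : Finset V} (h : B ⊆ B') :
    G.linesBetween A B ⊆ G.linesBetween A B' := by
  intro l hl
  obtain ⟨y, hy, z, hz, hj⟩ := G.mem_linesBetween_iff.mp hl
  exact G.mem_linesBetween_iff.mpr ⟨y, hy, z, h hz, hj⟩

/-- Parity in the form needed for the component count: a vertex set containing the external vertex
`a` but not `b` is left by an ODD number of lines (`1 + k` legs, even).
[cite: FeldmanSalmhoferTrubowitz1999, Lemma 2.5 (proof) p0005:L101-105] -/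
theorem odd_card_linesBetween_compl (hev : G.EvenIncidence) (h2 : G.IsTwoLegged) {a b : V}
    (ha : G.ext a = 1) (hb : G.ext b = 1) (hab : a ≠ b) {W : Finset V} (haW : a ∈ W) (hbW : b ∉ W) :
    Odd (G.linesBetween W Wᶜ).card := by
  have hext : ∑ v ∈ W, G.ext v = 1 := by
    rw [Finset.sum_eq_single_of_mem a haW fun v hv hva =>
      G.ext_eq_zero_of_ne h2 ha hb hab hva fun h => hbW (h ▸ hv), ha]
  have heven := even_subgraphLegs hev (G.isSubgraph_induced W)
  rw [subgraphLegs_induced, hext, add_comm] at heven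
  exact (Nat.even_add_one.mp heven) |> Nat.not_even_iff_odd.mp

/-- In the setting of Lemma 2.5, a vertex set avoiding both external vertices is left by an even number
of lines, not equal to two (its legs are these lines; even incidence and the skeleton property), and by
at least one (connectedness). [cite: FeldmanSalmhoferTrubowitz1999, Lemma 2.5 (proof) p0005:L122-128] -/
theorem card_linesBetween_compl_of_avoids (hev : G.EvenIncidence) (h2 : G.IsTwoLegged) {a b : V}
    (ha : G.ext a = 1) (hb : G.ext b = 1) (hab : a ≠ b) (hsk : G.IsSkeleton) {W : Finset V}
    (haW : a ∉ W) (hbW : b ∉ W) (hne : W.Nonempty) :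
    Even (G.linesBetween W Wᶜ).card ∧ (G.linesBetween W Wᶜ).card ≠ 2 ∧
      1 ≤ (G.linesBetween W Wᶜ).card := by
  have hext : ∑ v ∈ W, G.ext v = 0 :=
    Finset.sum_eq_zero fun v hv =>
      G.ext_eq_zero_of_ne h2 ha hb hab (fun h => haW (h ▸ hv)) fun h => hbW (h ▸ hv)
  have heven := even_subgraphLegs hev (G.isSubgraph_induced W)
  have hne2 : G.subgraphLegs W (G.induced W) ≠ 2 :=
    hsk.2.2.2 W _ (G.isSubgraph_induced W) (Or.inl fun h => haW (h ▸ Finset.mem_univ a))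
  rw [subgraphLegs_induced, hext, zero_add] at heven hne2
  refine ⟨heven, hne2, ?_⟩
  -- at least one line leaves W: G is connected and W is a proper nonempty vertex set
  obtain ⟨v₀, hv₀⟩ := hne
  obtain ⟨l, -, u, hu, x, -, hxW, hj⟩ := G.exists_crossing (G.isConnectedOn_univ hsk.1)
    (Finset.subset_univ W) hv₀ (Finset.mem_univ a) haW
  exact Finset.card_pos.mpr ⟨l, G.mem_linesBetween_iff.mpr ⟨u, hu, x, Finset.mem_compl.mpr hxW, hj⟩⟩

end Components

/-! ### Theorem 2.4: two-legged skeleton graphs with `t ≥ 2` are DOL (discharge of `lemma25`) -/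

section Theorem24

variable [Fintype V] [Fintype L] [DecidableEq V] [DecidableEq L] (G : FGraph V L)

open Classical in
/-- **The good-component case** (Figures 3, 5, 6 of Lemma 2.5 in one statement). Let `P₀ ∋ a` and
`S₀ ∋ b` be disjoint connected vertex sets left only through `a`, resp. `b`, and `M` the remaining
vertices. If some component `C` of `G[M]` is joined to `P₀` and is joined to `S₀` by at least three
lines, then `G` is DOL: apply the chain lemma to `P = P₀ ∪ (components not touching S₀)`, `Q = C`,
`R = S₀ ∪ (other components touching S₀)`. [cite: FeldmanSalmhoferTrubowitz1999, Lemma 2.5 (proof) p0005:L109-p0006:L35] -/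
theorem isDOL_of_goodComponent (hev : G.EvenIncidence) (h2 : G.IsTwoLegged) {a b : V}
    (ha : G.ext a = 1) (hb : G.ext b = 1) (hab : a ≠ b) (hsk : G.IsSkeleton) {P₀ S₀ M : Finset V}
    (haP : a ∈ P₀) (hbS : b ∈ S₀) (hPS : Disjoint P₀ S₀) (hM : M = (P₀ ∪ S₀)ᶜ)
    (hP₀ : G.IsConnectedOn P₀) (hS₀ : G.IsConnectedOn S₀)
    (hPout : ∀ {l : L} {x y : V}, G.Joins l x y → x ∈ P₀ → y ∉ P₀ → x = a)
    (hSout : ∀ {l : L} {x y : V}, G.Joins l x y → x ∈ S₀ → y ∉ S₀ → x = b) {x : V} (hx : x ∈ M)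
    (hα : (G.linesBetween (M.filter fun w => G.Reachable (G.induced M) x w) P₀).Nonempty)
    (hβ : 3 ≤ (G.linesBetween (M.filter fun w => G.Reachable (G.induced M) x w) S₀).card) :
    G.IsDOL := by
  classical
  set C : V → Finset V := fun y => M.filter fun w => G.Reachable (G.induced M) y w with hC
  change (G.linesBetween (C x) P₀).Nonempty at hα
  change 3 ≤ (G.linesBetween (C x) S₀).card at hβ
  have hMiff : ∀ {v : V}, v ∈ M ↔ v ∉ P₀ ∧ v ∉ S₀ := by
    intro v; rw [hM, Finset.mem_compl, Finset.mem_union, not_or]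
  have haM : a ∉ M := fun h => (hMiff.mp h).1 haP
  have hbM : b ∉ M := fun h => (hMiff.mp h).2 hbS
  have hself : ∀ {y : V}, y ∈ M → y ∈ C y := fun hy =>
    Finset.mem_filter.mpr ⟨hy, Relation.ReflTransGen.refl⟩
  have hCsub : ∀ {y z : V}, z ∈ C y → z ∈ M := fun hz => (Finset.mem_filter.mp hz).1
  have hCeq : ∀ {y z : V}, z ∈ C y → C z = C y := fun hz => G.comp_eq_of_mem hz
  -- lines leaving a component go to P₀ or S₀
  have hMc : Mᶜ = P₀ ∪ S₀ := by rw [hM, compl_compl]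
  have hδC : ∀ {y : V}, G.linesBetween (C y) (C y)ᶜ = G.linesBetween (C y) P₀ ∪ G.linesBetween (C y) S₀ := by
    intro y
    rw [show G.linesBetween (C y) (C y)ᶜ = G.linesBetween (C y) Mᶜ from G.linesBetween_comp_compl, hMc,
      G.linesBetween_union_right]
  -- the three parts
  set P : Finset V := P₀ ∪ M.filter fun y => y ∉ C x ∧ G.linesBetween (C y) S₀ = ∅ with hPdef
  set R : Finset V := S₀ ∪ M.filter fun y => y ∉ C x ∧ G.linesBetween (C y) S₀ ≠ ∅ with hRdef
  have hPiff : ∀ {v : V}, v ∈ P ↔ v ∈ P₀ ∨ (v ∈ M ∧ v ∉ C x ∧ G.linesBetween (C v) S₀ = ∅) := by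
    intro v; rw [hPdef, Finset.mem_union, Finset.mem_filter]
  have hRiff : ∀ {v : V}, v ∈ R ↔ v ∈ S₀ ∨ (v ∈ M ∧ v ∉ C x ∧ G.linesBetween (C v) S₀ ≠ ∅) := by
    intro v; rw [hRdef, Finset.mem_union, Finset.mem_filter]
  have hPS' : ∀ {v : V}, v ∈ P₀ → v ∉ S₀ := fun hv hv' => Finset.disjoint_left.mp hPS hv hv'
  have hPQ : Disjoint P (C x) := by
    rw [Finset.disjoint_left]
    intro v hv hvC
    rcases hPiff.mp hv with hv | ⟨_, hv, _⟩
    · exact (hMiff.mp (hCsub hvC)).1 hv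
    · exact hv hvC
  have hQR : Disjoint (C x) R := by
    rw [Finset.disjoint_left]
    intro v hvC hv
    rcases hRiff.mp hv with hv | ⟨_, hv, _⟩
    · exact (hMiff.mp (hCsub hvC)).2 hv
    · exact hv hvC
  have hPR : Disjoint P R := by
    rw [Finset.disjoint_left]
    intro v hvP hvR
    rcases hPiff.mp hvP with hvP | ⟨hvM, _, hv0⟩ <;> rcases hRiff.mp hvR with hvR | ⟨hvM', _, hv1⟩
    · exact hPS' hvP hvR
    · exact (hMiff.mp hvM').1 hvP
    · exact (hMiff.mp hvM).2 hvR
    · exact hv1 hv0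
  have hcover : P ∪ C x ∪ R = Finset.univ := by
    ext v
    simp only [Finset.mem_union, Finset.mem_univ, iff_true]
    by_cases hvP : v ∈ P₀
    · exact Or.inl (Or.inl (hPiff.mpr (Or.inl hvP)))
    by_cases hvS : v ∈ S₀
    · exact Or.inr (hRiff.mpr (Or.inl hvS))
    have hvM : v ∈ M := hMiff.mpr ⟨hvP, hvS⟩
    by_cases hvC : v ∈ C x
    · exact Or.inl (Or.inr hvC)
    by_cases h0 : G.linesBetween (C v) S₀ = ∅
    · exact Or.inl (Or.inl (hPiff.mpr (Or.inr ⟨hvM, hvC, h0⟩)))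
    · exact Or.inr (hRiff.mpr (Or.inr ⟨hvM, hvC, h0⟩))
  -- components other than `C x` lie entirely in P or entirely in R
  have hCP : ∀ {v : V}, v ∈ M → v ∉ C x → G.linesBetween (C v) S₀ = ∅ → C v ⊆ P := by
    intro v hvM hvC h0 c hc
    have hce : C c = C v := hCeq hc
    refine hPiff.mpr (Or.inr ⟨hCsub hc, fun hcx => hvC ?_, by rw [hce]; exact h0⟩)
    have : C x = C v := (hCeq hcx).symm.trans hce
    rw [this]; exact hself hvM
  have hCR : ∀ {v : V}, v ∈ M → v ∉ C x → G.linesBetween (C v) S₀ ≠ ∅ → C v ⊆ R := by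
    intro v hvM hvC h0 c hc
    have hce : C c = C v := hCeq hc
    refine hRiff.mpr (Or.inr ⟨hCsub hc, fun hcx => hvC ?_, by rw [hce]; exact h0⟩)
    have : C x = C v := (hCeq hcx).symm.trans hce
    rw [this]; exact hself hvM
  -- connectivity of P (everything reaches a) and of R (everything reaches b)
  have hPa : ∀ v ∈ P, G.Reachable (G.induced P) v a := by
    intro v hv
    rcases hPiff.mp hv with hvP | ⟨hvM, hvC, h0⟩
    · exact (hP₀ v hvP a haP).mono (G.induced_mono (fun y hy => hPiff.mpr (Or.inl hy)))
    · -- a line from C v to P₀ exists and ends at a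
      obtain ⟨-, -, h1⟩ := G.card_linesBetween_compl_of_avoids hev h2 ha hb hab hsk
        (W := C v) (fun h => haM (hCsub h)) (fun h => hbM (hCsub h)) ⟨v, hself hvM⟩
      rw [hδC, h0, Finset.union_empty] at h1
      obtain ⟨l, hl⟩ := Finset.card_pos.mp h1
      obtain ⟨c, hc, p, hp, hj⟩ := G.mem_linesBetween_iff.mp hl
      have hpa : p = a := hPout hj.symm hp fun hcP => (hMiff.mp (hCsub hc)).1 hcP
      subst hpa
      have hsub : C v ⊆ P := hCP hvM hvC h0
      have h1 : G.Reachable (G.induced P) v c :=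
        ((G.isConnectedOn_comp hvM) v (hself hvM) c hc).mono (G.induced_mono hsub)
      exact h1.tail ⟨l, (G.mem_induced_iff_of_joins hj).mpr ⟨hsub hc, hPiff.mpr (Or.inl hp)⟩, hj⟩
  have hP : G.IsConnectedOn P := fun v hv w hw => (hPa v hv).trans (hPa w hw).symm
  have hRb : ∀ v ∈ R, G.Reachable (G.induced R) v b := by
    intro v hv
    rcases hRiff.mp hv with hvS | ⟨hvM, hvC, h0⟩
    · exact (hS₀ v hvS b hbS).mono (G.induced_mono (fun y hy => hRiff.mpr (Or.inl hy)))
    · obtain ⟨l, hl⟩ := Finset.nonempty_iff_ne_empty.mpr h0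
      obtain ⟨c, hc, q, hq, hj⟩ := G.mem_linesBetween_iff.mp hl
      have hqb : q = b := hSout hj.symm hq fun hcS => (hMiff.mp (hCsub hc)).2 hcS
      subst hqb
      have hsub : C v ⊆ R := hCR hvM hvC h0
      have h1 : G.Reachable (G.induced R) v c :=
        ((G.isConnectedOn_comp hvM) v (hself hvM) c hc).mono (G.induced_mono hsub)
      exact h1.tail ⟨l, (G.mem_induced_iff_of_joins hj).mpr ⟨hsub hc, hRiff.mpr (Or.inl hq)⟩, hj⟩
  have hR : G.IsConnectedOn R := fun v hv w hw => (hRb v hv).trans (hRb w hw).symm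
  have hQ : G.IsConnectedOn (C x) := G.isConnectedOn_comp hx
  -- θ and two more lines leaving P
  obtain ⟨θ, hθ⟩ := hα
  have hθ' : θ ∈ G.linesBetween P (C x) := by
    rw [G.linesBetween_comm]
    exact G.linesBetween_mono_right _ (fun y hy => hPiff.mpr (Or.inl hy)) hθ
  have haPP : a ∈ P := hPiff.mpr (Or.inl haP)
  have hbP : b ∉ P := fun h => by
    rcases hPiff.mp h with h | ⟨h, _⟩
    · exact hPS' h hbS
    · exact hbM h
  have h3 := G.three_le_card_linesBetween_compl hev h2 ha hb hab hsk haPP hbP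
  obtain ⟨e₁, e₂, e₃, he₁, he₂, he₃, h12, h13, h23⟩ := Finset.two_lt_card_iff.mp h3
  obtain ⟨ℓ₁, ℓ₂, hℓ₁, hℓ₂, hℓ12, hℓ1θ, hℓ2θ⟩ : ∃ ℓ₁ ℓ₂ : L, ℓ₁ ∈ G.linesBetween P Pᶜ ∧
      ℓ₂ ∈ G.linesBetween P Pᶜ ∧ ℓ₁ ≠ ℓ₂ ∧ ℓ₁ ≠ θ ∧ ℓ₂ ≠ θ := by
    by_cases h1 : e₁ = θ
    · exact ⟨e₂, e₃, he₂, he₃, h23, fun h => h12 (h1.trans h.symm), fun h => h13 (h1.trans h.symm)⟩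
    by_cases h2' : e₂ = θ
    · exact ⟨e₁, e₃, he₁, he₃, h13, h1, fun h => h23 (h2'.trans h.symm)⟩
    · exact ⟨e₁, e₂, he₁, he₂, h12, h1, h2'⟩
  -- ζ, k₁, k₂ between C x and R
  have hsubQR : G.linesBetween (C x) S₀ ⊆ G.linesBetween (C x) R :=
    G.linesBetween_mono_right _ fun y hy => hRiff.mpr (Or.inl hy)
  obtain ⟨ζ, k₁, k₂, hζ, hk₁, hk₂, hζ1, hζ2, hk12⟩ := Finset.two_lt_card_iff.mp hβ
  exact G.isDOL_of_chain hPQ hPR hQR hcover hP hQ hR hθ' hℓ₁ hℓ₂ hℓ12 hℓ1θ hℓ2θ (hsubQR hζ)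
    (hsubQR hk₁) (hsubQR hk₂) hk12 (Ne.symm hζ1) (Ne.symm hζ2)


open Classical in
/-- **A good component exists** (the parity count of the proof of Lemma 2.5, (2.3)–(2.4) and the case
analysis "m_k = 1 or n_k = 1 … / all m_b, n_b > 1", p0005:L122–p0006:L28): with `P₀, S₀, M` as in
`isDOL_of_goodComponent` and no line joining `a` to `b`, some component `C` of `G[M]` has a line to
`P₀` and `≥ 3` lines to `S₀`, or a line to `S₀` and `≥ 3` lines to `P₀`. Otherwise every component
touching `P₀` would send `0` or `2` lines to `S₀`, so `W = P₀ ∪ (components touching P₀)` would be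
left by an even number of lines — but a set containing `a` and not `b` is left by an odd number.
[cite: FeldmanSalmhoferTrubowitz1999, Lemma 2.5 (proof) p0005:L122-p0006:L28] -/
theorem exists_goodComponent (hev : G.EvenIncidence) (h2 : G.IsTwoLegged) {a b : V}
    (ha : G.ext a = 1) (hb : G.ext b = 1) (hab : a ≠ b) (hsk : G.IsSkeleton) {P₀ S₀ M : Finset V}
    (haP : a ∈ P₀) (hbS : b ∈ S₀) (hPS : Disjoint P₀ S₀) (hM : M = (P₀ ∪ S₀)ᶜ)
    (hPout : ∀ {l : L} {x y : V}, G.Joins l x y → x ∈ P₀ → y ∉ P₀ → x = a)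
    (hSout : ∀ {l : L} {x y : V}, G.Joins l x y → x ∈ S₀ → y ∉ S₀ → x = b)
    (hnoab : ∀ l : L, ¬ G.Joins l a b) :
    ∃ x ∈ M,
      ((G.linesBetween (M.filter fun w => G.Reachable (G.induced M) x w) P₀).Nonempty ∧
        3 ≤ (G.linesBetween (M.filter fun w => G.Reachable (G.induced M) x w) S₀).card) ∨
      ((G.linesBetween (M.filter fun w => G.Reachable (G.induced M) x w) S₀).Nonempty ∧
        3 ≤ (G.linesBetween (M.filter fun w => G.Reachable (G.induced M) x w) P₀).card) := by
  classical
  set C : V → Finset V := fun y => M.filter fun w => G.Reachable (G.induced M) y w with hC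
  change ∃ x ∈ M, ((G.linesBetween (C x) P₀).Nonempty ∧ 3 ≤ (G.linesBetween (C x) S₀).card) ∨
      ((G.linesBetween (C x) S₀).Nonempty ∧ 3 ≤ (G.linesBetween (C x) P₀).card)
  by_contra hbad
  have hbad' : ∀ y ∈ M, ¬ ((G.linesBetween (C y) P₀).Nonempty ∧ 3 ≤ (G.linesBetween (C y) S₀).card) ∧
      ¬ ((G.linesBetween (C y) S₀).Nonempty ∧ 3 ≤ (G.linesBetween (C y) P₀).card) :=
    fun y hy => not_or.mp fun h => hbad ⟨y, hy, h⟩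
  have hMiff : ∀ {v : V}, v ∈ M ↔ v ∉ P₀ ∧ v ∉ S₀ := by
    intro v; rw [hM, Finset.mem_compl, Finset.mem_union, not_or]
  have haM : a ∉ M := fun h => (hMiff.mp h).1 haP
  have hbM : b ∉ M := fun h => (hMiff.mp h).2 hbS
  have hself : ∀ {y : V}, y ∈ M → y ∈ C y := fun hy =>
    Finset.mem_filter.mpr ⟨hy, Relation.ReflTransGen.refl⟩
  have hCsub : ∀ {y z : V}, z ∈ C y → z ∈ M := fun hz => (Finset.mem_filter.mp hz).1
  have hCeq : ∀ {y z : V}, z ∈ C y → C z = C y := fun hz => G.comp_eq_of_mem hz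
  have hPS' : ∀ {v : V}, v ∈ P₀ → v ∉ S₀ := fun hv hv' => Finset.disjoint_left.mp hPS hv hv'
  have hMc : Mᶜ = P₀ ∪ S₀ := by rw [hM, compl_compl]
  -- per-component counts: |α| + |β| is even and ≠ 2
  have hdisjαβ : ∀ {y : V}, Disjoint (G.linesBetween (C y) P₀) (G.linesBetween (C y) S₀) := by
    intro y
    rw [Finset.disjoint_left]
    intro l hl hl'
    obtain ⟨c, hc, q, hq, hj⟩ := G.mem_linesBetween_iff.mp hl
    obtain ⟨c', hc', q', hq', hj'⟩ := G.mem_linesBetween_iff.mp hl'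
    rcases hj.eq_or_eq hj' with ⟨_, h2⟩ | ⟨h1, _⟩
    · exact hPS' hq (h2 ▸ hq')
    · exact (hMiff.mp (hCsub hc)).2 (h1 ▸ hq')
  have hparity : ∀ {y : V}, y ∈ M →
      Even ((G.linesBetween (C y) P₀).card + (G.linesBetween (C y) S₀).card) ∧
        (G.linesBetween (C y) P₀).card + (G.linesBetween (C y) S₀).card ≠ 2 := by
    intro y hy
    obtain ⟨he, hne, -⟩ := G.card_linesBetween_compl_of_avoids hev h2 ha hb hab hsk (W := C y)
      (fun h => haM (hCsub h)) (fun h => hbM (hCsub h)) ⟨y, hself hy⟩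
    rw [show G.linesBetween (C y) (C y)ᶜ = G.linesBetween (C y) Mᶜ from G.linesBetween_comp_compl,
      hMc, G.linesBetween_union_right, Finset.card_union_of_disjoint hdisjαβ] at he hne
    exact ⟨he, hne⟩
  -- W := P₀ ∪ (components touching P₀)
  set A : Finset V := M.filter fun y => (G.linesBetween (C y) P₀).Nonempty with hA
  set W : Finset V := P₀ ∪ A with hW
  have haW : a ∈ W := Finset.mem_union_left _ haP
  have hbW : b ∉ W := fun h => by
    rcases Finset.mem_union.mp h with h | h
    · exact hPS' h hbS
    · exact hbM (Finset.mem_filter.mp h).1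
  have hodd := G.odd_card_linesBetween_compl hev h2 ha hb hab haW hbW
  -- δ(W) is the union over touching components of their S₀-lines
  set 𝒞 : Finset (Finset V) := A.image C with h𝒞
  have hδW : G.linesBetween W Wᶜ = 𝒞.biUnion fun C₀ => G.linesBetween C₀ S₀ := by
    ext l
    rw [G.mem_linesBetween_iff, Finset.mem_biUnion]
    constructor
    · rintro ⟨w, hw, z, hz, hj⟩
      rw [Finset.mem_compl] at hz
      have hzP : z ∉ P₀ := fun h => hz (Finset.mem_union_left _ h)
      rcases Finset.mem_union.mp hw with hwP | hwA
      · have hwa : w = a := hPout hj hwP hzP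
        by_cases hzS : z ∈ S₀
        · have hzb : z = b := hSout hj.symm hzS (hPS' hwP)
          subst hwa; subst hzb
          exact absurd hj (hnoab l)
        · have hzM : z ∈ M := hMiff.mpr ⟨hzP, hzS⟩
          have hlz : l ∈ G.linesBetween (C z) P₀ :=
            G.mem_linesBetween_iff.mpr ⟨z, hself hzM, w, hwP, hj.symm⟩
          exact absurd (Finset.mem_union_right _ (Finset.mem_filter.mpr ⟨hzM, ⟨l, hlz⟩⟩)) hz
      · obtain ⟨hwM, hαw⟩ := Finset.mem_filter.mp hwA
        by_cases hzM : z ∈ M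
        · have hzC : z ∈ C w := G.mem_comp_of_joins (hself hwM) hj hzM
          have hαz : (G.linesBetween (C z) P₀).Nonempty := by rw [hCeq hzC]; exact hαw
          exact absurd (Finset.mem_union_right _ (Finset.mem_filter.mpr ⟨hzM, hαz⟩)) hz
        · have hzS : z ∈ S₀ := by
            by_contra hzS
            exact hzM (hMiff.mpr ⟨hzP, hzS⟩)
          exact ⟨C w, Finset.mem_image_of_mem _ hwA, G.mem_linesBetween_iff.mpr ⟨w, hself hwM, z, hzS, hj⟩⟩
    · rintro ⟨C₀, hC₀, hl⟩
      obtain ⟨y, hyA, rfl⟩ := Finset.mem_image.mp hC₀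
      obtain ⟨hyM, hαy⟩ := Finset.mem_filter.mp hyA
      obtain ⟨c, hc, q, hq, hj⟩ := G.mem_linesBetween_iff.mp hl
      have hcA : c ∈ A := Finset.mem_filter.mpr ⟨hCsub hc, by rw [hCeq hc]; exact hαy⟩
      have hqW : q ∉ W := fun h => by
        rcases Finset.mem_union.mp h with h | h
        · exact hPS' h hq
        · exact (hMiff.mp (Finset.mem_filter.mp h).1).2 hq
      exact ⟨c, Finset.mem_union_right _ hcA, q, Finset.mem_compl.mpr hqW, hj⟩
  have hdisj : ∀ C₀ ∈ 𝒞, ∀ C₁ ∈ 𝒞, C₀ ≠ C₁ →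
      Disjoint (G.linesBetween C₀ S₀) (G.linesBetween C₁ S₀) := by
    intro C₀ hC₀ C₁ hC₁ hne
    obtain ⟨y₀, hy₀, rfl⟩ := Finset.mem_image.mp hC₀
    obtain ⟨y₁, hy₁, rfl⟩ := Finset.mem_image.mp hC₁
    rw [Finset.disjoint_left]
    intro l hl₀ hl₁
    obtain ⟨c₀, hc₀, q₀, hq₀, hj₀⟩ := G.mem_linesBetween_iff.mp hl₀
    obtain ⟨c₁, hc₁, q₁, hq₁, hj₁⟩ := G.mem_linesBetween_iff.mp hl₁
    rcases hj₀.eq_or_eq hj₁ with ⟨h1, _⟩ | ⟨h1, _⟩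
    · apply hne
      rw [← hCeq hc₀, ← hCeq hc₁, h1]
    · exact (hMiff.mp (hCsub hc₀)).2 (h1 ▸ hq₁)
  have hcard : (G.linesBetween W Wᶜ).card = ∑ C₀ ∈ 𝒞, (G.linesBetween C₀ S₀).card := by
    rw [hδW, Finset.card_biUnion hdisj]
  -- each touching component sends an even number of lines to S₀
  have hevenC : ∀ C₀ ∈ 𝒞, Even (G.linesBetween C₀ S₀).card := by
    intro C₀ hC₀
    obtain ⟨y, hyA, rfl⟩ := Finset.mem_image.mp hC₀
    obtain ⟨hyM, hαy⟩ := Finset.mem_filter.mp hyA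
    obtain ⟨⟨k, hk⟩, hne2⟩ := hparity hyM
    obtain ⟨hb1, hb2⟩ := hbad' y hyM
    have hαpos : 0 < (G.linesBetween (C y) P₀).card := Finset.card_pos.mpr hαy
    have hβlt : (G.linesBetween (C y) S₀).card < 3 := by
      by_contra h; exact hb1 ⟨hαy, not_lt.mp h⟩
    by_cases hβ0 : (G.linesBetween (C y) S₀).card = 0
    · rw [hβ0]; exact ⟨0, rfl⟩
    · have hβne : (G.linesBetween (C y) S₀).Nonempty := Finset.card_pos.mp (Nat.pos_of_ne_zero hβ0)
      have hαlt : (G.linesBetween (C y) P₀).card < 3 := by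
        by_contra h; exact hb2 ⟨hβne, not_lt.mp h⟩
      have : (G.linesBetween (C y) S₀).card = 2 := by omega
      rw [this]; exact ⟨1, rfl⟩
  have heven : Even (G.linesBetween W Wᶜ).card := by
    rw [hcard]
    exact even_iff_two_dvd.mpr (Finset.dvd_sum fun C₀ hC₀ => even_iff_two_dvd.mp (hevenC C₀ hC₀))
  exact (Nat.not_even_iff_odd.mpr hodd) heven

omit [DecidableEq L] in
open Classical in
/-- The sides `P₀ = {a} ∪ (components of G - a not containing b)`: the complement of the component of
`b` in `G[V ∖ {a}]` contains `a`, not `b`, is connected, and is left only through `a` (Figure 3 with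
the components attached to `G₁` absorbed, p0005:L111-115).
[cite: FeldmanSalmhoferTrubowitz1999, Lemma 2.5 (proof) p0005:L109-118] -/
theorem side_spec (hconn : G.IsConnected) {c d : V} (hcd : c ≠ d) {P₀ : Finset V}
    (hP : P₀ = (Finset.univ.filter fun y => G.Reachable (G.induced ({c}ᶜ : Finset V)) d y)ᶜ) :
    c ∈ P₀ ∧ d ∉ P₀ ∧ (∀ {l : L} {x y : V}, G.Joins l x y → x ∈ P₀ → y ∉ P₀ → x = c) ∧
      ∀ v ∈ P₀, G.Reachable (G.induced P₀) c v := by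
  have hdc : d ∈ ({c}ᶜ : Finset V) := by simp [hcd.symm]
  have hmem : ∀ {v : V}, v ∈ P₀ ↔ ¬ G.Reachable (G.induced ({c}ᶜ : Finset V)) d v := by
    intro v; rw [hP]; simp
  have hcP : c ∈ P₀ := hmem.mpr fun h => by
    have := G.reachable_induced_mem h hdc
    simp at this
  have hdP : d ∉ P₀ := fun h => hmem.mp h Relation.ReflTransGen.refl
  have hout : ∀ {l : L} {x y : V}, G.Joins l x y → x ∈ P₀ → y ∉ P₀ → x = c := by
    intro l x y hj hx hy
    by_contra hxc
    have hy' : G.Reachable (G.induced ({c}ᶜ : Finset V)) d y := not_not.mp fun h => hy (hmem.mpr h)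
    have hyc : y ∈ ({c}ᶜ : Finset V) := G.reachable_induced_mem hy' hdc
    have hxc' : x ∈ ({c}ᶜ : Finset V) := by simp [hxc]
    exact hmem.mp hx (hy'.tail ⟨l, (G.mem_induced_iff_of_joins hj.symm).mpr ⟨hyc, hxc'⟩, hj.symm⟩)
  refine ⟨hcP, hdP, hout, ?_⟩
  suffices key : ∀ v, G.Reachable Finset.univ c v → v ∈ P₀ → G.Reachable (G.induced P₀) c v from
    fun v hv => key v (hconn c v) hv
  intro v hv
  induction hv with
  | refl => exact fun _ => Relation.ReflTransGen.refl
  | @tail x y _ hxy ih =>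
    intro hyP
    obtain ⟨l, -, hj⟩ := hxy
    by_cases hxP : x ∈ P₀
    · exact (ih hxP).tail ⟨l, (G.mem_induced_iff_of_joins hj).mpr ⟨hxP, hyP⟩, hj⟩
    · have hyc : y = c := hout hj.symm hyP hxP
      rw [hyc]
      exact Relation.ReflTransGen.refl

open Classical in
/-- **Theorem 2.4 for the typed definitions** (p0005:L39–40: "All two–legged skeleton graphs with
`t ≥ 2` are doubly overlapping"), proved along the lines of the proof of Lemma 2.5 (p0005:L57–p0006:L35):
with `P₀ = {a} ∪` (components of `G - a` away from `b`) and `S₀` symmetric, a good component of the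
middle part exists by parity (`exists_goodComponent`) and the chain lemma applies
(`isDOL_of_goodComponent`), in one of the two orientations.
[cite: FeldmanSalmhoferTrubowitz1999, Thm 2.4 p0005:L39-41] -/
theorem isDOL_of_two_le_edist (hev : G.EvenIncidence) (h2 : G.IsTwoLegged) {a b : V}
    (ha : G.ext a = 1) (hb : G.ext b = 1) (hsk : G.IsSkeleton) (ht : 2 ≤ G.edist a b) : G.IsDOL := by
  classical
  have hab : a ≠ b := G.ne_of_edist_pos (by omega)
  have hnoab : ∀ l : L, ¬ G.Joins l a b := fun l hj =>
    G.not_mem_ball_of_lt_edist (show 1 < G.edist a b by omega)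
      (G.mem_ball_succ_of_joins (G.mem_ball_self a 0) hj)
  set P₀ : Finset V := (Finset.univ.filter fun y => G.Reachable (G.induced ({a}ᶜ : Finset V)) b y)ᶜ
    with hP₀
  set S₀ : Finset V := (Finset.univ.filter fun y => G.Reachable (G.induced ({b}ᶜ : Finset V)) a y)ᶜ
    with hS₀
  obtain ⟨haP, hbP, hPout, hPr⟩ := G.side_spec hsk.1 hab hP₀
  obtain ⟨hbS, haS, hSout, hSr⟩ := G.side_spec hsk.1 hab.symm hS₀
  have hP₀c : G.IsConnectedOn P₀ := fun v hv w hw => (hPr v hv).symm.trans (hPr w hw)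
  have hS₀c : G.IsConnectedOn S₀ := fun v hv w hw => (hSr v hv).symm.trans (hSr w hw)
  have hPS : Disjoint P₀ S₀ := by
    rw [Finset.disjoint_left]
    intro x hxP hxS
    have h1 : G.Reachable (G.induced ({b}ᶜ : Finset V)) a x :=
      (hPr x hxP).mono (G.induced_mono fun y hy => by
        rw [Finset.mem_compl, Finset.mem_singleton]
        rintro rfl
        exact hbP hy)
    have : x ∉ S₀ := by
      rw [hS₀, Finset.mem_compl, not_not]
      exact Finset.mem_filter.mpr ⟨Finset.mem_univ x, h1⟩
    exact this hxS
  set M : Finset V := (P₀ ∪ S₀)ᶜ with hM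
  obtain ⟨x, hxM, hgood⟩ := G.exists_goodComponent hev h2 ha hb hab hsk haP hbS hPS hM
    hPout hSout hnoab
  rcases hgood with ⟨hα, hβ⟩ | ⟨hβ, hα⟩
  · exact G.isDOL_of_goodComponent hev h2 ha hb hab hsk haP hbS hPS hM hP₀c hS₀c hPout hSout hxM hα hβ
  · have hM' : M = (S₀ ∪ P₀)ᶜ := by rw [hM, Finset.union_comm]
    exact G.isDOL_of_goodComponent hev h2 hb ha hab.symm hsk hbS haP hPS.symm hM' hS₀c hP₀c hSout hPout
      hxM hβ hα

end Theorem24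

/-! ### Spanning trees are minimal: cuts of a tree line (for "the wicked ladder is not DOL") -/

section TreeCuts

variable [Fintype V] [Fintype L] [DecidableEq V] [DecidableEq L] (G : FGraph V L)

omit [Fintype V] [Fintype L] [DecidableEq L] in
/-- Growth step inside a connecting line set `S`: a proper vertex set containing `v₀` is left by a line
of `S`. [cite: FeldmanSalmhoferTrubowitz1999, §2.1 p0004:L44-47] -/
theorem exists_crossing_sub {S : Finset L} {U : Finset V} {v₀ w : V} (hS : G.Reachable S v₀ w)
    (hv₀ : v₀ ∈ U) (hwU : w ∉ U) : ∃ l ∈ S, ∃ u ∈ U, ∃ x, x ∉ U ∧ G.Joins l u x := by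
  suffices key : ∀ y, G.Reachable S v₀ y → y ∈ U ∨ ∃ l ∈ S, ∃ u ∈ U, ∃ x, x ∉ U ∧ G.Joins l u x by
    rcases key w hS with h | h
    · exact absurd h hwU
    · exact h
  intro y hy
  induction hy with
  | refl => exact Or.inl hv₀
  | @tail b c _ hbc ih =>
    rcases ih with hbU | hcross
    · obtain ⟨l, hl, hj⟩ := hbc
      by_cases hcU : c ∈ U
      · exact Or.inl hcU
      · exact Or.inr ⟨l, hl, b, hbU, c, hcU, hj⟩
    · exact Or.inr hcross

/-- Inside any connecting line set `S` there is a spanning tree (growth induction).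
[cite: FeldmanSalmhoferTrubowitz1999, §2.1 p0004:L44-47] -/
theorem exists_tree_sub_aux {S : Finset L} (hS : ∀ v w : V, G.Reachable S v w) (v₀ : V) :
    ∀ (n : ℕ) (U : Finset V) (T : Finset L), v₀ ∈ U → T ⊆ S → T ⊆ G.induced U →
      (∀ x ∈ U, G.Reachable T v₀ x) → T.card + 1 = U.card → U.card + n = Fintype.card V →
      ∃ T' : Finset L, T' ⊆ S ∧ (∀ x, G.Reachable T' v₀ x) ∧ T'.card + 1 = Fintype.card V := by
  intro n
  induction n with
  | zero =>
    intro U T _ hTS _ hreach hcard hn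
    have hU : U = Finset.univ := Finset.eq_univ_of_card U (by rw [← hn]; simp)
    subst hU
    exact ⟨T, hTS, fun x => hreach x (Finset.mem_univ x), by rw [hcard, ← hn]; simp⟩
  | succ n ih =>
    intro U T hv₀U hTS hT hreach hcard hn
    have hne : U ≠ Finset.univ := fun h => by
      rw [h, Finset.card_univ] at hn; omega
    obtain ⟨w, -, hwU⟩ := Finset.exists_of_ssubset
      (Finset.ssubset_iff_subset_ne.mpr ⟨Finset.subset_univ U, hne⟩)
    obtain ⟨l, hl, u, huU, x, hxU, hj⟩ := G.exists_crossing_sub (hS v₀ w) hv₀U hwU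
    have hlT : l ∉ T := fun hlT => hxU ((G.mem_induced_iff_of_joins hj).mp (hT hlT)).2
    refine ih (insert x U) (insert l T) (Finset.mem_insert_of_mem hv₀U)
      (Finset.insert_subset hl hTS) ?_ ?_ ?_ ?_
    · intro l' hl'
      rcases Finset.mem_insert.mp hl' with rfl | hl'T
      · exact (G.mem_induced_iff_of_joins hj).mpr
          ⟨Finset.mem_insert_of_mem huU, Finset.mem_insert_self x U⟩
      · exact G.induced_mono (Finset.subset_insert x U) (hT hl'T)
    · intro y hy
      rcases Finset.mem_insert.mp hy with rfl | hyU
      · exact ((hreach u huU).mono (Finset.subset_insert l T)).tail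
          ⟨l, Finset.mem_insert_self l T, hj⟩
      · exact (hreach y hyU).mono (Finset.subset_insert l T)
    · rw [Finset.card_insert_of_notMem hlT, Finset.card_insert_of_notMem hxU, hcard]
    · rw [Finset.card_insert_of_notMem hxU]
      omega

/-- **A connecting set of lines has at least `|V| - 1` elements** (it contains a spanning tree).
[cite: FeldmanSalmhoferTrubowitz1999, §2.1 p0004:L44-47] -/
theorem card_add_one_ge_of_connects [Nonempty V] {S : Finset L} (hS : ∀ v w : V, G.Reachable S v w) :
    Fintype.card V ≤ S.card + 1 := by
  obtain ⟨v₀⟩ := ‹Nonempty V›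
  have hpos : 0 < Fintype.card V := Fintype.card_pos
  obtain ⟨T, hTS, -, hcard⟩ := G.exists_tree_sub_aux hS v₀ (Fintype.card V - 1) {v₀} ∅
    (Finset.mem_singleton_self v₀) (Finset.empty_subset _) (Finset.empty_subset _)
    (fun x hx => by rw [Finset.mem_singleton.mp hx]; exact Relation.ReflTransGen.refl) (by simp)
    (by rw [Finset.card_singleton]; omega)
  have := Finset.card_le_card hTS
  omega

omit [Fintype V] [Fintype L] [DecidableEq V] in
/-- If the ends of `θ` are still joined in `T - θ`, then `T - θ` connects whatever `T` connects.
[cite: FeldmanSalmhoferTrubowitz1999, §2.1 p0004:L48-53] -/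
theorem reachable_erase_of_detour {T : Finset L} {θ : L}
    (hdet : G.Reachable (T.erase θ) (G.fst θ) (G.snd θ)) {v w : V} (h : G.Reachable T v w) :
    G.Reachable (T.erase θ) v w := by
  induction h with
  | refl => exact Relation.ReflTransGen.refl
  | @tail b c _ hbc ih =>
    obtain ⟨l, hl, hj⟩ := hbc
    by_cases hlθ : l = θ
    · subst hlθ
      rcases hj with ⟨h1, h2⟩ | ⟨h1, h2⟩
      · exact ih.trans (by rw [← h1, ← h2]; exact hdet)
      · exact ih.trans (by rw [← h1, ← h2]; exact hdet.symm)
    · exact ih.tail ⟨l, Finset.mem_erase.mpr ⟨hlθ, hl⟩, hj⟩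

/-- In a spanning tree, removing a line disconnects: `T - θ` no longer joins all vertices.
[cite: FeldmanSalmhoferTrubowitz1999, §2.1 p0004:L44-47] -/
theorem IsSpanningTree.not_connects_erase {T : Finset L} (hT : G.IsSpanningTree T) {θ : L} (hθ : θ ∈ T) :
    ¬ ∀ v w : V, G.Reachable (T.erase θ) v w := by
  intro h
  haveI : Nonempty V := ⟨G.fst θ⟩
  have h1 := G.card_add_one_ge_of_connects h
  rw [Finset.card_erase_of_mem hθ] at h1
  have h2 := hT.2
  have h3 := Finset.card_pos.mpr ⟨θ, hθ⟩
  omega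

/-- The loop of a tree line "contains itself": its ends are separated in `T - θ` (no detour).
[cite: FeldmanSalmhoferTrubowitz1999, §2.1 p0004:L48-53] -/
theorem IsSpanningTree.loopContains_self {T : Finset L} (hT : G.IsSpanningTree T) {θ : L} (hθ : θ ∈ T) :
    G.LoopContains T θ θ :=
  fun hdet => hT.not_connects_erase G hθ fun v w => G.reachable_erase_of_detour hdet (hT.1 v w)

/-- A spanning tree contains no self-contraction. [cite: FeldmanSalmhoferTrubowitz1999, §2.1 p0004:L44-47] -/
theorem IsSpanningTree.fst_ne_snd {T : Finset L} (hT : G.IsSpanningTree T) {θ : L} (hθ : θ ∈ T) :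
    G.fst θ ≠ G.snd θ := fun h =>
  hT.loopContains_self G hθ (by
    rw [h]
    exact Relation.ReflTransGen.refl)

/-- A spanning tree contains no two parallel lines. [cite: FeldmanSalmhoferTrubowitz1999, §2.1 p0004:L44-47] -/
theorem IsSpanningTree.not_joins_of_ne {T : Finset L} (hT : G.IsSpanningTree T) {θ θ' : L} (hθ : θ ∈ T)
    (hθ' : θ' ∈ T) (hne : θ' ≠ θ) : ¬ G.Joins θ' (G.fst θ) (G.snd θ) := fun hj =>
  hT.loopContains_self G hθ (Relation.ReflTransGen.single ⟨θ', Finset.mem_erase.mpr ⟨hne, hθ'⟩, hj⟩)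

omit [Fintype L] [DecidableEq V] in
/-- After removing `θ` from a spanning tree every vertex is still joined to one of the two ends of `θ`.
[cite: FeldmanSalmhoferTrubowitz1999, §2.1 p0004:L48-53] -/
theorem IsSpanningTree.reachable_erase_or {T : Finset L} (hT : G.IsSpanningTree T) (θ : L) (v : V) :
    G.Reachable (T.erase θ) (G.fst θ) v ∨ G.Reachable (T.erase θ) (G.snd θ) v := by
  suffices key : ∀ w, G.Reachable T (G.fst θ) w →
      (G.Reachable (T.erase θ) (G.fst θ) w ∨ G.Reachable (T.erase θ) (G.snd θ) w) from
    key v (hT.1 _ v)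
  intro w hw
  induction hw with
  | refl => exact Or.inl Relation.ReflTransGen.refl
  | @tail b c _ hbc ih =>
    obtain ⟨l, hl, hj⟩ := hbc
    by_cases hlθ : l = θ
    · subst hlθ
      rcases hj with ⟨_, h2⟩ | ⟨h1, _⟩
      · right; rw [← h2]; exact Relation.ReflTransGen.refl
      · left; rw [← h1]; exact Relation.ReflTransGen.refl
    · have hl' : l ∈ T.erase θ := Finset.mem_erase.mpr ⟨hlθ, hl⟩
      rcases ih with ih | ih
      · exact Or.inl (ih.tail ⟨l, hl', hj⟩)
      · exact Or.inr (ih.tail ⟨l, hl', hj⟩)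

omit [Fintype L] [DecidableEq V] in
/-- **The loop of `ℓ` contains the tree line `θ` iff exactly one end of `ℓ` lies on the side of
`fst θ` in `T - θ`** (the cut of a tree line). [cite: FeldmanSalmhoferTrubowitz1999, §2.1 p0004:L48-53] -/
theorem IsSpanningTree.loopContains_iff {T : Finset L} (hT : G.IsSpanningTree T) (θ l : L) :
    G.LoopContains T l θ ↔ ¬ (G.Reachable (T.erase θ) (G.fst θ) (G.fst l) ↔
      G.Reachable (T.erase θ) (G.fst θ) (G.snd l)) := by
  constructor
  · intro hlc hiff
    apply hlc
    rcases hT.reachable_erase_or G θ (G.fst l) with h1 | h1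
    · exact h1.symm.trans (hiff.mp h1)
    · rcases hT.reachable_erase_or G θ (G.snd l) with h2 | h2
      · exact (hiff.mpr h2).symm.trans h2
      · exact h1.symm.trans h2
  · intro hne hreach
    exact hne ⟨fun h => h.trans hreach, fun h => h.trans hreach.symm⟩

end TreeCuts

/-! ### The wicked ladder is not DOL (p0006:L102–103) -/

section Ladder

variable [Fintype V] [Fintype L] [DecidableEq V] [DecidableEq L]

/-- Discrete intermediate value theorem: a predicate that differs at `0` and `m` changes at some step.
[cite: FeldmanSalmhoferTrubowitz1999, §2.2 p0006:L102-103] -/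
theorem exists_step_of_not_iff {P : ℕ → Prop} :
    ∀ {m : ℕ}, ¬ (P 0 ↔ P m) → ∃ i, 1 ≤ i ∧ i ≤ m ∧ ¬ (P (i - 1) ↔ P i)
  | 0, h => absurd Iff.rfl h
  | m + 1, h => by
    by_cases hm : (P 0 ↔ P m)
    · exact ⟨m + 1, by omega, le_rfl, fun h' => h (hm.trans (by simpa using h'))⟩
    · obtain ⟨i, hi1, him, hi⟩ := exists_step_of_not_iff hm
      exact ⟨i, hi1, by omega, hi⟩

/-- A predicate that agrees at `0` and `m` but changes at the step `i₀` changes at a second step.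
[cite: FeldmanSalmhoferTrubowitz1999, §2.2 p0006:L102-103] -/
theorem exists_second_step {P : ℕ → Prop} {m i₀ : ℕ} (h0 : P 0 ↔ P m) (hi₀ : 1 ≤ i₀) (hi₀m : i₀ ≤ m)
    (hstep : ¬ (P (i₀ - 1) ↔ P i₀)) : ∃ j, 1 ≤ j ∧ j ≤ m ∧ j ≠ i₀ ∧ ¬ (P (j - 1) ↔ P j) := by
  by_cases hA : (P 0 ↔ P (i₀ - 1))
  · have hB : ¬ (P i₀ ↔ P m) := fun hB => hstep (hA.symm.trans (h0.trans hB.symm))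
    have hB' : ¬ ((fun k => P (i₀ + k)) 0 ↔ (fun k => P (i₀ + k)) (m - i₀)) := by
      simpa [Nat.add_sub_cancel' hi₀m] using hB
    obtain ⟨k, hk1, hkm, hk⟩ := exists_step_of_not_iff (P := fun k => P (i₀ + k)) hB'
    refine ⟨i₀ + k, by omega, by omega, by omega, ?_⟩
    have hk' : i₀ + k - 1 = i₀ + (k - 1) := by omega
    rw [hk']
    exact hk
  · obtain ⟨j, hj1, hjm, hj⟩ := exists_step_of_not_iff hA
    exact ⟨j, hj1, by omega, by omega, hj⟩

open Classical in
/-- **The wicked ladder is not DOL** (p0006:L102–103: "The graph in Figure 11 is DOL, but the one in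
Figure 12, the wicked ladder, is not"), for the typed shape `IsWickedLadderShape a b n` (any `n`; for
`n ≤ 1` the graph has at most two vertices). Proof: a spanning tree `T` of the ladder uses one line of
each of `n` of the `n + 1` gaps of the cycle `u₀ u₁ ⋯ uₙ u₀` and misses exactly one gap `g*`; the cut of a
tree line `θ` is crossed exactly by the lines of its own gap and of `g*` (discrete intermediate value
theorem around the cycle); hence a line whose loop contains `ζ` but not `θ` is parallel to `ζ`, and the
gap of `ζ` holds at most one line besides `ζ` — no `k₁ ≠ k₂`. Together with `IsSunsetShape.not_isDOL`
and `IsMultipleSunsetShape.not_isDOL`: all three families of Theorem 2.6 are non-DOL.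
[cite: FeldmanSalmhoferTrubowitz1999, §2.2 p0006:L102-103] -/
theorem IsWickedLadderShape.not_isDOL {G : FGraph V L} {a b : V} {n : ℕ}
    (hW : G.IsWickedLadderShape a b n) : ¬ G.IsDOL := by
  classical
  obtain ⟨u, hbij, -, -, hcount⟩ := hW
  have hcardV : Fintype.card V = n + 1 := by
    rw [← Fintype.card_of_bijective hbij, Fintype.card_fin]
  by_cases hn : n ≤ 1
  · exact G.not_isDOL_of_card_le_two (by omega)
  have hn2 : 2 ≤ n := by omega
  rintro ⟨T, hT, θ, hθ, ζ, hζ, hθζ, l₁, l₂, k₁, k₂, -, -, hk₁, hk₂, -, -, -, -, -, h34, -, -,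
    hK₁, hK₂, hK₁θ, hK₂θ⟩
  -- indexing of the vertices
  set e : Fin (n + 1) ≃ V := Equiv.ofBijective u hbij with he
  have heu : ∀ i, e i = u i := fun i => rfl
  have hue : ∀ v, u (e.symm v) = v := fun v => by rw [← heu, Equiv.apply_symm_apply]
  have hlastv : ((Fin.last n : Fin (n + 1)) : ℕ) = n := rfl
  -- the gap of a line: lo < hi indices of its ends, and its code
  set lo : L → Fin (n + 1) := fun l => min (e.symm (G.fst l)) (e.symm (G.snd l)) with hlo
  set hi : L → Fin (n + 1) := fun l => max (e.symm (G.fst l)) (e.symm (G.snd l)) with hhi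
  set code : L → ℕ := fun l => if ((hi l : ℕ) = (lo l : ℕ) + 1) then (hi l : ℕ) else 0 with hcode
  have hjoins : ∀ l, G.Joins l (u (lo l)) (u (hi l)) := by
    intro l
    rcases le_total (e.symm (G.fst l)) (e.symm (G.snd l)) with h | h
    · have h1 : lo l = e.symm (G.fst l) := min_eq_left h
      have h2 : hi l = e.symm (G.snd l) := max_eq_right h
      rw [h1, h2, hue, hue]; exact Or.inl ⟨rfl, rfl⟩
    · have h1 : lo l = e.symm (G.snd l) := min_eq_right h
      have h2 : hi l = e.symm (G.fst l) := max_eq_left h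
      rw [h1, h2, hue, hue]; exact Or.inr ⟨rfl, rfl⟩
  have hlt : ∀ l, G.fst l ≠ G.snd l → lo l < hi l := by
    intro l hne
    refine min_lt_max.mpr fun h => hne ?_
    have := congrArg u h
    rwa [hue, hue] at this
  -- the printed line counts force every line into a gap
  have hgap : ∀ l, G.fst l ≠ G.snd l →
      ((hi l : ℕ) = (lo l : ℕ) + 1) ∨ (lo l = 0 ∧ hi l = Fin.last n) := by
    intro l hne
    have hpos : 0 < G.lineCount (u (lo l)) (u (hi l)) :=
      Finset.card_pos.mpr ⟨l, Finset.mem_filter.mpr ⟨Finset.mem_univ l, hjoins l⟩⟩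
    have hc := hcount (lo l) (hi l) (hlt l hne)
    by_contra hno
    rw [not_or] at hno
    rw [if_neg hno.1, if_neg hno.2] at hc
    omega
  have hcode_le : ∀ l, code l ≤ n := by
    intro l
    simp only [hcode]
    split_ifs
    · exact Nat.lt_succ_iff.mp (hi l).isLt
    · exact Nat.zero_le n
  -- code determines the gap (for lines that are not self-contractions)
  have hcode0 : ∀ l, G.fst l ≠ G.snd l → code l = 0 → lo l = 0 ∧ hi l = Fin.last n := by
    intro l hne hc
    simp only [hcode] at hc
    split_ifs at hc with h
    · exact absurd hc (by have := (hlt l hne); omega)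
    · exact (hgap l hne).resolve_left h
  have hcode1 : ∀ l, G.fst l ≠ G.snd l → code l ≠ 0 →
      (hi l : ℕ) = (lo l : ℕ) + 1 ∧ code l = (hi l : ℕ) := by
    intro l hne hc
    simp only [hcode] at hc ⊢
    split_ifs at hc ⊢ with h
    · exact ⟨h, rfl⟩
    · exact absurd rfl hc
  have hsamegap : ∀ l l', G.fst l ≠ G.snd l → G.fst l' ≠ G.snd l' → code l = code l' →
      lo l = lo l' ∧ hi l = hi l' := by
    intro l l' hne hne' hc
    by_cases h0 : code l = 0
    · obtain ⟨h1, h2⟩ := hcode0 l hne h0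
      obtain ⟨h1', h2'⟩ := hcode0 l' hne' (hc ▸ h0)
      exact ⟨h1.trans h1'.symm, h2.trans h2'.symm⟩
    · obtain ⟨h1, h2⟩ := hcode1 l hne h0
      obtain ⟨h1', h2'⟩ := hcode1 l' hne' (fun h => h0 (hc.trans h))
      have hh : (hi l : ℕ) = hi l' := by rw [← h2, hc, h2']
      refine ⟨Fin.ext ?_, Fin.ext hh⟩
      omega
  -- parallel lines: same code ⇒ l' joins the ends of l
  have hparallel : ∀ l l', G.fst l ≠ G.snd l → G.fst l' ≠ G.snd l' → code l = code l' →
      G.Joins l' (G.fst l) (G.snd l) := by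
    intro l l' hne hne' hc
    obtain ⟨h1, h2⟩ := hsamegap l l' hne hne' hc
    have hj' : G.Joins l' (u (lo l)) (u (hi l)) := by rw [h1, h2]; exact hjoins l'
    rcases hjoins l with ⟨hf, hs⟩ | ⟨hf, hs⟩
    · rw [hf, hs]; exact hj'
    · rw [hf, hs]; exact hj'.symm
  -- tree lines have pairwise distinct codes
  have hTne : ∀ τ ∈ T, G.fst τ ≠ G.snd τ := fun τ hτ => hT.fst_ne_snd G hτ
  have hinj : ∀ τ ∈ T, ∀ τ' ∈ T, code τ = code τ' → τ = τ' := by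
    intro τ hτ τ' hτ' hc
    by_contra hne
    exact hT.not_joins_of_ne G hτ hτ' (Ne.symm hne) (hparallel τ τ' (hTne τ hτ) (hTne τ' hτ') hc)
  -- the free gap g⋆
  have hTcard : T.card = n := by have := hT.2; omega
  have himg : (T.image code).card = n := by
    rw [Finset.card_image_of_injOn (fun τ hτ τ' hτ' h => hinj τ hτ τ' hτ' h), hTcard]
  have hsub : T.image code ⊆ Finset.range (n + 1) := by
    intro g hg
    obtain ⟨τ, -, rfl⟩ := Finset.mem_image.mp hg
    exact Finset.mem_range.mpr (Nat.lt_succ_of_le (hcode_le τ))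
  obtain ⟨gs, hgs, hgsT⟩ : ∃ g ∈ Finset.range (n + 1), g ∉ T.image code :=
    Finset.exists_mem_notMem_of_card_lt_card (by rw [himg, Finset.card_range]; omega)
  have huniq : ∀ g, g ≤ n → g ∉ T.image code → g = gs := by
    intro g hg hgT
    by_contra hne
    have hsub' : T.image code ⊆ ((Finset.range (n + 1)).erase gs).erase g := by
      intro x hx
      refine Finset.mem_erase.mpr ⟨fun h => hgT (h ▸ hx), Finset.mem_erase.mpr ⟨fun h => hgsT (h ▸ hx), hsub hx⟩⟩
    have := Finset.card_le_card hsub'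
    rw [Finset.card_erase_of_mem (Finset.mem_erase.mpr ⟨hne, Finset.mem_range.mpr (by omega)⟩),
      Finset.card_erase_of_mem hgs, Finset.card_range, himg] at this
    omega
  -- the side of u_i with respect to a tree line τ, and crossing of a gap code
  set side : L → ℕ → Prop := fun τ i => ∃ h : i < n + 1, G.Reachable (T.erase τ) (G.fst τ) (u ⟨i, h⟩)
    with hside
  have hside_iff : ∀ τ (i : Fin (n + 1)), side τ i ↔ G.Reachable (T.erase τ) (G.fst τ) (u i) := by
    intro τ i
    simp only [hside]
    exact ⟨fun ⟨_, h⟩ => h, fun h => ⟨i.isLt, h⟩⟩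
  set cross : L → ℕ → Prop := fun τ g =>
    if g = 0 then ¬ (side τ 0 ↔ side τ n) else ¬ (side τ (g - 1) ↔ side τ g) with hcross
  -- LoopContains ↔ the gap of the line crosses the cut
  have hlink : ∀ τ ∈ T, ∀ l, G.fst l ≠ G.snd l → (G.LoopContains T l τ ↔ cross τ (code l)) := by
    intro τ hτ l hne
    rw [hT.loopContains_iff G τ l]
    -- rewrite the ends of l as u (lo l), u (hi l)
    have key : ¬ (G.Reachable (T.erase τ) (G.fst τ) (G.fst l) ↔ G.Reachable (T.erase τ) (G.fst τ) (G.snd l)) ↔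
        ¬ (side τ (lo l : ℕ) ↔ side τ (hi l : ℕ)) := by
      rw [hside_iff τ (lo l), hside_iff τ (hi l)]
      rcases hjoins l with ⟨hf, hs⟩ | ⟨hf, hs⟩
      · rw [hf, hs]
      · rw [hf, hs]; exact not_congr Iff.comm
    rw [key]
    by_cases h0 : code l = 0
    · obtain ⟨h1, h2⟩ := hcode0 l hne h0
      simp only [hcross, h0, if_true, h1, h2, Fin.val_zero, hlastv]
    · obtain ⟨h1, h2⟩ := hcode1 l hne h0
      simp only [hcross, if_neg h0]
      rw [h2, h1, Nat.add_sub_cancel]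
  -- for a tree line τ: its own gap crosses, gaps of other tree lines do not, hence g⋆ crosses
  have hcross_gs : ∀ τ ∈ T, cross τ gs := by
    intro τ hτ
    have hself : cross τ (code τ) := (hlink τ hτ τ (hTne τ hτ)).mp (hT.loopContains_self G hτ)
    have hothers : ∀ τ' ∈ T, τ' ≠ τ → ¬ cross τ (code τ') := by
      intro τ' hτ' hne hc
      have hlc := (hlink τ hτ τ' (hTne τ' hτ')).mpr hc
      exact hlc (Relation.ReflTransGen.single ⟨τ', Finset.mem_erase.mpr ⟨hne, hτ'⟩, Or.inl ⟨rfl, rfl⟩⟩)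
    have hclass : ∀ g, g ≤ n → cross τ g → g ≠ code τ → g = gs := by
      intro g hg hc hne
      refine huniq g hg fun hmem => ?_
      obtain ⟨τ', hτ', hτ'c⟩ := Finset.mem_image.mp hmem
      exact hothers τ' hτ' (fun h => hne (by rw [← hτ'c, h])) (hτ'c ▸ hc)
    -- a second crossing gap exists (discrete IVT around the cycle)
    obtain ⟨g, hg, hgc, hgne⟩ : ∃ g, g ≤ n ∧ cross τ g ∧ g ≠ code τ := by
      by_cases h0 : code τ = 0
      · have hc0 : ¬ (side τ 0 ↔ side τ n) := by
          have := hself; rw [h0] at this; simpa [hcross] using this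
        obtain ⟨g, hg1, hgn, hg⟩ := exists_step_of_not_iff (P := side τ) hc0
        refine ⟨g, hgn, ?_, by omega⟩
        simp only [hcross, if_neg (show g ≠ 0 by omega)]
        exact hg
      · obtain ⟨h1, h2⟩ := hcode1 τ (hTne τ hτ) h0
        have hcpos : 1 ≤ code τ := Nat.one_le_iff_ne_zero.mpr h0
        have hcle : code τ ≤ n := hcode_le τ
        have hstep : ¬ (side τ (code τ - 1) ↔ side τ (code τ)) := by
          have := hself; simpa [hcross, h0] using this
        by_cases h0n : (side τ 0 ↔ side τ n)
        · obtain ⟨g, hg1, hgn, hgne, hg⟩ := exists_second_step h0n hcpos hcle hstep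
          refine ⟨g, hgn, ?_, hgne⟩
          simp only [hcross, if_neg (show g ≠ 0 by omega)]
          exact hg
        · refine ⟨0, Nat.zero_le n, ?_, fun h => h0 h.symm⟩
          simp only [hcross, if_true]
          exact h0n
    rw [← hclass g hg hgc hgne]
    exact hgc
  -- a line whose loop contains ζ but not θ is parallel to ζ
  have hkpar : ∀ k, k ∉ T → G.LoopContains T k ζ → ¬ G.LoopContains T k θ → code k = code ζ := by
    intro k hkT hkζ hkθ
    have hkne : G.fst k ≠ G.snd k := fun h => G.not_loopContains_of_isSelfContraction h T ζ hkζ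
    have hcζ : cross ζ (code k) := (hlink ζ hζ k hkne).mp hkζ
    have hcθ : ¬ cross θ (code k) := fun h => hkθ ((hlink θ hθ k hkne).mpr h)
    by_contra hne
    -- then code k = g⋆, which crosses the θ-cut
    have hothers : ∀ τ' ∈ T, τ' ≠ ζ → ¬ cross ζ (code τ') := by
      intro τ' hτ' hne' hc
      have hlc := (hlink ζ hζ τ' (hTne τ' hτ')).mpr hc
      exact hlc (Relation.ReflTransGen.single ⟨τ', Finset.mem_erase.mpr ⟨hne', hτ'⟩, Or.inl ⟨rfl, rfl⟩⟩)
    have hkgs : code k = gs := by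
      refine huniq (code k) (hcode_le k) fun hmem => ?_
      obtain ⟨τ', hτ', hτ'c⟩ := Finset.mem_image.mp hmem
      exact hothers τ' hτ' (fun h => hne (by rw [← hτ'c, h])) (hτ'c ▸ hcζ)
    exact hcθ (hkgs ▸ hcross_gs θ hθ)
  -- k₁, k₂ and ζ all lie in the gap of ζ: three distinct lines between two vertices of a gap
  have hk₁ne : G.fst k₁ ≠ G.snd k₁ := fun h => G.not_loopContains_of_isSelfContraction h T ζ hK₁
  have hk₂ne : G.fst k₂ ≠ G.snd k₂ := fun h => G.not_loopContains_of_isSelfContraction h T ζ hK₂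
  have hζne : G.fst ζ ≠ G.snd ζ := hTne ζ hζ
  have hc₁ := hkpar k₁ hk₁ hK₁ hK₁θ
  have hc₂ := hkpar k₂ hk₂ hK₂ hK₂θ
  have hmem : ∀ l, G.fst l ≠ G.snd l → code l = code ζ →
      l ∈ Finset.univ.filter fun l' => G.Joins l' (u (lo ζ)) (u (hi ζ)) := by
    intro l hne hc
    obtain ⟨h1, h2⟩ := hsamegap l ζ hne hζne hc
    exact Finset.mem_filter.mpr ⟨Finset.mem_univ l, by rw [← h1, ← h2]; exact hjoins l⟩
  have h3 : 3 ≤ G.lineCount (u (lo ζ)) (u (hi ζ)) := by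
    have hsub3 : ({k₁, k₂, ζ} : Finset L) ⊆ Finset.univ.filter fun l' => G.Joins l' (u (lo ζ)) (u (hi ζ)) := by
      intro l hl
      simp only [Finset.mem_insert, Finset.mem_singleton] at hl
      rcases hl with rfl | rfl | rfl
      · exact hmem _ hk₁ne hc₁
      · exact hmem _ hk₂ne hc₂
      · exact hmem _ hζne rfl
    have hk₁ζ : k₁ ≠ ζ := fun h => hk₁ (h ▸ hζ)
    have hk₂ζ : k₂ ≠ ζ := fun h => hk₂ (h ▸ hζ)
    have hcard3 : ({k₁, k₂, ζ} : Finset L).card = 3 := by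
      rw [Finset.card_insert_of_notMem (by simp [h34, hk₁ζ]), Finset.card_pair hk₂ζ]
    exact hcard3 ▸ Finset.card_le_card hsub3
  -- but a gap of the ladder (n ≥ 2) carries at most two lines
  have hc := hcount (lo ζ) (hi ζ) (hlt ζ hζne)
  have h2 : G.lineCount (u (lo ζ)) (u (hi ζ)) ≤ 2 := by
    rw [hc]
    rcases hgap ζ hζne with h | ⟨h1, h2⟩
    · rw [if_pos h]
      split_ifs with h'
      · exfalso
        obtain ⟨h1, h2⟩ := h'
        rw [h1, h2, hlastv, Fin.val_zero] at h
        omega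
      · omega
    · have : ¬ ((hi ζ : ℕ) = (lo ζ : ℕ) + 1) := by rw [h1, h2, hlastv, Fin.val_zero]; omega
      rw [if_neg this]
      split_ifs <;> omega
  omega

end Ladder

/-! ### Both external legs at ONE vertex (`t = 0`): Flag 1 of the statement file; the case "`G̃` … has
only one external vertex" of Theorem 3.11 (p0016:L171–176), treated in its proof by "The remaining case
is `t_G̃ = 0` … Otherwise, `G` is overlapping" (p0018:L54–57) -/

section TZero

variable [Fintype V] [Fintype L] [DecidableEq V] [DecidableEq L] (G : FGraph V L)

omit [Fintype L] [DecidableEq L] in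
/-- In a two-legged graph with BOTH external legs at the vertex `a` (`ext a = 2`), every other vertex
carries none. [cite: FeldmanSalmhoferTrubowitz1999, §2 p0004:L22-25] -/
theorem ext_eq_zero_of_ext_eq_two (h2 : G.IsTwoLegged) {a : V} (ha : G.ext a = 2) {v : V}
    (hva : v ≠ a) : G.ext v = 0 := by
  have hsum : ∑ x, G.ext x = 2 := h2
  have hle : ∑ x ∈ ({a, v} : Finset V), G.ext x ≤ ∑ x, G.ext x :=
    Finset.sum_le_sum_of_subset (Finset.subset_univ _)
  rw [Finset.sum_pair hva.symm, ha, hsum] at hle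
  omega

/-- **The `t = 0` counterpart of `three_le_card_linesBetween_compl`.** In a two-legged skeleton graph
with even incidence numbers and both external legs at `a`, every nonempty vertex set `W` NOT containing
`a` is left by at least FOUR lines: the induced subgraph on `W` is proper and has `0 + k` legs, an even
number (`even_subgraphLegs`) different from `2` (skeleton), and `k ≥ 1` because `G` is connected
(the same count as "`G₁`, `G₂` and `G'` must all have an even number of legs … `G` is 1PI, so
`k₁ ≥ 3`", p0005:L101–106, with no external leg inside `W`).
[cite: FeldmanSalmhoferTrubowitz1999, Lemma 2.5 (proof) p0005:L101-107] -/
theorem four_le_card_linesBetween_compl_of_ext_eq_two (hev : G.EvenIncidence) (h2 : G.IsTwoLegged)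
    {a : V} (ha : G.ext a = 2) (hsk : G.IsSkeleton) {W : Finset V} (haW : a ∉ W) (hW : W.Nonempty) :
    4 ≤ (G.linesBetween W Wᶜ).card := by
  have hext : ∑ v ∈ W, G.ext v = 0 :=
    Finset.sum_eq_zero fun v hv => G.ext_eq_zero_of_ext_eq_two h2 ha fun h => haW (h ▸ hv)
  have heven := even_subgraphLegs hev (G.isSubgraph_induced W)
  have hne : G.subgraphLegs W (G.induced W) ≠ 2 :=
    hsk.2.2.2 W _ (G.isSubgraph_induced W) (Or.inl fun h => haW (h ▸ Finset.mem_univ a))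
  rw [subgraphLegs_induced, hext, zero_add] at heven hne
  obtain ⟨w, hw⟩ := hW
  obtain ⟨l, -, u, hu, x, -, hxW, hj⟩ :=
    G.exists_crossing (G.isConnectedOn_univ hsk.1) (Finset.subset_univ W) hw (Finset.mem_univ a) haW
  have hl : l ∈ G.linesBetween W Wᶜ :=
    (G.mem_linesBetween_iff).mpr ⟨u, hu, x, Finset.mem_compl.mpr hxW, hj⟩
  have hpos : 0 < (G.linesBetween W Wᶜ).card := Finset.card_pos.mpr ⟨l, hl⟩
  rcases heven with ⟨k, hk⟩
  omega

/-- **The external vertex of a `t = 0` two-legged skeleton graph is at least six-legged**: its two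
external legs plus the `≥ 4` lines to the rest of the graph (`four_le_card_linesBetween_compl_of_ext_eq_two`
for `W = V ∖ {a}`, nonempty since a skeleton has `≥ 2` vertices), plus twice its self-contractions
(`subgraphLegs_add_two_mul_card` for `W = {a}`). So the `t = 0` graphs of Flag 1 only occur with a
"`2m`–legged" external vertex, `m ≥ 3` (Thm 2.6: "with the vertices possibly being `2m`–legged
vertices", p0006:L107; in the bounds of §3 these are the quotient graphs `G̃(φ)` whose external legs
both enter one condensed subgraph, "has only one external vertex", p0016:L176).
[cite: FeldmanSalmhoferTrubowitz1999, Thm 3.11 p0016:L171-176] -/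
theorem six_le_incidence_of_ext_eq_two (hev : G.EvenIncidence) (h2 : G.IsTwoLegged) {a : V}
    (ha : G.ext a = 2) (hsk : G.IsSkeleton) : 6 ≤ G.incidence a := by
  have hne : (({a} : Finset V)ᶜ).Nonempty := by
    by_contra h
    rw [Finset.not_nonempty_iff_eq_empty, Finset.compl_eq_empty_iff] at h
    have hcard := hsk.2.1
    rw [← Finset.card_univ, ← h, Finset.card_singleton] at hcard
    omega
  have h4 := G.four_le_card_linesBetween_compl_of_ext_eq_two hev h2 ha hsk
    (by simp : a ∉ (({a} : Finset V)ᶜ)) hne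
  rw [compl_compl, linesBetween_comm] at h4
  have hlegs := G.subgraphLegs_add_two_mul_card (G.isSubgraph_induced {a})
  rw [Finset.sum_singleton, subgraphLegs_induced, Finset.sum_singleton, ha] at hlegs
  omega

/-- **No two-legged skeleton graph carries both external legs at a FOUR-legged vertex.** In
particular a graph all of whose vertices are four-legged (a graph of bare perturbation theory in a
two-body interaction, no condensed subgraphs) is never a `t = 0` skeleton: the `t = 0` members of
Flag 1 (outside the three families of Theorem 2.6) need a fat external vertex.
[cite: FeldmanSalmhoferTrubowitz1999, Thm 2.6 p0006:L106-108] -/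
theorem not_isSkeleton_of_incidence_eq_four (hev : G.EvenIncidence) (h2 : G.IsTwoLegged) {a : V}
    (ha : G.ext a = 2) (h4 : G.incidence a = 4) : ¬ G.IsSkeleton := fun hsk => by
  have h6 := G.six_le_incidence_of_ext_eq_two hev h2 ha hsk
  omega

/-- **"Otherwise, `G` is overlapping"** — the `t = 0` case in the proof of Theorem 3.11 (p0018:L54–57),
PROVED for the typed definitions in the strong form the legs count gives: a two-legged skeleton graph
with even incidence numbers and both external legs at one vertex `a` is overlapping, indeed for EVERY
spanning tree `T` and EVERY tree line `θ`: the side of the cut `T − θ` away from `a` is left by `≥ 4`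
lines (`four_le_card_linesBetween_compl_of_ext_eq_two`), no tree line other than `θ` crosses the cut,
so at least three non-tree lines cross it, and the loop of each of them contains `θ`
(`IsSpanningTree.loopContains_iff`). (For two external vertices the print has "If `G` is two-legged,
1PI, and has two external vertices, then `G` is overlapping by Lemma I.2.22", p0005:L28–29; the
one-external-vertex skeleton case is the "Otherwise" of p0018:L57, which the third alternative of
Theorem 3.11 uses: ONE overlap, one volume gain. "It was shown in Lemma I.2.34, that if `G` is
overlapping, then not only `T*`, but every spanning tree of `G` has this property" (p0004:L58–60) is
visible in the proof: `T` and `θ ∈ T` are arbitrary.)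
[cite: FeldmanSalmhoferTrubowitz1999, Thm 3.11 (proof) p0018:L54-57] -/
theorem isOverlapping_of_ext_eq_two (hev : G.EvenIncidence) (h2 : G.IsTwoLegged) {a : V}
    (ha : G.ext a = 2) (hsk : G.IsSkeleton) : G.IsOverlapping := by
  classical
  haveI : Nonempty V := ⟨a⟩
  obtain ⟨T, hT⟩ := G.exists_isSpanningTree hsk.1
  have hTne : T.Nonempty := by
    rw [← Finset.card_pos]
    have h1 := hT.2
    have h2' := hsk.2.1
    omega
  obtain ⟨θ, hθ⟩ := hTne
  -- the side of `fst θ` in the cut tree `T - θ`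
  set A : Finset V := Finset.univ.filter fun v => G.Reachable (T.erase θ) (G.fst θ) v with hA
  have hmemA : ∀ v, v ∈ A ↔ G.Reachable (T.erase θ) (G.fst θ) v := fun v => by simp [hA]
  have hfst : G.fst θ ∈ A := (hmemA _).mpr Relation.ReflTransGen.refl
  have hsnd : G.snd θ ∉ A := fun h => hT.loopContains_self G hθ ((hmemA _).mp h)
  -- the side `W` of the cut NOT containing the external vertex `a`
  obtain ⟨W, haW, hWne, hWA⟩ : ∃ W : Finset V, a ∉ W ∧ W.Nonempty ∧ (W = A ∨ W = Aᶜ) := by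
    by_cases haA : a ∈ A
    · exact ⟨Aᶜ, by simp [haA], ⟨G.snd θ, Finset.mem_compl.mpr hsnd⟩, Or.inr rfl⟩
    · exact ⟨A, haA, ⟨G.fst θ, hfst⟩, Or.inl rfl⟩
  have h4 := G.four_le_card_linesBetween_compl_of_ext_eq_two hev h2 ha hsk haW hWne
  -- a line crossing the cut has its ends on different sides
  have hcross : ∀ l ∈ G.linesBetween W Wᶜ, ¬ (G.fst l ∈ A ↔ G.snd l ∈ A) := by
    intro l hl
    rcases hWA with rfl | rfl
    · simp only [linesBetween, Finset.mem_filter, Finset.mem_univ, true_and, Finset.mem_compl] at hl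
      tauto
    · simp only [linesBetween, Finset.mem_filter, Finset.mem_univ, true_and, Finset.mem_compl,
        compl_compl] at hl
      tauto
  -- tree lines other than `θ` do not cross the cut
  have htree : ∀ l ∈ G.linesBetween W Wᶜ, l ∈ T → l = θ := by
    intro l hl hlT
    by_contra hne
    apply hcross l hl
    have hl' : l ∈ T.erase θ := Finset.mem_erase.mpr ⟨hne, hlT⟩
    constructor
    · intro h
      exact (hmemA _).mpr (((hmemA _).mp h).tail ⟨l, hl', Or.inl ⟨rfl, rfl⟩⟩)
    · intro h
      exact (hmemA _).mpr (((hmemA _).mp h).tail ⟨l, hl', Or.inr ⟨rfl, rfl⟩⟩)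
  -- hence at least three NON-tree lines cross
  have hsub : G.linesBetween W Wᶜ ⊆ insert θ ((G.linesBetween W Wᶜ).filter fun l => l ∉ T) := by
    intro l hl
    by_cases hlT : l ∈ T
    · rw [htree l hl hlT]
      exact Finset.mem_insert_self _ _
    · exact Finset.mem_insert_of_mem (Finset.mem_filter.mpr ⟨hl, hlT⟩)
  have h3 : 3 ≤ ((G.linesBetween W Wᶜ).filter fun l => l ∉ T).card := by
    have h := (Finset.card_le_card hsub).trans (Finset.card_insert_le _ _)
    omega
  obtain ⟨l₁, hl₁, l₂, hl₂, hne⟩ := Finset.one_lt_card.mp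
    (show 1 < ((G.linesBetween W Wᶜ).filter fun l => l ∉ T).card by omega)
  rw [Finset.mem_filter] at hl₁ hl₂
  have hloop : ∀ l ∈ G.linesBetween W Wᶜ, G.LoopContains T l θ := fun l hl =>
    (hT.loopContains_iff G θ l).mpr fun hiff =>
      hcross l hl ⟨fun h => (hmemA _).mpr (hiff.mp ((hmemA _).mp h)),
        fun h => (hmemA _).mpr (hiff.mpr ((hmemA _).mp h))⟩
  exact ⟨T, hT, θ, hθ, l₁, hl₁.2, l₂, hl₂.2, hne, hloop l₁ hl₁.1, hloop l₂ hl₂.1⟩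

end TZero

/-! ### `t = 0`, continued (rev 6): the non-DOL graphs with one external vertex are the fat tadpoles
and the RINGS OF BUBBLES through that vertex (Flag 1 of the statement file made exhaustive).  The print
does not classify this case (the proof of Theorem 3.11 only uses "Otherwise, `G` is overlapping",
p0018:L57 — `isOverlapping_of_ext_eq_two` above); the classification below is proved for the typed
definitions from Definition 2.1 alone, by cuts of spanning trees. -/

section TZeroRing

variable [Fintype V] [Fintype L] [DecidableEq V] [DecidableEq L] (G : FGraph V L)

/-- P0: a-free cut bound.
[cite: FeldmanSalmhoferTrubowitz1999, Thm 3.11 (proof) p0018:L54-57] -/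
theorem four_le_card_linesBetween_compl' (hev : G.EvenIncidence) (h2 : G.IsTwoLegged) {a : V}
    (ha : G.ext a = 2) (hsk : G.IsSkeleton) {W : Finset V} (hW : W.Nonempty) (hWc : Wᶜ.Nonempty) :
    4 ≤ (G.linesBetween W Wᶜ).card := by
  by_cases haW : a ∈ W
  · have h := G.four_le_card_linesBetween_compl_of_ext_eq_two hev h2 ha hsk (W := Wᶜ)
      (by simpa using haW) hWc
    rwa [compl_compl, linesBetween_comm] at h
  · exact G.four_le_card_linesBetween_compl_of_ext_eq_two hev h2 ha hsk haW hW

/-- P0: every cut is even.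
[cite: FeldmanSalmhoferTrubowitz1999, Thm 3.11 (proof) p0018:L54-57] -/
theorem even_card_linesBetween_compl (hev : G.EvenIncidence) (h2 : G.IsTwoLegged) {a : V}
    (ha : G.ext a = 2) (W : Finset V) : Even (G.linesBetween W Wᶜ).card := by
  have heven := even_subgraphLegs hev (G.isSubgraph_induced W)
  rw [subgraphLegs_induced] at heven
  have hext : Even (∑ v ∈ W, G.ext v) := by
    by_cases haW : a ∈ W
    · rw [Finset.sum_eq_single_of_mem a haW (fun v _ hva => G.ext_eq_zero_of_ext_eq_two h2 ha hva),
        ha]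
      exact even_two
    · rw [Finset.sum_eq_zero (fun v hv => G.ext_eq_zero_of_ext_eq_two h2 ha (fun h => haW (h ▸ hv)))]
      exact Even.zero
  exact (Nat.even_add.mp heven).mp hext

omit [Fintype V] [Fintype L] [DecidableEq V] in
/-- P1: a tree line other than `θ` is not crossed (its ends are adjacent in `T - θ`).
[cite: FeldmanSalmhoferTrubowitz1999, Thm 3.11 (proof) p0018:L54-57] -/
theorem eq_of_mem_of_loopContains {T : Finset L} {θ l : L} (hl : l ∈ T)
    (h : G.LoopContains T l θ) : l = θ := by
  by_contra hne
  exact h (Relation.ReflTransGen.single ⟨l, Finset.mem_erase.mpr ⟨hne, hl⟩, Or.inl ⟨rfl, rfl⟩⟩)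

omit [Fintype V] [Fintype L] [DecidableEq V] in
/-- P1: crossing depends only on the (unordered) pair of ends.
[cite: FeldmanSalmhoferTrubowitz1999, Thm 3.11 (proof) p0018:L54-57] -/
theorem loopContains_of_joins_of_joins {T : Finset L} {θ l l' : L} {x y : V} (hj : G.Joins l x y)
    (hj' : G.Joins l' x y) (h : G.LoopContains T l θ) : G.LoopContains T l' θ := by
  intro hr
  apply h
  rcases hj with ⟨h1, h2⟩ | ⟨h1, h2⟩ <;> rcases hj' with ⟨h3, h4⟩ | ⟨h3, h4⟩
  · rw [h1, h2]; rw [h3, h4] at hr; exact hr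
  · rw [h1, h2]; rw [h3, h4] at hr; exact hr.symm
  · rw [h1, h2]; rw [h3, h4] at hr; exact hr.symm
  · rw [h1, h2]; rw [h3, h4] at hr; exact hr

/-- P1: the crossing set of a tree line is the cut between the two sides of `T - θ`.
[cite: FeldmanSalmhoferTrubowitz1999, Thm 3.11 (proof) p0018:L54-57] -/
theorem IsSpanningTree.loopContains_iff_mem_linesBetween {T : Finset L} (hT : G.IsSpanningTree T)
    (θ l : L) (A : Finset V) (hA : ∀ x, x ∈ A ↔ G.Reachable (T.erase θ) (G.fst θ) x) :
    G.LoopContains T l θ ↔ l ∈ G.linesBetween A Aᶜ := by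
  rw [hT.loopContains_iff G θ l]
  simp only [linesBetween, Finset.mem_filter, Finset.mem_univ, true_and, Finset.mem_compl, hA]
  tauto

open Classical in
/-- P1: at least three distinct non-tree lines cross every tree line, and the number of lines crossing
(the tree line included) is even.
[cite: FeldmanSalmhoferTrubowitz1999, Thm 3.11 (proof) p0018:L54-57] -/
theorem exists_three_loopContains (hev : G.EvenIncidence) (h2 : G.IsTwoLegged) {a : V}
    (ha : G.ext a = 2) (hsk : G.IsSkeleton) {T : Finset L} (hT : G.IsSpanningTree T) {θ : L}
    (hθ : θ ∈ T) :
    ∃ l₁ l₂ l₃ : L, l₁ ∉ T ∧ l₂ ∉ T ∧ l₃ ∉ T ∧ l₁ ≠ l₂ ∧ l₁ ≠ l₃ ∧ l₂ ≠ l₃ ∧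
      G.LoopContains T l₁ θ ∧ G.LoopContains T l₂ θ ∧ G.LoopContains T l₃ θ := by
  classical
  set A : Finset V := Finset.univ.filter fun x => G.Reachable (T.erase θ) (G.fst θ) x with hAdef
  have hA : ∀ x, x ∈ A ↔ G.Reachable (T.erase θ) (G.fst θ) x := fun x => by simp [hAdef]
  have h4 : 4 ≤ (G.linesBetween A Aᶜ).card :=
    G.four_le_card_linesBetween_compl' hev h2 ha hsk ⟨G.fst θ, (hA _).mpr Relation.ReflTransGen.refl⟩
      ⟨G.snd θ, Finset.mem_compl.mpr fun h => hT.loopContains_self G hθ ((hA _).mp h)⟩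
  have hθmem : θ ∈ G.linesBetween A Aᶜ :=
    (hT.loopContains_iff_mem_linesBetween G θ θ A hA).mp (hT.loopContains_self G hθ)
  have h3 : 2 < ((G.linesBetween A Aᶜ).erase θ).card := by
    rw [Finset.card_erase_of_mem hθmem]; omega
  obtain ⟨l₁, hl₁, l₂, hl₂, l₃, hl₃, h12, h13, h23⟩ := Finset.two_lt_card.mp h3
  rw [Finset.mem_erase] at hl₁ hl₂ hl₃
  have hcross : ∀ {l}, l ∈ G.linesBetween A Aᶜ → G.LoopContains T l θ := fun hl =>
    (hT.loopContains_iff_mem_linesBetween G θ _ A hA).mpr hl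
  have hnot : ∀ {l}, l ≠ θ → l ∈ G.linesBetween A Aᶜ → l ∉ T := fun hne hl hlT =>
    hne (G.eq_of_mem_of_loopContains hlT (hcross hl))
  exact ⟨l₁, l₂, l₃, hnot hl₁.1 hl₁.2, hnot hl₂.1 hl₂.2, hnot hl₃.1 hl₃.2, h12, h13, h23,
    hcross hl₁.2, hcross hl₂.2, hcross hl₃.2⟩

open Classical in
/-- P1': parity of the crossing set: the number of NON-tree lines crossing a tree line is odd.
[cite: FeldmanSalmhoferTrubowitz1999, Thm 3.11 (proof) p0018:L54-57] -/
theorem odd_card_filter_loopContains (hev : G.EvenIncidence) (h2 : G.IsTwoLegged) {a : V}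
    (ha : G.ext a = 2) {T : Finset L} (hT : G.IsSpanningTree T) {θ : L} (hθ : θ ∈ T) :
    Odd ((Finset.univ.filter fun l => l ∉ T ∧ G.LoopContains T l θ).card) := by
  classical
  set A : Finset V := Finset.univ.filter fun x => G.Reachable (T.erase θ) (G.fst θ) x with hAdef
  have hA : ∀ x, x ∈ A ↔ G.Reachable (T.erase θ) (G.fst θ) x := fun x => by simp [hAdef]
  have heven := G.even_card_linesBetween_compl hev h2 ha A
  have hθmem : θ ∈ G.linesBetween A Aᶜ :=
    (hT.loopContains_iff_mem_linesBetween G θ θ A hA).mp (hT.loopContains_self G hθ)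
  have hset : (Finset.univ.filter fun l => l ∉ T ∧ G.LoopContains T l θ) =
      (G.linesBetween A Aᶜ).erase θ := by
    ext l
    simp only [Finset.mem_filter, Finset.mem_univ, true_and, Finset.mem_erase]
    constructor
    · rintro ⟨hlT, hlc⟩
      exact ⟨fun h => hlT (h ▸ hθ), (hT.loopContains_iff_mem_linesBetween G θ l A hA).mp hlc⟩
    · rintro ⟨hne, hl⟩
      have hlc := (hT.loopContains_iff_mem_linesBetween G θ l A hA).mpr hl
      exact ⟨fun hlT => hne (G.eq_of_mem_of_loopContains hlT hlc), hlc⟩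
  rw [hset, Finset.card_erase_of_mem hθmem]
  rcases heven with ⟨k, hk⟩
  have hpos : 0 < (G.linesBetween A Aᶜ).card := Finset.card_pos.mpr ⟨θ, hθmem⟩
  exact ⟨k - 1, by omega⟩

/-- P2: the use of `¬ DOL`: if two distinct non-tree lines cross the tree line `ζ`, they cannot both
avoid crossing another tree line `θ` (together with two of the `≥ 3` lines crossing `θ` they would be
the `ℓ₁, ℓ₂, k₁, k₂` of Definition 2.1).
[cite: FeldmanSalmhoferTrubowitz1999, Thm 3.11 (proof) p0018:L54-57] -/
theorem loopContains_of_not_isDOL (hev : G.EvenIncidence) (h2 : G.IsTwoLegged) {a : V}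
    (ha : G.ext a = 2) (hsk : G.IsSkeleton) (hnd : ¬ G.IsDOL) {T : Finset L}
    (hT : G.IsSpanningTree T) {θ ζ : L} (hθ : θ ∈ T) (hζ : ζ ∈ T) (hne : θ ≠ ζ) {k₁ k₂ : L}
    (hk₁ : k₁ ∉ T) (hk₂ : k₂ ∉ T) (hk : k₁ ≠ k₂) (h₁ : G.LoopContains T k₁ ζ)
    (h₂ : G.LoopContains T k₂ ζ) (hn₁ : ¬ G.LoopContains T k₁ θ) : G.LoopContains T k₂ θ := by
  by_contra hn₂
  obtain ⟨l₁, l₂, l₃, hl₁, hl₂, -, h12, -, -, hc₁, hc₂, -⟩ :=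
    G.exists_three_loopContains hev h2 ha hsk hT hθ
  apply hnd
  refine ⟨T, hT, θ, hθ, ζ, hζ, hne, l₁, l₂, k₁, k₂, hl₁, hl₂, hk₁, hk₂, h12, ?_, ?_, ?_, ?_, hk,
    hc₁, hc₂, h₁, h₂, hn₁, hn₂⟩
  · rintro rfl; exact hn₁ hc₁
  · rintro rfl; exact hn₂ hc₁
  · rintro rfl; exact hn₁ hc₂
  · rintro rfl; exact hn₂ hc₂

omit [DecidableEq V] in
/-- P3 (Lemma F): two distinct vertices are separated by the cut of some tree line.
[cite: FeldmanSalmhoferTrubowitz1999, §2.1 p0004:L44-53] -/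
theorem IsSpanningTree.exists_separating {T : Finset L} (hT : G.IsSpanningTree T) {x y : V}
    (hxy : x ≠ y) :
    ∃ θ ∈ T, ¬ (G.Reachable (T.erase θ) (G.fst θ) x ↔ G.Reachable (T.erase θ) (G.fst θ) y) := by
  classical
  -- growth of a `T`-connected vertex set `U ∋ x` all of whose other members are separated from `x`
  suffices key : ∀ (n : ℕ) (U : Finset V), x ∈ U →
      (∀ u ∈ U, G.Reachable (T.filter fun l => G.fst l ∈ U ∧ G.snd l ∈ U) x u) →
      (∀ u ∈ U, u ≠ x → ∃ θ ∈ T,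
        ¬ (G.Reachable (T.erase θ) (G.fst θ) x ↔ G.Reachable (T.erase θ) (G.fst θ) u)) →
      U.card + n = Fintype.card V →
      ∃ θ ∈ T, ¬ (G.Reachable (T.erase θ) (G.fst θ) x ↔ G.Reachable (T.erase θ) (G.fst θ) y) by
    refine key (Fintype.card V - 1) {x} (Finset.mem_singleton_self x) ?_ ?_ ?_
    · intro u hu
      rw [Finset.mem_singleton.mp hu]
      exact Relation.ReflTransGen.refl
    · intro u hu hux
      exact absurd (Finset.mem_singleton.mp hu) hux
    · rw [Finset.card_singleton]
      have : 0 < Fintype.card V := Fintype.card_pos_iff.mpr ⟨x⟩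
      omega
  intro n
  induction n with
  | zero =>
    intro U hxU _ hsep hcard
    have hU : U = Finset.univ := Finset.eq_univ_of_card U (by rw [← hcard]; simp)
    subst hU
    exact hsep y (Finset.mem_univ y) hxy.symm
  | succ n ih =>
    intro U hxU hconn hsep hcard
    have hne : U ≠ Finset.univ := fun h => by
      rw [h, Finset.card_univ] at hcard; omega
    obtain ⟨w, -, hwU⟩ := Finset.exists_of_ssubset
      (Finset.ssubset_iff_subset_ne.mpr ⟨Finset.subset_univ U, hne⟩)
    obtain ⟨l, hl, u, huU, z, hzU, hj⟩ := G.exists_crossing_sub (hT.1 x w) hxU hwU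
    -- `u` and `x` are joined inside `U`, hence on the same side of the cut of `l`
    have hux : G.Reachable (T.erase l) x u := by
      refine (hconn u huU).mono ?_
      intro l' hl'
      rw [Finset.mem_filter] at hl'
      refine Finset.mem_erase.mpr ⟨?_, hl'.1⟩
      rintro rfl
      rcases hj with ⟨h1, h2⟩ | ⟨h1, h2⟩
      · exact hzU (h2 ▸ hl'.2.2)
      · exact hzU (h1 ▸ hl'.2.1)
    have hside_ux : G.Reachable (T.erase l) (G.fst l) x ↔ G.Reachable (T.erase l) (G.fst l) u :=
      ⟨fun h => h.trans hux, fun h => h.trans hux.symm⟩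
    -- the ends of `l` are on different sides
    have hself : ¬ G.Reachable (T.erase l) (G.fst l) (G.snd l) := hT.loopContains_self G hl
    have hside_uz :
        ¬ (G.Reachable (T.erase l) (G.fst l) u ↔ G.Reachable (T.erase l) (G.fst l) z) := by
      intro hiff
      rcases hj with ⟨h1, h2⟩ | ⟨h1, h2⟩
      · have hu : G.Reachable (T.erase l) (G.fst l) u := by
          rw [h1]
          exact Relation.ReflTransGen.refl
        have hz := hiff.mp hu
        apply hself
        rw [h2]
        exact hz
      · have hz : G.Reachable (T.erase l) (G.fst l) z := by
          rw [h1]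
          exact Relation.ReflTransGen.refl
        have hu := hiff.mpr hz
        apply hself
        rw [h2]
        exact hu
    refine ih (insert z U) (Finset.mem_insert_of_mem hxU) ?_ ?_ ?_
    · intro u' hu'
      have hmono : (T.filter fun l => G.fst l ∈ U ∧ G.snd l ∈ U) ⊆
          T.filter fun l => G.fst l ∈ insert z U ∧ G.snd l ∈ insert z U := by
        intro l' hl'
        rw [Finset.mem_filter] at hl' ⊢
        exact ⟨hl'.1, Finset.mem_insert_of_mem hl'.2.1, Finset.mem_insert_of_mem hl'.2.2⟩
      rcases Finset.mem_insert.mp hu' with rfl | hu'U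
      · refine ((hconn u huU).mono hmono).tail ⟨l, ?_, hj⟩
        rw [Finset.mem_filter]
        rcases hj with ⟨h1, h2⟩ | ⟨h1, h2⟩
        · exact ⟨hl, h1 ▸ Finset.mem_insert_of_mem huU, h2 ▸ Finset.mem_insert_self _ U⟩
        · exact ⟨hl, h1 ▸ Finset.mem_insert_self _ U, h2 ▸ Finset.mem_insert_of_mem huU⟩
      · exact (hconn u' hu'U).mono hmono
    · intro u' hu' hu'x
      rcases Finset.mem_insert.mp hu' with rfl | hu'U
      · exact ⟨l, hl, fun hiff => hside_uz (hside_ux.symm.trans hiff)⟩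
      · exact hsep u' hu'U hu'x
    · rw [Finset.card_insert_of_notMem hzU]
      omega

omit [Fintype V] [Fintype L] [DecidableEq V] in
/-- P4 (leaf cut): if `v` meets exactly one tree line `ζ`, then nothing else is reachable from `v` in
`T - ζ`.
[cite: FeldmanSalmhoferTrubowitz1999, §2.1 p0004:L44-53] -/
theorem reachable_erase_leaf {T : Finset L} {ζ : L} {v : V}
    (honly : ∀ θ ∈ T, θ ≠ ζ → G.fst θ ≠ v ∧ G.snd θ ≠ v) {x : V}
    (h : G.Reachable (T.erase ζ) v x) : x = v := by
  induction h with
  | refl => rfl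
  | @tail b c _ hbc ih =>
    subst ih
    obtain ⟨l, hl, hj⟩ := hbc
    rw [Finset.mem_erase] at hl
    have := honly l hl.2 hl.1
    rcases hj with ⟨h1, _⟩ | ⟨_, h2⟩
    · exact absurd h1 this.1
    · exact absurd h2 this.2

/-- P4 (leaf cut): for a leaf `v` of the spanning tree `T` with tree line `ζ`, the side of `fst ζ`
in `T - ζ` is `{v}` or its complement.
[cite: FeldmanSalmhoferTrubowitz1999, §2.1 p0004:L44-53] -/
theorem IsSpanningTree.side_leaf_iff {T : Finset L} (hT : G.IsSpanningTree T) {ζ : L}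
    (hζ : ζ ∈ T) {v : V} (hζv : G.fst ζ = v ∨ G.snd ζ = v)
    (honly : ∀ θ ∈ T, θ ≠ ζ → G.fst θ ≠ v ∧ G.snd θ ≠ v) (x : V) :
    G.Reachable (T.erase ζ) (G.fst ζ) x ↔ (G.fst ζ = v ↔ x = v) := by
  rcases hζv with h1 | h2
  · rw [h1]
    simp only [true_iff]
    exact ⟨fun h => G.reachable_erase_leaf honly h, fun h => h ▸ Relation.ReflTransGen.refl⟩
  · have hne : G.fst ζ ≠ v := h2 ▸ hT.fst_ne_snd G hζ
    simp only [hne, false_iff]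
    constructor
    · intro h hx
      subst hx
      exact hne (G.reachable_erase_leaf honly h.symm)
    · intro hx
      rcases hT.reachable_erase_or G ζ x with h | h
      · exact h
      · rw [h2] at h
        exact absurd (G.reachable_erase_leaf honly h) hx

/-- P4 (leaf cut): for a leaf `v` of the spanning tree `T` with tree line `ζ`, a line crosses `ζ`
iff exactly one of its ends is `v`.
[cite: FeldmanSalmhoferTrubowitz1999, Thm 3.11 (proof) p0018:L54-57] -/
theorem IsSpanningTree.loopContains_leaf_iff {T : Finset L} (hT : G.IsSpanningTree T) {ζ : L}
    (hζ : ζ ∈ T) {v : V} (hζv : G.fst ζ = v ∨ G.snd ζ = v)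
    (honly : ∀ θ ∈ T, θ ≠ ζ → G.fst θ ≠ v ∧ G.snd θ ≠ v) (l : L) :
    G.LoopContains T l ζ ↔ ¬ (G.fst l = v ↔ G.snd l = v) := by
  rw [hT.loopContains_iff G ζ l, hT.side_leaf_iff G hζ hζv honly, hT.side_leaf_iff G hζ hζv honly]
  tauto

omit [Fintype V] [Fintype L] [DecidableEq V] [DecidableEq L] in
/-- The other end of a line with exactly one end at `v`.
[cite: FeldmanSalmhoferTrubowitz1999, §2 p0004:L17-32] -/
theorem exists_joins_of_end {l : L} {v : V} (h : ¬ (G.fst l = v ↔ G.snd l = v)) :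
    ∃ x, x ≠ v ∧ G.Joins l v x := by
  by_cases h1 : G.fst l = v
  · have h2 : G.snd l ≠ v := fun h2 => h ⟨fun _ => h2, fun _ => h1⟩
    exact ⟨G.snd l, h2, Or.inl ⟨h1, rfl⟩⟩
  · have h2 : G.snd l = v := by
      by_contra h2
      exact h ⟨fun h' => absurd h' h1, fun h' => absurd h' h2⟩
    exact ⟨G.fst l, h1, Or.inr ⟨rfl, h2⟩⟩

omit [Fintype V] [Fintype L] [DecidableEq V] [DecidableEq L] in
/-- A line from `v` to another vertex has exactly one end at `v`.
[cite: FeldmanSalmhoferTrubowitz1999, §2 p0004:L17-32] -/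
theorem end_iff_of_joins {l : L} {v x : V} (hj : G.Joins l v x) (hx : x ≠ v) :
    ¬ (G.fst l = v ↔ G.snd l = v) := by
  rcases hj with ⟨h1, h2⟩ | ⟨h1, h2⟩
  · exact fun h => hx (h2.symm.trans (h.mp h1))
  · exact fun h => hx (h1.symm.trans (h.mpr h2))

omit [Fintype V] [Fintype L] [DecidableEq V] [DecidableEq L] in
/-- The other end of a line at `v` is unique.
[cite: FeldmanSalmhoferTrubowitz1999, §2 p0004:L17-32] -/
theorem end_eq_of_joins {l : L} {v x y : V} (hx : G.Joins l v x) (hy : G.Joins l v y) (hxv : x ≠ v) :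
    x = y := by
  rcases hx.eq_or_eq hy with ⟨_, h⟩ | ⟨_, h2⟩
  · exact h
  · exact absurd h2 hxv

omit [Fintype V] [Fintype L] [DecidableEq V] [DecidableEq L] in
/-- If a line from `v` has an end `w ≠ v`, its other end is `w`.
[cite: FeldmanSalmhoferTrubowitz1999, §2 p0004:L17-32] -/
theorem end_eq_of_joins_of_end {l : L} {v x w : V} (hj : G.Joins l v x)
    (hw : G.fst l = w ∨ G.snd l = w) (hwv : w ≠ v) : x = w := by
  rcases hj with ⟨h1, h2⟩ | ⟨h1, h2⟩
  · rcases hw with h | h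
    · exact absurd (h1.symm.trans h) hwv.symm
    · exact h2.symm.trans h
  · rcases hw with h | h
    · exact h1.symm.trans h
    · exact absurd (h2.symm.trans h) hwv.symm

/-- P5: if `G - v` is connected, then for every line `l₀` from `v` to another vertex there is a
spanning tree containing `l₀` in which `v` is a leaf (no other tree line at `v`).
[cite: FeldmanSalmhoferTrubowitz1999, §2.1 p0004:L44-53] -/
theorem exists_isSpanningTree_leaf {v u : V} (hconn : G.IsConnectedOn ({v}ᶜ : Finset V)) {l₀ : L}
    (hj : G.Joins l₀ v u) (huv : u ≠ v) :
    ∃ T : Finset L, G.IsSpanningTree T ∧ l₀ ∈ T ∧ (G.fst l₀ = v ∨ G.snd l₀ = v) ∧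
      ∀ θ ∈ T, θ ≠ l₀ → G.fst θ ≠ v ∧ G.snd θ ≠ v := by
  classical
  have hu : u ∈ ({v}ᶜ : Finset V) := by simp [huv]
  obtain ⟨T', hT'sub, hreach, hcard⟩ := G.exists_tree hconn hu
  have hmemT' : ∀ {θ}, θ ∈ T' → G.fst θ ≠ v ∧ G.snd θ ≠ v := by
    intro θ hθ
    have h' := hT'sub hθ
    simp only [induced, Finset.mem_filter, Finset.mem_univ, true_and, Finset.mem_compl,
      Finset.mem_singleton] at h'
    exact h'
  have hl₀T' : l₀ ∉ T' := by
    intro h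
    rcases hj with ⟨h1, _⟩ | ⟨_, h2⟩
    · exact (hmemT' h).1 h1
    · exact (hmemT' h).2 h2
  refine ⟨insert l₀ T', ⟨?_, ?_⟩, Finset.mem_insert_self _ _, ?_, ?_⟩
  · have hru : ∀ y, G.Reachable (insert l₀ T') u y := by
      intro y
      by_cases hy : y = v
      · subst hy
        exact Relation.ReflTransGen.single ⟨l₀, Finset.mem_insert_self _ _, hj.symm⟩
      · exact (hreach y (by simp [hy])).mono (Finset.subset_insert _ _)
    exact fun x y => (hru x).symm.trans (hru y)
  · rw [Finset.card_insert_of_notMem hl₀T', hcard, Finset.card_compl, Finset.card_singleton]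
    have : 1 ≤ Fintype.card V := Fintype.card_pos_iff.mpr ⟨v⟩
    omega
  · rcases hj with ⟨h1, _⟩ | ⟨_, h2⟩
    · exact Or.inl h1
    · exact Or.inr h2
  · intro θ hθ hne
    exact hmemT' ((Finset.mem_insert.mp hθ).resolve_left hne)

omit [Fintype L] [DecidableEq L] in
/-- Handshake for a set of lines: every line has two ends.
[cite: FeldmanSalmhoferTrubowitz1999, §2.1 p0004:L44-53] -/
theorem sum_sum_endsAt (T : Finset L) :
    ∑ w, ∑ θ ∈ T, G.endsAt θ w = 2 * T.card := by
  rw [Finset.sum_comm]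
  have h2 : ∀ θ ∈ T, ∑ w, G.endsAt θ w = 2 := fun θ _ => by
    rw [← G.endsIn_eq_sum_endsAt Finset.univ θ]
    simp [endsIn]
  rw [Finset.sum_congr rfl h2, Finset.sum_const, smul_eq_mul, mul_comm]

omit [Fintype V] [Fintype L] [DecidableEq L] in
/-- `endsAt θ w > 0` iff `w` is an end of `θ`.
[cite: FeldmanSalmhoferTrubowitz1999, §2 p0004:L17-32] -/
theorem endsAt_pos_iff {θ : L} {w : V} : 0 < G.endsAt θ w ↔ (G.fst θ = w ∨ G.snd θ = w) := by
  unfold endsAt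
  split_ifs with h1 h2 h2 <;> simp [h1, h2]

omit [Fintype V] [Fintype L] [DecidableEq L] in
/-- `endsAt θ w = 0` iff `w` is not an end of `θ`.
[cite: FeldmanSalmhoferTrubowitz1999, §2 p0004:L17-32] -/
theorem endsAt_eq_zero_iff {θ : L} {w : V} : G.endsAt θ w = 0 ↔ (G.fst θ ≠ w ∧ G.snd θ ≠ w) := by
  unfold endsAt
  split_ifs with h1 h2 h2 <;> simp [h1, h2]

omit [Fintype L] [DecidableEq V] [DecidableEq L] in
/-- Every vertex meets a line of a spanning tree (at least two vertices).
[cite: FeldmanSalmhoferTrubowitz1999, §2.1 p0004:L44-53] -/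
theorem IsSpanningTree.exists_mem_end {T : Finset L} (hT : G.IsSpanningTree T)
    (h2 : 2 ≤ Fintype.card V) (w : V) : ∃ θ ∈ T, G.fst θ = w ∨ G.snd θ = w := by
  classical
  obtain ⟨w', hw'⟩ : ∃ w', w' ≠ w := Fintype.exists_ne_of_one_lt_card (by omega) w
  obtain ⟨l, hl, u, hu, x, -, hj⟩ :=
    G.exists_crossing_sub (hT.1 w w') (Finset.mem_singleton_self w) (by simpa using hw')
  rw [Finset.mem_singleton] at hu
  subst hu
  rcases hj with ⟨h1, _⟩ | ⟨_, h2⟩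
  · exact ⟨l, hl, Or.inl h1⟩
  · exact ⟨l, hl, Or.inr h2⟩

omit [Fintype L] in
/-- P7: a spanning tree on at least two vertices has a leaf different from any given vertex `u`
(handshake: the tree degrees sum to `2|T| = 2|V| - 2`, and every vertex has tree degree `≥ 1`).
[cite: FeldmanSalmhoferTrubowitz1999, §2.1 p0004:L44-53] -/
theorem IsSpanningTree.exists_leaf_ne {T : Finset L} (hT : G.IsSpanningTree T)
    (h2 : 2 ≤ Fintype.card V) (u : V) :
    ∃ w, w ≠ u ∧ ∃ ζ ∈ T, (G.fst ζ = w ∨ G.snd ζ = w) ∧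
      ∀ θ ∈ T, θ ≠ ζ → G.fst θ ≠ w ∧ G.snd θ ≠ w := by
  classical
  have hsum : ∑ w, ∑ θ ∈ T, G.endsAt θ w = 2 * T.card := G.sum_sum_endsAt T
  have hpos : ∀ w, 1 ≤ ∑ θ ∈ T, G.endsAt θ w := by
    intro w
    obtain ⟨θ, hθ, hθw⟩ := hT.exists_mem_end G h2 w
    have h1 : 1 ≤ G.endsAt θ w := (G.endsAt_pos_iff).mpr hθw
    exact h1.trans (Finset.single_le_sum (f := fun θ => G.endsAt θ w) (fun _ _ => Nat.zero_le _) hθ)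
  obtain ⟨w, hwu, hw⟩ : ∃ w, w ≠ u ∧ ∑ θ ∈ T, G.endsAt θ w ≤ 1 := by
    by_contra hcon
    have h : ∀ w, w ≠ u → 2 ≤ ∑ θ ∈ T, G.endsAt θ w := fun w hw => by
      by_contra hlt
      exact hcon ⟨w, hw, by omega⟩
    have hsplit := Finset.add_sum_erase Finset.univ (fun w => ∑ θ ∈ T, G.endsAt θ w)
      (Finset.mem_univ u)
    have hrest : ∑ w ∈ Finset.univ.erase u, 2 ≤ ∑ w ∈ Finset.univ.erase u, ∑ θ ∈ T, G.endsAt θ w :=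
      Finset.sum_le_sum fun w hw => h w (Finset.ne_of_mem_erase hw)
    rw [Finset.sum_const, smul_eq_mul, Finset.card_erase_of_mem (Finset.mem_univ u),
      Finset.card_univ] at hrest
    have hu1 := hpos u
    have hT2 := hT.2
    omega
  have hdw : ∑ θ ∈ T, G.endsAt θ w = 1 := le_antisymm hw (hpos w)
  obtain ⟨ζ, hζ, hζw⟩ : ∃ ζ ∈ T, G.endsAt ζ w ≠ 0 :=
    Finset.exists_ne_zero_of_sum_ne_zero (by rw [hdw]; exact one_ne_zero)
  refine ⟨w, hwu, ζ, hζ, (G.endsAt_pos_iff).mp (Nat.pos_of_ne_zero hζw), ?_⟩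
  intro θ hθ hne
  have hsub : ({θ, ζ} : Finset L) ⊆ T := by
    intro x hx
    simp only [Finset.mem_insert, Finset.mem_singleton] at hx
    rcases hx with rfl | rfl
    · exact hθ
    · exact hζ
  have hle := Finset.sum_le_sum_of_subset (f := fun θ => G.endsAt θ w) hsub
  rw [Finset.sum_pair hne] at hle
  have h0 : G.endsAt θ w = 0 := by
    have := hdw ▸ hle
    omega
  exact (G.endsAt_eq_zero_iff).mp h0

omit [Fintype L] [DecidableEq V] in
/-- Sides of a tree cut: a vertex on the side of `x` is joined to `x` in `T - θ`.
[cite: FeldmanSalmhoferTrubowitz1999, §2.1 p0004:L44-53] -/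
theorem IsSpanningTree.reachable_erase_of_side {T : Finset L} (hT : G.IsSpanningTree T) {θ : L}
    {x s : V}
    (hs : G.Reachable (T.erase θ) (G.fst θ) s ↔ G.Reachable (T.erase θ) (G.fst θ) x) :
    G.Reachable (T.erase θ) x s := by
  rcases hT.reachable_erase_or G θ x with h | h
  · exact h.symm.trans (hs.mpr h)
  · rcases hT.reachable_erase_or G θ s with h' | h'
    · exact (hs.mp h').symm.trans h'
    · exact h.symm.trans h'

/-- If the cut of `θ` separates `v` from `x`, then every vertex on the side of `x` is joined to `x`
inside `G - v` (the `T - θ` walk stays on that side, which misses `v`).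
[cite: FeldmanSalmhoferTrubowitz1999, §2.1 p0004:L44-53] -/
theorem IsSpanningTree.reachable_induced_compl_of_side {T : Finset L} (hT : G.IsSpanningTree T)
    {θ : L} {v x : V}
    (hsep : ¬ (G.Reachable (T.erase θ) (G.fst θ) v ↔ G.Reachable (T.erase θ) (G.fst θ) x)) {s : V}
    (hs : G.Reachable (T.erase θ) (G.fst θ) s ↔ G.Reachable (T.erase θ) (G.fst θ) x) :
    G.Reachable (G.induced ({v}ᶜ : Finset V)) x s := by
  have hxs : G.Reachable (T.erase θ) x s := hT.reachable_erase_of_side G hs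
  have hside : ∀ {z}, G.Reachable (T.erase θ) x z → z ≠ v := by
    intro z hz hzv
    subst hzv
    exact hsep ⟨fun h => h.trans hz.symm, fun h => h.trans hz⟩
  clear hs
  induction hxs with
  | refl => exact Relation.ReflTransGen.refl
  | @tail b c hxb hbc ih =>
    obtain ⟨l, hl, hj⟩ := hbc
    have hb : b ∈ ({v}ᶜ : Finset V) := by simpa using hside hxb
    have hc : c ∈ ({v}ᶜ : Finset V) := by simpa using hside (hxb.tail ⟨l, hl, hj⟩)
    exact ih.tail ⟨l, (G.mem_induced_iff_of_joins hj).mpr ⟨hb, hc⟩, hj⟩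

/-- Propositional bookkeeping for the two sides of a cut.
[cite: FeldmanSalmhoferTrubowitz1999, §2.1 p0004:L44-53] -/
private theorem iff_of_not_iff_of_not_iff {A B C : Prop} (h1 : ¬ (C ↔ A)) (h2 : ¬ (C ↔ B)) :
    (A ↔ B) := by
  tauto

/-- Propositional bookkeeping: if the ends differ and one end is not on a side, the other is.
[cite: FeldmanSalmhoferTrubowitz1999, §2.1 p0004:L44-53] -/
private theorem iff_other_end {P Q R : Prop} (hne : ¬ (P ↔ Q)) (h : ¬ (P ↔ R)) : (Q ↔ R) := by
  tauto

/-- P6: **no cut vertex.** For a non-DOL `t = 0` two-legged skeleton graph, `G - v` is connected for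
every vertex `v`: otherwise two tree lines leading into different components of `G - v` would have
disjoint crossing sets, each of size `≥ 3` — two separate overlaps.
[cite: FeldmanSalmhoferTrubowitz1999, Thm 3.11 (proof) p0018:L54-57] -/
theorem isConnectedOn_compl_singleton_of_not_isDOL (hev : G.EvenIncidence) (h2 : G.IsTwoLegged)
    {a : V} (ha : G.ext a = 2) (hsk : G.IsSkeleton) (hnd : ¬ G.IsDOL) (v : V) :
    G.IsConnectedOn ({v}ᶜ : Finset V) := by
  classical
  intro x hx y hy
  by_contra hxy
  have hxv : v ≠ x := fun h => by simp [h] at hx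
  have hyv : v ≠ y := fun h => by simp [h] at hy
  haveI : Nonempty V := ⟨v⟩
  obtain ⟨T, hT⟩ := G.exists_isSpanningTree hsk.1
  obtain ⟨θ, hθ, hθsep⟩ := hT.exists_separating G hxv
  obtain ⟨ζ, hζ, hζsep⟩ := hT.exists_separating G hyv
  -- the two far sides are disjoint
  have disj : ∀ s, (G.Reachable (T.erase θ) (G.fst θ) s ↔ G.Reachable (T.erase θ) (G.fst θ) x) →
      (G.Reachable (T.erase ζ) (G.fst ζ) s ↔ G.Reachable (T.erase ζ) (G.fst ζ) y) → False :=
    fun s h1 h2 => hxy ((hT.reachable_induced_compl_of_side G hθsep h1).trans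
      (hT.reachable_induced_compl_of_side G hζsep h2).symm)
  have hθζ : θ ≠ ζ := by
    rintro rfl
    exact disj y (iff_of_not_iff_of_not_iff hζsep hθsep) Iff.rfl
  -- no line crosses both cuts
  have nocross : ∀ l, G.LoopContains T l θ → G.LoopContains T l ζ → False := by
    intro l hlθ hlζ
    rw [hT.loopContains_iff G] at hlθ hlζ
    by_cases h1 : (G.Reachable (T.erase θ) (G.fst θ) (G.fst l) ↔
        G.Reachable (T.erase θ) (G.fst θ) x)
    · by_cases h2' : (G.Reachable (T.erase ζ) (G.fst ζ) (G.fst l) ↔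
          G.Reachable (T.erase ζ) (G.fst ζ) y)
      · exact disj _ h1 h2'
      · have h3 := iff_other_end hlζ h2'
        have w1 := hT.reachable_induced_compl_of_side G hθsep h1
        have w2 := hT.reachable_induced_compl_of_side G hζsep h3
        have hl : l ∈ G.induced ({v}ᶜ : Finset V) :=
          (G.mem_induced_iff_of_joins (Or.inl ⟨rfl, rfl⟩ : G.Joins l (G.fst l) (G.snd l))).mpr
            ⟨G.reachable_induced_mem w1 hx, G.reachable_induced_mem w2 hy⟩
        exact hxy ((w1.tail ⟨l, hl, Or.inl ⟨rfl, rfl⟩⟩).trans w2.symm)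
    · have h1' := iff_other_end hlθ h1
      by_cases h2' : (G.Reachable (T.erase ζ) (G.fst ζ) (G.snd l) ↔
          G.Reachable (T.erase ζ) (G.fst ζ) y)
      · exact disj _ h1' h2'
      · have hlζ' : ¬ (G.Reachable (T.erase ζ) (G.fst ζ) (G.snd l) ↔
            G.Reachable (T.erase ζ) (G.fst ζ) (G.fst l)) := fun h => hlζ h.symm
        have h3 := iff_other_end hlζ' h2'
        have w1 := hT.reachable_induced_compl_of_side G hθsep h1'
        have w2 := hT.reachable_induced_compl_of_side G hζsep h3
        have hl : l ∈ G.induced ({v}ᶜ : Finset V) :=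
          (G.mem_induced_iff_of_joins (Or.inl ⟨rfl, rfl⟩ : G.Joins l (G.fst l) (G.snd l))).mpr
            ⟨G.reachable_induced_mem w2 hy, G.reachable_induced_mem w1 hx⟩
        exact hxy ((w1.tail ⟨l, hl, Or.inr ⟨rfl, rfl⟩⟩).trans w2.symm)
  obtain ⟨k₁, k₂, k₃, hk₁, hk₂, -, hk12, -, -, hc₁, hc₂, -⟩ :=
    G.exists_three_loopContains hev h2 ha hsk hT hζ
  exact nocross k₂ (G.loopContains_of_not_isDOL hev h2 ha hsk hnd hT hθ hζ hθζ hk₁ hk₂ hk12 hc₁ hc₂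
    (fun h => nocross k₁ h hc₁)) hc₂

omit [Fintype L] in
/-- L0: on at least three vertices, a leaf `v` hanging by `l₀` and another leaf `w ≠ v` hanging by
`ζ` hang by different lines.
[cite: FeldmanSalmhoferTrubowitz1999, §2.1 p0004:L44-53] -/
theorem IsSpanningTree.leaf_line_ne {T : Finset L} (hT : G.IsSpanningTree T)
    (h3 : 3 ≤ Fintype.card V) {v u w : V} {l₀ ζ : L} (hl₀ : l₀ ∈ T) (hj : G.Joins l₀ v u)
    (hleafv : ∀ θ ∈ T, θ ≠ l₀ → G.fst θ ≠ v ∧ G.snd θ ≠ v) (hwv : w ≠ v)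
    (hζw : G.fst ζ = w ∨ G.snd ζ = w) (hleafw : ∀ θ ∈ T, θ ≠ ζ → G.fst θ ≠ w ∧ G.snd θ ≠ w) :
    ζ ≠ l₀ := by
  classical
  intro heq
  rw [heq] at hζw hleafw
  have hwu : u = w := G.end_eq_of_joins_of_end hj hζw hwv
  rw [← hwu] at hleafw
  have key : ∀ x, G.Reachable T v x → x = v ∨ x = u := by
    intro x hx
    induction hx with
    | refl => exact Or.inl rfl
    | @tail b c _ hbc ih =>
      obtain ⟨l, hl, hjl⟩ := hbc
      by_cases hll : l = l₀
      · subst hll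
        rcases ih with rfl | rfl
        · rcases hj.eq_or_eq hjl with ⟨_, h⟩ | ⟨h, _⟩
          · exact Or.inr h.symm
          · exact Or.inl h.symm
        · rcases hj.symm.eq_or_eq hjl with ⟨_, h⟩ | ⟨h, _⟩
          · exact Or.inl h.symm
          · exact Or.inr h.symm
      · have hv' := hleafv l hl hll
        have hu' := hleafw l hl hll
        exfalso
        rcases ih with rfl | rfl
        · rcases hjl with ⟨h1, _⟩ | ⟨_, h2⟩
          · exact hv'.1 h1
          · exact hv'.2 h2
        · rcases hjl with ⟨h1, _⟩ | ⟨_, h2⟩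
          · exact hu'.1 h1
          · exact hu'.2 h2
  have hlt : ({v, u} : Finset V).card < (Finset.univ : Finset V).card := by
    rw [Finset.card_univ]
    exact lt_of_le_of_lt (Finset.card_le_two) (by omega)
  obtain ⟨x, -, hx⟩ := Finset.exists_mem_notMem_of_card_lt_card hlt
  rcases key x (hT.1 v x) with rfl | rfl
  · simp at hx
  · simp at hx

/-- MULT: at most two lines join any two (distinct, adjacent) vertices of a non-DOL `t = 0`
two-legged skeleton graph with `≥ 3` vertices: besides `l₀` at most one further line joins `v` and
`u`.
[cite: FeldmanSalmhoferTrubowitz1999, Thm 3.11 (proof) p0018:L54-57] -/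
theorem parallel_le_two (hev : G.EvenIncidence) (h2 : G.IsTwoLegged) {a : V} (ha : G.ext a = 2)
    (hsk : G.IsSkeleton) (hnd : ¬ G.IsDOL) (h3 : 3 ≤ Fintype.card V) {v u : V} {l₀ p₁ p₂ : L}
    (hj : G.Joins l₀ v u) (huv : u ≠ v) (hp₁ : G.Joins p₁ v u) (hp₂ : G.Joins p₂ v u)
    (h₁ : p₁ ≠ l₀) (h₂ : p₂ ≠ l₀) : p₁ = p₂ := by
  classical
  by_contra hne
  have hconn := G.isConnectedOn_compl_singleton_of_not_isDOL hev h2 ha hsk hnd v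
  obtain ⟨T, hT, hl₀, hl₀v, hleafv⟩ := G.exists_isSpanningTree_leaf hconn hj huv
  obtain ⟨w, hwv, ζ, hζ, hζw, hleafw⟩ := hT.exists_leaf_ne G (by omega) v
  have hζl₀ : ζ ≠ l₀ := hT.leaf_line_ne G h3 hl₀ hj hleafv hwv hζw hleafw
  have huw : u ≠ w := by
    intro huw
    have h := hleafw l₀ hl₀ hζl₀.symm
    rcases hj with ⟨_, h2'⟩ | ⟨h1', _⟩
    · exact h.2 (h2'.trans huw)
    · exact h.1 (h1'.trans huw)
  have hpT : ∀ {p}, G.Joins p v u → p ≠ l₀ → p ∉ T := by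
    intro p hp hpl hpT
    have h := hleafv p hpT hpl
    rcases hp with ⟨h1', _⟩ | ⟨_, h2'⟩
    · exact h.1 h1'
    · exact h.2 h2'
  have hcross : ∀ {p}, G.Joins p v u → G.LoopContains T p l₀ := fun hp =>
    (hT.loopContains_leaf_iff G hl₀ hl₀v hleafv _).mpr (G.end_iff_of_joins hp huv)
  have hnot : ∀ {p}, G.Joins p v u → ¬ G.LoopContains T p ζ := by
    intro p hp hc
    rw [hT.loopContains_leaf_iff G hζ hζw hleafw] at hc
    apply hc
    rcases hp with ⟨h1', h2'⟩ | ⟨h1', h2'⟩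
    · rw [h1', h2']
      exact ⟨fun h => (hwv h.symm).elim, fun h => (huw h).elim⟩
    · rw [h1', h2']
      exact ⟨fun h => (huw h).elim, fun h => (hwv h.symm).elim⟩
  exact hnot hp₂ (G.loopContains_of_not_isDOL hev h2 ha hsk hnd hT hζ hl₀ hζl₀ (hpT hp₁ h₁)
    (hpT hp₂ h₂) hne (hcross hp₁) (hcross hp₂) (hnot hp₁))

/-- LOCAL STRUCTURE at a vertex `v` of a non-DOL `t = 0` two-legged skeleton graph with `≥ 3`
vertices, seen from a line `l₀ = v–u`: the lines with exactly one end at `v` are `l₀`, a bubble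
`e₁, e₂` to a third vertex `w ∉ {v, u}`, and one further line `f` missing `w`.
[cite: FeldmanSalmhoferTrubowitz1999, Thm 3.11 (proof) p0018:L54-57] -/
theorem local_lines (hev : G.EvenIncidence) (h2 : G.IsTwoLegged) {a : V} (ha : G.ext a = 2)
    (hsk : G.IsSkeleton) (hnd : ¬ G.IsDOL) (h3 : 3 ≤ Fintype.card V) {v u : V} {l₀ : L}
    (hj : G.Joins l₀ v u) (huv : u ≠ v) :
    ∃ w : V, w ≠ v ∧ w ≠ u ∧ ∃ e₁ e₂ f : L, e₁ ≠ e₂ ∧ f ≠ e₁ ∧ f ≠ e₂ ∧ f ≠ l₀ ∧ e₁ ≠ l₀ ∧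
      e₂ ≠ l₀ ∧ G.Joins e₁ v w ∧ G.Joins e₂ v w ∧ ¬ (G.fst f = v ↔ G.snd f = v) ∧ G.fst f ≠ w ∧
      G.snd f ≠ w ∧ ∀ l : L, ¬ (G.fst l = v ↔ G.snd l = v) → (l = l₀ ∨ l = e₁ ∨ l = e₂ ∨ l = f) := by
  classical
  have hconn := G.isConnectedOn_compl_singleton_of_not_isDOL hev h2 ha hsk hnd v
  obtain ⟨T, hT, hl₀, hl₀v, hleafv⟩ := G.exists_isSpanningTree_leaf hconn hj huv
  obtain ⟨w, hwv, ζ, hζ, hζw, hleafw⟩ := hT.exists_leaf_ne G (by omega) v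
  have hζl₀ : ζ ≠ l₀ := hT.leaf_line_ne G h3 hl₀ hj hleafv hwv hζw hleafw
  have huw : u ≠ w := by
    intro huw
    have h := hleafw l₀ hl₀ hζl₀.symm
    rcases hj with ⟨_, h2'⟩ | ⟨h1', _⟩
    · exact h.2 (h2'.trans huw)
    · exact h.1 (h1'.trans huw)
  have hXv : ∀ l, G.LoopContains T l l₀ ↔ ¬ (G.fst l = v ↔ G.snd l = v) :=
    hT.loopContains_leaf_iff G hl₀ hl₀v hleafv
  have hXw : ∀ l, G.LoopContains T l ζ ↔ ¬ (G.fst l = w ↔ G.snd l = w) :=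
    hT.loopContains_leaf_iff G hζ hζw hleafw
  have hnT : ∀ {l}, ¬ (G.fst l = v ↔ G.snd l = v) → l ≠ l₀ → l ∉ T := by
    intro l hl hne hlT
    have h := hleafv l hlT hne
    exact hl ⟨fun h1 => absurd h1 h.1, fun h2 => absurd h2 h.2⟩
  -- (A): two distinct non-tree lines at `v` cannot both miss `w`
  have hA : ∀ {k₁ k₂ : L}, k₁ ∉ T → k₂ ∉ T → k₁ ≠ k₂ → ¬ (G.fst k₁ = v ↔ G.snd k₁ = v) →
      ¬ (G.fst k₂ = v ↔ G.snd k₂ = v) → (G.fst k₁ = w ↔ G.snd k₁ = w) →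
      ¬ (G.fst k₂ = w ↔ G.snd k₂ = w) := by
    intro k₁ k₂ hk₁ hk₂ hne hv₁ hv₂ hw₁
    have h := G.loopContains_of_not_isDOL hev h2 ha hsk hnd hT hζ hl₀ hζl₀ hk₁ hk₂ hne
      ((hXv _).mpr hv₁) ((hXv _).mpr hv₂) (fun hc => (hXw _).mp hc hw₁)
    exact (hXw _).mp h
  -- a line with one end at `v` and one end at `w` joins them
  have hjoin : ∀ {k : L}, ¬ (G.fst k = v ↔ G.snd k = v) → ¬ (G.fst k = w ↔ G.snd k = w) →
      G.Joins k v w := by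
    intro k hv hw
    by_cases h1 : G.fst k = v
    · have h3' : G.snd k = w := by
        by_contra h3'
        exact hw ⟨fun h => (hwv.symm (h1.symm.trans h)).elim, fun h => (h3' h).elim⟩
      exact Or.inl ⟨h1, h3'⟩
    · have h2' : G.snd k = v := by
        by_contra h2'
        exact hv ⟨fun h => (h1 h).elim, fun h => (h2' h).elim⟩
      have h3' : G.fst k = w := by
        by_contra h3'
        exact hw ⟨fun h => (h3' h).elim, fun h => (hwv.symm (h2'.symm.trans h)).elim⟩
      exact Or.inr ⟨h3', h2'⟩
  obtain ⟨m₁, m₂, m₃, hm₁, hm₂, hm₃, h12, h13, h23, hc₁, hc₂, hc₃⟩ :=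
    G.exists_three_loopContains hev h2 ha hsk hT hl₀
  rw [hXv] at hc₁ hc₂ hc₃
  obtain ⟨e₁, e₂, g, he₁T, he₂T, hgT, he12, hg1, hg2, hv₁, hv₂, hvg, hw₁, hw₂⟩ :
      ∃ e₁ e₂ g : L, e₁ ∉ T ∧ e₂ ∉ T ∧ g ∉ T ∧ e₁ ≠ e₂ ∧ g ≠ e₁ ∧ g ≠ e₂ ∧
        ¬ (G.fst e₁ = v ↔ G.snd e₁ = v) ∧ ¬ (G.fst e₂ = v ↔ G.snd e₂ = v) ∧
        ¬ (G.fst g = v ↔ G.snd g = v) ∧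
        ¬ (G.fst e₁ = w ↔ G.snd e₁ = w) ∧ ¬ (G.fst e₂ = w ↔ G.snd e₂ = w) := by
    by_cases hw1 : (G.fst m₁ = w ↔ G.snd m₁ = w)
    · exact ⟨m₂, m₃, m₁, hm₂, hm₃, hm₁, h23, h12, h13, hc₂, hc₃, hc₁,
        hA hm₁ hm₂ h12 hc₁ hc₂ hw1, hA hm₁ hm₃ h13 hc₁ hc₃ hw1⟩
    · by_cases hw2 : (G.fst m₂ = w ↔ G.snd m₂ = w)
      · exact ⟨m₁, m₃, m₂, hm₁, hm₃, hm₂, h13, h12.symm, h23, hc₁, hc₃, hc₂, hw1,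
          hA hm₂ hm₃ h23 hc₂ hc₃ hw2⟩
      · exact ⟨m₁, m₂, m₃, hm₁, hm₂, hm₃, h12, h13.symm, h23.symm, hc₁, hc₂, hc₃, hw1, hw2⟩
  have hje₁ : G.Joins e₁ v w := hjoin hv₁ hw₁
  have hje₂ : G.Joins e₂ v w := hjoin hv₂ hw₂
  have honly_vw : ∀ {l : L}, G.Joins l v w → l = e₁ ∨ l = e₂ := by
    intro l hl
    by_cases hle : l = e₁
    · exact Or.inl hle
    · exact Or.inr (G.parallel_le_two hev h2 ha hsk hnd h3 hje₁ hwv hl hje₂ hle he12.symm)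
  have hgw : G.fst g ≠ w ∧ G.snd g ≠ w := by
    obtain ⟨x, hxv, hgx⟩ := G.exists_joins_of_end hvg
    by_contra hcon
    have hw' : G.fst g = w ∨ G.snd g = w := by
      by_cases h1 : G.fst g = w
      · exact Or.inl h1
      · right
        by_contra h2'
        exact hcon ⟨h1, h2'⟩
    have hxw : x = w := G.end_eq_of_joins_of_end hgx hw' hwv
    rw [hxw] at hgx
    rcases honly_vw hgx with h | h
    · exact hg1 h
    · exact hg2 h
  refine ⟨w, hwv, fun h => huw h.symm, e₁, e₂, g, he12, hg1, hg2, fun h => hgT (h ▸ hl₀),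
    fun h => he₁T (h ▸ hl₀), fun h => he₂T (h ▸ hl₀), hje₁, hje₂, hvg, hgw.1, hgw.2, ?_⟩
  intro l hl
  by_cases hl0 : l = l₀
  · exact Or.inl hl0
  have hlT : l ∉ T := hnT hl hl0
  by_cases hjl : G.Joins l v w
  · rcases honly_vw hjl with h | h
    · exact Or.inr (Or.inl h)
    · exact Or.inr (Or.inr (Or.inl h))
  · have hlw : (G.fst l = w ↔ G.snd l = w) := by
      by_contra hlw
      exact hjl (hjoin hl hlw)
    right; right; right
    by_contra hlg
    exact (hA hlT hgT hlg hl hvg hlw) ⟨fun h => absurd h hgw.1, fun h => absurd h hgw.2⟩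

/-- P9: the local pattern "one bubble `v =2= w` and two single lines `v–z`, `v–z'` to two further
vertices" is impossible in a non-DOL `t = 0` two-legged skeleton graph: with `T` a spanning tree in
which `v` hangs by `l₀ = v–z` and `θ` a tree line separating `z` from `z'`, parity forces the
non-tree lines crossing `θ` to be exactly the bubble and `v–z'`, and then the side of `z'` together
with `v` is left by only two lines (`θ` and `l₀`), against the cut bound `≥ 4`.
[cite: FeldmanSalmhoferTrubowitz1999, Thm 3.11 (proof) p0018:L54-57] -/
theorem no_single_lines (hev : G.EvenIncidence) (h2 : G.IsTwoLegged) {a : V} (ha : G.ext a = 2)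
    (hsk : G.IsSkeleton) (hnd : ¬ G.IsDOL) {v z z' w : V} {l₀ f e₁ e₂ : L}
    (hzv : z ≠ v) (hz'v : z' ≠ v) (hwv : w ≠ v) (hzz' : z ≠ z') (hwz : w ≠ z) (hwz' : w ≠ z')
    (hl₀ : G.Joins l₀ v z) (hf : G.Joins f v z') (he₁ : G.Joins e₁ v w) (he₂ : G.Joins e₂ v w)
    (he12 : e₁ ≠ e₂)
    (hall : ∀ l : L, ¬ (G.fst l = v ↔ G.snd l = v) → (l = l₀ ∨ l = e₁ ∨ l = e₂ ∨ l = f)) :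
    False := by
  classical
  -- distinctness of the named lines
  have he₁f : e₁ ≠ f := fun h => hwz' (G.end_eq_of_joins he₁ (h ▸ hf) hwv)
  have he₂f : e₂ ≠ f := fun h => hwz' (G.end_eq_of_joins he₂ (h ▸ hf) hwv)
  have he₁l : e₁ ≠ l₀ := fun h => hwz (G.end_eq_of_joins he₁ (h ▸ hl₀) hwv)
  have he₂l : e₂ ≠ l₀ := fun h => hwz (G.end_eq_of_joins he₂ (h ▸ hl₀) hwv)
  have hfl : f ≠ l₀ := fun h => hzz' (G.end_eq_of_joins (h ▸ hl₀) hf hzv)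
  -- the leaf tree through `l₀`
  have hconn := G.isConnectedOn_compl_singleton_of_not_isDOL hev h2 ha hsk hnd v
  obtain ⟨T, hT, hl₀T, hl₀v, hleafv⟩ := G.exists_isSpanningTree_leaf hconn hl₀ hzv
  have hXv : ∀ l, G.LoopContains T l l₀ ↔ ¬ (G.fst l = v ↔ G.snd l = v) :=
    hT.loopContains_leaf_iff G hl₀T hl₀v hleafv
  have hnT : ∀ {l : L} {x : V}, G.Joins l v x → l ≠ l₀ → l ∉ T := by
    intro l x hl hne hlT
    have h := hleafv l hlT hne
    rcases hl with ⟨h1, _⟩ | ⟨_, h2'⟩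
    · exact h.1 h1
    · exact h.2 h2'
  have he₁T : e₁ ∉ T := hnT he₁ he₁l
  have he₂T : e₂ ∉ T := hnT he₂ he₂l
  have hfT : f ∉ T := hnT hf hfl
  -- a tree line separating `z` from `z'`
  obtain ⟨θ, hθ, hsep⟩ := hT.exists_separating G hzz'
  have hX := hT.loopContains_iff G θ
  have hθl₀ : θ ≠ l₀ := by
    intro h
    rw [h] at hsep
    apply hsep
    rw [hT.side_leaf_iff G hl₀T hl₀v hleafv z, hT.side_leaf_iff G hl₀T hl₀v hleafv z']
    simp [hzv, hz'v]
  have hl₀' : l₀ ∈ T.erase θ := Finset.mem_erase.mpr ⟨fun h => hθl₀ h.symm, hl₀T⟩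
  have hvz : (G.Reachable (T.erase θ) (G.fst θ) v ↔ G.Reachable (T.erase θ) (G.fst θ) z) :=
    ⟨fun h => h.tail ⟨l₀, hl₀', hl₀⟩, fun h => h.tail ⟨l₀, hl₀', hl₀.symm⟩⟩
  have hvz' : ¬ (G.Reachable (T.erase θ) (G.fst θ) v ↔ G.Reachable (T.erase θ) (G.fst θ) z') :=
    fun h => hsep (hvz.symm.trans h)
  -- `f`, `e₁`, `e₂` cross `θ`
  have hcf : G.LoopContains T f θ := by
    rw [hX]
    rcases hf with ⟨h1, h2'⟩ | ⟨h1, h2'⟩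
    · rw [h1, h2']; exact hvz'
    · rw [h1, h2']; exact fun h => hvz' h.symm
  have hce₁ : G.LoopContains T e₁ θ := by
    by_contra hn
    have hc2 := G.loopContains_of_not_isDOL hev h2 ha hsk hnd hT hθ hl₀T hθl₀ he₁T he₂T he12
      ((hXv _).mpr (G.end_iff_of_joins he₁ hwv)) ((hXv _).mpr (G.end_iff_of_joins he₂ hwv)) hn
    exact hn (G.loopContains_of_joins_of_joins he₂ he₁ hc2)
  have hce₂ : G.LoopContains T e₂ θ := G.loopContains_of_joins_of_joins he₁ he₂ hce₁
  -- `w` lies on the side of `z'`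
  have hw : (G.Reachable (T.erase θ) (G.fst θ) w ↔ G.Reachable (T.erase θ) (G.fst θ) z') := by
    have h1 : ¬ (G.Reachable (T.erase θ) (G.fst θ) v ↔ G.Reachable (T.erase θ) (G.fst θ) w) := by
      have hc := hce₁
      rw [hX] at hc
      rcases he₁ with ⟨h1, h2'⟩ | ⟨h1, h2'⟩
      · rw [h1, h2'] at hc; exact hc
      · rw [h1, h2'] at hc; exact fun h => hc h.symm
    exact iff_of_not_iff_of_not_iff h1 hvz'
  -- the non-tree lines crossing `θ` are exactly `e₁`, `e₂`, `f`
  have hN : ∀ g, g ∉ T → G.LoopContains T g θ → g = e₁ ∨ g = e₂ ∨ g = f := by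
    intro g hgT hgc
    by_contra hcon
    have hg1 : g ≠ e₁ := fun h => hcon (Or.inl h)
    have hg2 : g ≠ e₂ := fun h => hcon (Or.inr (Or.inl h))
    have hg3 : g ≠ f := fun h => hcon (Or.inr (Or.inr h))
    have hgv : (G.fst g = v ↔ G.snd g = v) := by
      by_contra hgv
      rcases hall g hgv with h | h | h | h
      · exact hgT (h ▸ hl₀T)
      · exact hg1 h
      · exact hg2 h
      · exact hg3 h
    have hS := G.odd_card_filter_loopContains hev h2 ha hT hθ
    have hSeq : (Finset.univ.filter fun l => l ∉ T ∧ G.LoopContains T l θ) = {e₁, e₂, f, g} := by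
      ext s
      simp only [Finset.mem_filter, Finset.mem_univ, true_and, Finset.mem_insert,
        Finset.mem_singleton]
      constructor
      · rintro ⟨hsT, hsc⟩
        by_cases hsv : (G.fst s = v ↔ G.snd s = v)
        · right; right; right
          by_contra hsg
          have h := G.loopContains_of_not_isDOL hev h2 ha hsk hnd hT hl₀T hθ (Ne.symm hθl₀) hgT hsT
            (Ne.symm hsg) hgc hsc (fun h => (hXv g).mp h hgv)
          exact (hXv s).mp h hsv
        · rcases hall s hsv with h | h | h | h
          · exact absurd (h ▸ hl₀T) hsT
          · exact Or.inl h
          · exact Or.inr (Or.inl h)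
          · exact Or.inr (Or.inr (Or.inl h))
      · rintro (rfl | rfl | rfl | rfl)
        exacts [⟨he₁T, hce₁⟩, ⟨he₂T, hce₂⟩, ⟨hfT, hcf⟩, ⟨hgT, hgc⟩]
    rw [hSeq, Finset.card_insert_of_notMem (by simp [he12, he₁f, hg1.symm]),
      Finset.card_insert_of_notMem (by simp [he₂f, hg2.symm]), Finset.card_pair hg3.symm] at hS
    rcases hS with ⟨k, hk⟩
    omega
  -- the cut `A' = {v} ∪ (side of z')` is left only by `θ` and `l₀`
  set A' : Finset V := insert v (Finset.univ.filter fun s =>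
    (G.Reachable (T.erase θ) (G.fst θ) s ↔ G.Reachable (T.erase θ) (G.fst θ) z')) with hA'
  have hmemA' : ∀ s, s ∈ A' ↔ s = v ∨
      (G.Reachable (T.erase θ) (G.fst θ) s ↔ G.Reachable (T.erase θ) (G.fst θ) z') := by
    intro s
    simp [hA']
  have hsub : G.linesBetween A' A'ᶜ ⊆ {θ, l₀} := by
    intro l hl
    rw [G.mem_linesBetween_iff] at hl
    obtain ⟨p, hp, q, hq, hjl⟩ := hl
    rw [Finset.mem_compl, hmemA', not_or] at hq
    rw [hmemA'] at hp
    simp only [Finset.mem_insert, Finset.mem_singleton]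
    by_cases hlv : (G.fst l = v ↔ G.snd l = v)
    · -- `l` has no end at `v` (a self-contraction at `v` cannot leave `A'`)
      have hends : G.fst l ≠ v ∧ G.snd l ≠ v := by
        rcases hjl with ⟨h1, h2'⟩ | ⟨h1, h2'⟩
        · exact ⟨fun h => hq.1 (h2'.symm.trans (hlv.mp h)), fun h => hq.1 (h2'.symm.trans h)⟩
        · exact ⟨fun h => hq.1 (h1.symm.trans h), fun h => hq.1 (h1.symm.trans (hlv.mpr h))⟩
      have hpv : p ≠ v := by
        rcases hjl with ⟨h1, _⟩ | ⟨_, h2'⟩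
        · exact fun h => hends.1 (h1.trans h)
        · exact fun h => hends.2 (h2'.trans h)
      have hp' := hp.resolve_left hpv
      have hlc : G.LoopContains T l θ := by
        rw [hX]
        rcases hjl with ⟨h1, h2'⟩ | ⟨h1, h2'⟩
        · rw [h1, h2']; exact fun h => hq.2 (h.symm.trans hp')
        · rw [h1, h2']; exact fun h => hq.2 (h.trans hp')
      by_cases hlT : l ∈ T
      · exact Or.inl (G.eq_of_mem_of_loopContains hlT hlc)
      · exfalso
        rcases hN l hlT hlc with rfl | rfl | rfl
        · rcases he₁ with ⟨h1, _⟩ | ⟨_, h2'⟩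
          · exact hends.1 h1
          · exact hends.2 h2'
        · rcases he₂ with ⟨h1, _⟩ | ⟨_, h2'⟩
          · exact hends.1 h1
          · exact hends.2 h2'
        · rcases hf with ⟨h1, _⟩ | ⟨_, h2'⟩
          · exact hends.1 h1
          · exact hends.2 h2'
    · rcases hall l hlv with rfl | rfl | rfl | rfl
      · exact Or.inr rfl
      · exfalso
        rcases he₁.eq_or_eq hjl with ⟨_, h⟩ | ⟨h, _⟩
        · exact hq.2 (h ▸ hw)
        · exact hq.1 h.symm
      · exfalso
        rcases he₂.eq_or_eq hjl with ⟨_, h⟩ | ⟨h, _⟩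
        · exact hq.2 (h ▸ hw)
        · exact hq.1 h.symm
      · exfalso
        rcases hf.eq_or_eq hjl with ⟨_, h⟩ | ⟨h, _⟩
        · exact hq.2 (h ▸ Iff.rfl)
        · exact hq.1 h.symm
  have hcard := Finset.card_le_card hsub
  have h2' : ({θ, l₀} : Finset L).card ≤ 2 := Finset.card_le_two
  have hzA : z ∉ A' := by
    rw [hmemA', not_or]
    exact ⟨hzv, hsep⟩
  have h4 := G.four_le_card_linesBetween_compl' hev h2 ha hsk (W := A')
    ⟨v, (hmemA' v).mpr (Or.inl rfl)⟩ ⟨z, Finset.mem_compl.mpr hzA⟩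
  omega

/-- **Local form of the ring.** In a non-DOL `t = 0` two-legged skeleton graph with at least three
vertices, every vertex `v` is joined to exactly two other vertices, by exactly two lines each (and
to nothing else, self-contractions apart).
[cite: FeldmanSalmhoferTrubowitz1999, Thm 3.11 (proof) p0018:L54-57] -/
theorem tZero_local_ring (hev : G.EvenIncidence) (h2 : G.IsTwoLegged) {a : V} (ha : G.ext a = 2)
    (hsk : G.IsSkeleton) (hnd : ¬ G.IsDOL) (h3 : 3 ≤ Fintype.card V) (v : V) :
    ∃ w₁ w₂ : V, w₁ ≠ v ∧ w₂ ≠ v ∧ w₁ ≠ w₂ ∧ ∃ e₁ e₂ e₃ e₄ : L,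
      e₁ ≠ e₂ ∧ e₃ ≠ e₄ ∧ e₁ ≠ e₃ ∧ e₁ ≠ e₄ ∧ e₂ ≠ e₃ ∧ e₂ ≠ e₄ ∧
      G.Joins e₁ v w₁ ∧ G.Joins e₂ v w₁ ∧ G.Joins e₃ v w₂ ∧ G.Joins e₄ v w₂ ∧
      ∀ l : L, ¬ (G.fst l = v ↔ G.snd l = v) → (l = e₁ ∨ l = e₂ ∨ l = e₃ ∨ l = e₄) := by
  classical
  -- a line leaving `v`
  have hne : (({v} : Finset V)ᶜ).Nonempty := by
    obtain ⟨x, hx⟩ := Fintype.exists_ne_of_one_lt_card (by omega : 1 < Fintype.card V) v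
    exact ⟨x, by simp [hx]⟩
  have h4 := G.four_le_card_linesBetween_compl' hev h2 ha hsk ⟨v, Finset.mem_singleton_self v⟩ hne
  obtain ⟨l₀, hl₀⟩ : (G.linesBetween {v} {v}ᶜ).Nonempty := Finset.card_pos.mp (by omega)
  rw [G.mem_linesBetween_iff] at hl₀
  obtain ⟨p, hp, u, hu, hj⟩ := hl₀
  rw [Finset.mem_singleton] at hp
  subst hp
  have huv : u ≠ p := by simpa using hu
  obtain ⟨w, hwv, hwu, e₁, e₂, f, he12, hf1, hf2, hfl, he1l, he2l, hje₁, hje₂, hfv, hfw1, hfw2,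
    hall⟩ := G.local_lines hev h2 ha hsk hnd h3 hj huv
  obtain ⟨x, hxv, hfx⟩ := G.exists_joins_of_end hfv
  have hxw : x ≠ w := by
    intro h
    rw [h] at hfx
    rcases hfx with ⟨_, h2'⟩ | ⟨h1, _⟩
    · exact hfw2 h2'
    · exact hfw1 h1
  by_cases hxu : x = u
  · rw [hxu] at hfx
    refine ⟨w, u, hwv, huv, hwu, e₁, e₂, l₀, f, he12, fun h => hfl h.symm, he1l,
      fun h => hf1 h.symm, he2l, fun h => hf2 h.symm, hje₁, hje₂, hj, hfx, ?_⟩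
    intro l hl
    rcases hall l hl with h | h | h | h
    · exact Or.inr (Or.inr (Or.inl h))
    · exact Or.inl h
    · exact Or.inr (Or.inl h)
    · exact Or.inr (Or.inr (Or.inr h))
  · exact (G.no_single_lines hev h2 ha hsk hnd huv hxv hwv (Ne.symm hxu) hwu
      (fun h => hxw h.symm) hj hfx hje₁ hje₂ he12 hall).elim

/-- **THE `t = 0` CLASSIFICATION (the one-external-vertex twin of Theorem 2.6).** A non-DOL two-legged
skeleton graph with even incidence numbers and both external legs at one vertex either has exactly
two vertices (a fat tadpole: the external vertex joined by `2m ≥ 4` lines to one further vertex,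
`six_le_incidence_of_ext_eq_two`), or is — self-contractions apart — a RING OF BUBBLES through the
external vertex: every vertex is joined to exactly two other vertices, by exactly two lines each
(so the multigraph is a doubled cycle through all `≥ 3` vertices, `G` being connected). This makes
Flag 1 of the statement file ("a vertex carrying both external legs joined by four lines to a
four-legged vertex … more generally rings of bubbles through the external vertex") exhaustive.
Proof (not in the print, which does not need it: "Otherwise, `G` is overlapping", p0018:L57): cuts
of a `t = 0` skeleton have `≥ 4` lines; `¬`DOL says that for two tree lines `θ ≠ ζ` at most one
non-tree line crosses `ζ` without crossing `θ`; whence no cut vertex, leaf spanning trees, at most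
two parallel lines, the local structure "one bubble plus two lines" at every vertex, and finally the
exclusion of two single lines by a parity count across a separating tree line.
[cite: FeldmanSalmhoferTrubowitz1999, Thm 3.11 (proof) p0018:L54-57] -/
theorem tZero_classification (hev : G.EvenIncidence) (h2 : G.IsTwoLegged) {a : V}
    (ha : G.ext a = 2) (hsk : G.IsSkeleton) (hnd : ¬ G.IsDOL) :
    Fintype.card V = 2 ∨
      ∀ v : V, ∃ w₁ w₂ : V, w₁ ≠ v ∧ w₂ ≠ v ∧ w₁ ≠ w₂ ∧
        G.lineCount v w₁ = 2 ∧ G.lineCount v w₂ = 2 ∧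
        ∀ x : V, x ≠ v → x ≠ w₁ → x ≠ w₂ → G.lineCount v x = 0 := by
  classical
  by_cases h3 : 3 ≤ Fintype.card V
  · right
    intro v
    obtain ⟨w₁, w₂, hw₁, hw₂, hw12, e₁, e₂, e₃, e₄, h12, h34, h13, h14, h23, h24, hj₁, hj₂, hj₃,
      hj₄, hall⟩ := G.tZero_local_ring hev h2 ha hsk hnd h3 v
    refine ⟨w₁, w₂, hw₁, hw₂, hw12, ?_, ?_, ?_⟩
    · unfold lineCount
      have hset : (Finset.univ.filter fun l => G.Joins l v w₁) = {e₁, e₂} := by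
        ext l
        simp only [Finset.mem_filter, Finset.mem_univ, true_and, Finset.mem_insert,
          Finset.mem_singleton]
        constructor
        · intro hl
          rcases hall l (G.end_iff_of_joins hl hw₁) with rfl | rfl | rfl | rfl
          · exact Or.inl rfl
          · exact Or.inr rfl
          · exact absurd (G.end_eq_of_joins hl hj₃ hw₁) hw12
          · exact absurd (G.end_eq_of_joins hl hj₄ hw₁) hw12
        · rintro (rfl | rfl)
          · exact hj₁
          · exact hj₂
      rw [hset, Finset.card_pair h12]
    · unfold lineCount
      have hset : (Finset.univ.filter fun l => G.Joins l v w₂) = {e₃, e₄} := by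
        ext l
        simp only [Finset.mem_filter, Finset.mem_univ, true_and, Finset.mem_insert,
          Finset.mem_singleton]
        constructor
        · intro hl
          rcases hall l (G.end_iff_of_joins hl hw₂) with rfl | rfl | rfl | rfl
          · exact absurd (G.end_eq_of_joins hl hj₁ hw₂) (Ne.symm hw12)
          · exact absurd (G.end_eq_of_joins hl hj₂ hw₂) (Ne.symm hw12)
          · exact Or.inl rfl
          · exact Or.inr rfl
        · rintro (rfl | rfl)
          · exact hj₃
          · exact hj₄
      rw [hset, Finset.card_pair h34]
    · intro x hxv hx1 hx2
      unfold lineCount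
      rw [Finset.card_eq_zero, Finset.filter_eq_empty_iff]
      intro l _ hl
      rcases hall l (G.end_iff_of_joins hl hxv) with rfl | rfl | rfl | rfl
      · exact hx1 (G.end_eq_of_joins hl hj₁ hxv)
      · exact hx1 (G.end_eq_of_joins hl hj₂ hxv)
      · exact hx2 (G.end_eq_of_joins hl hj₃ hxv)
      · exact hx2 (G.end_eq_of_joins hl hj₄ hxv)
  · left
    have := hsk.2.1
    omega

end TZeroRing

end FGraph

/-- **Lemma 2.5 reduces to Theorem 2.4.** Since the Figure-3 clause is proved
(`FGraph.lemma25_figure3`), the named fact `lemma25` follows from — indeed is equivalent to — its first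
conclusion "all two–legged skeleton graphs with `t ≥ 2` are doubly overlapping" (Theorem 2.4, p0005:L39–40);
this is what remains to be proved to discharge licence F-035.
[cite: FeldmanSalmhoferTrubowitz1999, Thm 2.4 p0005:L39-41] -/
theorem lemma25_of_theorem24
    (h : ∀ (V L : Type) [Fintype V] [DecidableEq V] [Fintype L] [DecidableEq L] (G : FGraph V L)
      (a b : V), G.EvenIncidence → G.IsTwoLegged → G.ext a = 1 → G.ext b = 1 → G.IsSkeleton →
        2 ≤ G.edist a b → G.IsDOL) :
    lemma25 := by
  intro V L _ _ _ _ G a b hev h2 ha hb hsk ht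
  exact ⟨h V L G a b hev h2 ha hb hsk ht,
    fun r s hrs hst => G.lemma25_figure3 hev h2 ha hb hsk ht hrs hst⟩

/-- Conversely Theorem 2.4 is the first conclusion of `lemma25` (`theorem24`); together:
`lemma25` is EQUIVALENT to Theorem 2.4 for these definitions.
[cite: FeldmanSalmhoferTrubowitz1999, Thm 2.4 p0005:L39-41] -/
theorem lemma25_iff_theorem24 :
    lemma25 ↔ ∀ (V L : Type) [Fintype V] [DecidableEq V] [Fintype L] [DecidableEq L] (G : FGraph V L)
      (a b : V), G.EvenIncidence → G.IsTwoLegged → G.ext a = 1 → G.ext b = 1 → G.IsSkeleton →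
        2 ≤ G.edist a b → G.IsDOL :=
  ⟨fun h _ _ _ _ _ _ G a b hev h2 ha hb hsk ht => theorem24 h G a b hev h2 ha hb hsk ht,
    lemma25_of_theorem24⟩

/-- **Theorem 2.4, PROVED** (p0005:L39–40): every two-legged skeleton graph (even incidence numbers,
one external leg at each of `a`, `b`) with `t = edist a b ≥ 2` is doubly overlapping — for the
definitions of `FST3GraphClassification.lean` (`FGraph.isDOL_of_two_le_edist`).
[cite: FeldmanSalmhoferTrubowitz1999, Thm 2.4 p0005:L39-41] -/
theorem theorem24_holds :
    ∀ (V L : Type) [Fintype V] [DecidableEq V] [Fintype L] [DecidableEq L] (G : FGraph V L)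
      (a b : V), G.EvenIncidence → G.IsTwoLegged → G.ext a = 1 → G.ext b = 1 → G.IsSkeleton →
        2 ≤ G.edist a b → G.IsDOL :=
  fun _ _ _ _ _ _ G _ _ hev h2 ha hb hsk ht => G.isDOL_of_two_le_edist hev h2 ha hb hsk ht

/-- **DISCHARGE of the named fact `lemma25` (FST III Lemma 2.5, licence F-035)**: Theorem 2.4 is
proved (`theorem24_holds`) and the Figure-3 clause is proved (`FGraph.lemma25_figure3`).
[cite: FeldmanSalmhoferTrubowitz1999, Lemma 2.5 p0005:L43-47] -/
theorem lemma25_holds : lemma25 := lemma25_of_theorem24 theorem24_holds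

end FST3

end Literature.MathematicalPhysics.QuantumLattice.FermiRG
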